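import Literature.Barriers.PneNP.TSPExtensionComplexityRothvossSlots
import Mathlib.Data.Finset.Powerset
import Mathlib.Data.Nat.Choose.Basic
import HarnessLib
import Mathlib.Algebra.Order.BigOperators.Ring.Finset
import Literature.Barriers.PneNP.TSPExtensionComplexityRothvossAveraging
import Mathlib.Tactic.FieldSimp
import Mathlib.Tactic.Ring
import Mathlib.Tactic.Linarith
import Mathlib.Tactic.Positivity
import Mathlib.Tactic.NormNum

/-!
# Rothvoß 2017 for TSP — core of §3 (slot model: cuts, matchings, the weight matrix, re-indexings, good pairs, Lemma 9, exchange)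

This module concatenates, in dependency order, the support files listed below (each keeps its own
module docstring); see those docstrings for the mathematical content and the sources.

Parts: TSPExtensionComplexityRothvossCuts, TSPExtensionComplexityRothvossMex, TSPExtensionComplexityRothvossW, TSPExtensionComplexityRothvossPerms, TSPExtensionComplexityRothvossTheta, TSPExtensionComplexityRothvossTheta2, TSPExtensionComplexityRothvossGood, TSPExtensionComplexityRothvossLemma9, TSPExtensionComplexityRothvossExchange.
-/


/-! ## Part: `TSPExtensionComplexityRothvossCuts` -/

/-!
# Rothvoß's partitions, II: the cuts respecting a partition

Support file for the discharge of `Literature.Barriers.PneNP.Rothvoss2017_tsp` (Rothvoß 2017,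
§3), continuing `…RothvossSlots.lean`. The cuts `U ∈ 𝒰_all(T)` "contain either all or none of
the nodes in each `A_i`" (§3.1, PDF p. 8), so a cut with prescribed trace on `C` is a union of
`c = V(H) ∩ C` with `(m+1)/2` of the `A`-type blocks. Writing `Ã_j` (`j ≤ m`) for the blocks
`A_j` (`j < m`) together with `Ã_m = C ∖ c`, and `U_I = c ∪ ⋃_{j ∈ I} Ã_j`:

* `mem_Uex3_iff`: `𝒰ex(T,H) = {U_I : |I| = μ+1, m ∉ I}`; `mem_UexC_iff`: the cuts with
  `U ∩ C = C` are `{U_I : |I| = μ+1, m ∈ I}` (here `m = 2μ+1`, `t = (μ+1)q + 3`, `q ≥ 1`);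
* `cutOf_injective`; `card_Uex3`, `card_UexC`: both families have `C(m, μ+1) = C(m, μ)`
  members — "we only consider cuts `U` of size `|U| = t` … hence `p_{U,T}(c) > 0` only if
  `|c| ∈ {3, k}`" (§3.2, PDF p. 8), in particular they are nonempty.

Sources: [Rothvoss2017] §3.1–3.2 (PDF p. 8).
-/

namespace Literature.Barriers.PneNP

open Finset Slot

variable {m q : ℕ}

/-- The `A`-type blocks `Ã_j = π⁻¹{a j ·}` (`Ã_m = C ∖ c`). [cite: Rothvoss2017, §3.1 (PDF p. 8)] -/
def Atil (π : Equiv.Perm (Slot m q)) (j : Fin (m + 1)) : Finset (Slot m q) := pull π (aSlots j)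

/-- Auxiliary (`Ablk_eq_Atil`). [folklore] -/
theorem Ablk_eq_Atil (π : Equiv.Perm (Slot m q)) (i : Fin m) : Ablk π i = Atil π (Fin.castSucc i) := rfl

/-- Auxiliary (`mem_Atil`). [folklore] -/
@[simp] theorem mem_Atil {π : Equiv.Perm (Slot m q)} {j : Fin (m + 1)} {v : Slot m q} :
    v ∈ Atil π j ↔ ∃ x, π v = a j x := by
  simp [Atil, mem_pull]

/-- Auxiliary (`mem_cset`). [folklore] -/
@[simp] theorem mem_cset {π : Equiv.Perm (Slot m q)} {v : Slot m q} : v ∈ cset π ↔ ∃ t, π v = c t := by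
  simp [cset, mem_pull]

/-- Auxiliary (`card_Atil`). [folklore] -/
theorem card_Atil (π : Equiv.Perm (Slot m q)) (j : Fin (m + 1)) : (Atil π j).card = q := by
  rw [Atil, card_pull, card_aSlots]

/-- Auxiliary (`card_cset`). [folklore] -/
theorem card_cset (π : Equiv.Perm (Slot m q)) : (cset π).card = 3 := by
  rw [cset, card_pull, card_cSlots]

/-- Auxiliary (`disjoint_Atil`). [folklore] -/
theorem disjoint_Atil {π : Equiv.Perm (Slot m q)} {j j' : Fin (m + 1)} (h : j ≠ j') :
    Disjoint (Atil π j) (Atil π j') := by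
  rw [disjoint_left]
  rintro v hv hv'
  obtain ⟨x, hx⟩ := mem_Atil.1 hv
  obtain ⟨x', hx'⟩ := mem_Atil.1 hv'
  rw [hx] at hx'
  simp only [Slot.a.injEq] at hx'
  exact h hx'.1

/-- Auxiliary (`disjoint_cset_Atil`). [folklore] -/
theorem disjoint_cset_Atil (π : Equiv.Perm (Slot m q)) (j : Fin (m + 1)) :
    Disjoint (cset π) (Atil π j) := by
  rw [disjoint_left]
  rintro v hv hv'
  obtain ⟨t, ht⟩ := mem_cset.1 hv
  obtain ⟨x, hx⟩ := mem_Atil.1 hv'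
  rw [ht] at hx
  simp at hx

/-- `C = c ∪ Ã_m`. [folklore] -/
theorem Cset_eq (π : Equiv.Perm (Slot m q)) : Cset π = cset π ∪ Atil π (Fin.last m) := by
  rw [Cset, CSlots_eq, pull_union]
  rfl

/-- The cut `U_I = c ∪ ⋃_{j ∈ I} Ã_j`. [cite: Rothvoss2017, §3.1 (PDF p. 8)] -/
def cutOf (π : Equiv.Perm (Slot m q)) (I : Finset (Fin (m + 1))) : Finset (Slot m q) :=
  cset π ∪ I.biUnion (Atil π)

/-- Auxiliary (`mem_cutOf`). [folklore] -/
theorem mem_cutOf {π : Equiv.Perm (Slot m q)} {I : Finset (Fin (m + 1))} {v : Slot m q} :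
    v ∈ cutOf π I ↔ v ∈ cset π ∨ ∃ j ∈ I, v ∈ Atil π j := by
  simp [cutOf]

/-- Auxiliary (`card_cutOf`). [folklore] -/
theorem card_cutOf (π : Equiv.Perm (Slot m q)) (I : Finset (Fin (m + 1))) :
    (cutOf π I).card = 3 + q * I.card := by
  have hdisj : Disjoint (cset π) (I.biUnion (Atil π)) := by
    rw [disjoint_biUnion_right]
    intro j _
    exact disjoint_cset_Atil π j
  have hpw : ∀ j ∈ I, ∀ j' ∈ I, j ≠ j' → Disjoint (Atil π j) (Atil π j') :=
    fun j _ j' _ hjj' => disjoint_Atil hjj'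
  rw [cutOf, card_union_of_disjoint hdisj, card_cset, card_biUnion hpw]
  simp only [card_Atil, sum_const, smul_eq_mul, mul_comm]

/-- Auxiliary (`Atil_subset_cutOf_iff`). [folklore] -/
theorem Atil_subset_cutOf_iff {π : Equiv.Perm (Slot m q)} (hq : 0 < q) {I : Finset (Fin (m + 1))}
    {j : Fin (m + 1)} : Atil π j ⊆ cutOf π I ↔ j ∈ I := by
  constructor
  · intro h
    have hne : (Atil π j).Nonempty := by
      rw [← card_pos, card_Atil]; exact hq
    obtain ⟨v, hv⟩ := hne
    rcases mem_cutOf.1 (h hv) with hc | ⟨j', hj', hv'⟩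
    · exact (disjoint_left.1 (disjoint_cset_Atil π j) hc hv).elim
    · by_contra hj
      have : j ≠ j' := fun h' => hj (h' ▸ hj')
      exact disjoint_left.1 (disjoint_Atil this) hv hv'
  · intro hj v hv
    exact mem_cutOf.2 (Or.inr ⟨j, hj, hv⟩)

/-- Auxiliary (`disjoint_Atil_cutOf_iff`). [folklore] -/
theorem disjoint_Atil_cutOf_iff {π : Equiv.Perm (Slot m q)} (hq : 0 < q) {I : Finset (Fin (m + 1))}
    {j : Fin (m + 1)} : Disjoint (Atil π j) (cutOf π I) ↔ j ∉ I := by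
  constructor
  · intro h hj
    have hne : (Atil π j).Nonempty := by
      rw [← card_pos, card_Atil]; exact hq
    obtain ⟨v, hv⟩ := hne
    exact disjoint_left.1 h hv (mem_cutOf.2 (Or.inr ⟨j, hj, hv⟩))
  · intro hj
    rw [disjoint_left]
    intro v hv hv'
    rcases mem_cutOf.1 hv' with hc | ⟨j', hj', hvj'⟩
    · exact disjoint_left.1 (disjoint_cset_Atil π j) hc hv
    · have : j ≠ j' := fun h' => hj (h' ▸ hj')
      exact disjoint_left.1 (disjoint_Atil this) hv hvj'

/-- `I ↦ U_I` is injective (`q ≥ 1`). [folklore] -/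
theorem cutOf_injective {π : Equiv.Perm (Slot m q)} (hq : 0 < q) :
    Function.Injective (cutOf π) := by
  intro I I' h
  ext j
  rw [← Atil_subset_cutOf_iff (π := π) hq (I := I), h, Atil_subset_cutOf_iff hq]

/-- The slot of a vertex of `A ∪ C` is an `a`-slot or a `c`-slot. [folklore] -/
theorem isAC_iff (s : Slot m q) : isAC s = true ↔ (∃ j x, s = a j x) ∨ ∃ t, s = c t := by
  rcases s with ⟨j, x⟩ | t | t | x | ⟨i, sd, x⟩ <;> simp [isAC]

/-- **`𝒰ex(T,H)` described**: the cuts of `𝒰_all(T)` with `U ∩ C = c` are the `U_I` with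
`|I| = μ + 1` and `m ∉ I`. [cite: Rothvoss2017, §3.1–3.2 (PDF p. 8)] -/
theorem mem_Uex3_iff {μ : ℕ} (hq : 0 < q) {π : Equiv.Perm (Slot m q)} {U : Finset (Slot m q)} :
    U ∈ Uex3 μ π ↔ ∃ I : Finset (Fin (m + 1)), I.card = μ + 1 ∧ Fin.last m ∉ I ∧ U = cutOf π I := by
  constructor
  · intro hU
    simp only [Uex3, UallP, mem_filter, mem_univ, true_and] at hU
    obtain ⟨⟨hcard, hAC, hblk⟩, hcap⟩ := hU
    set I : Finset (Fin (m + 1)) := univ.filter fun j => Atil π j ⊆ U with hI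
    have hcU : cset π ⊆ U := fun v hv => by
      have : v ∈ U ∩ Cset π := by
        rw [hcap]; exact hv
      exact (mem_inter.1 this).1
    have hlast : Fin.last m ∉ I := by
      intro h
      rw [hI, mem_filter] at h
      have hne : (Atil π (Fin.last m)).Nonempty := by rw [← card_pos, card_Atil]; exact hq
      obtain ⟨v, hv⟩ := hne
      have hvU := h.2 hv
      have : v ∈ U ∩ Cset π := mem_inter.2 ⟨hvU, by rw [Cset_eq]; exact mem_union_right _ hv⟩
      rw [hcap] at this
      exact disjoint_left.1 (disjoint_cset_Atil π (Fin.last m)) this hv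
    have hUeq : U = cutOf π I := by
      ext v
      rw [mem_cutOf]
      constructor
      · intro hv
        rcases (isAC_iff _).1 (hAC v hv) with ⟨j, x, hjx⟩ | ⟨t, ht⟩
        · right
          have hvA : v ∈ Atil π j := mem_Atil.2 ⟨x, hjx⟩
          refine ⟨j, ?_, hvA⟩
          rw [hI, mem_filter]
          refine ⟨mem_univ _, ?_⟩
          -- `j < m`: the block is in or out, and `v` is in; `j = m` is impossible
          by_cases hj : (j : ℕ) < m
          · have hAblk : Atil π j = Ablk π ⟨j, hj⟩ := by
              rw [Ablk_eq_Atil]; congr 1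
            rcases hblk ⟨j, hj⟩ with hin | hout
            · rwa [hAblk]
            · rw [← hAblk] at hout
              exact absurd hv (disjoint_left.1 hout hvA)
          · have hjl : j = Fin.last m := Fin.ext (by have := j.2; simp [Fin.last]; omega)
            subst hjl
            have : v ∈ U ∩ Cset π := mem_inter.2 ⟨hv, by rw [Cset_eq]; exact mem_union_right _ hvA⟩
            rw [hcap] at this
            exact absurd hvA (disjoint_left.1 (disjoint_cset_Atil π _) this)
        · exact Or.inl (mem_cset.2 ⟨t, ht⟩)
      · rintro (hv | ⟨j, hj, hv⟩)
        · exact hcU hv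
        · rw [hI, mem_filter] at hj
          exact hj.2 hv
    refine ⟨I, ?_, hlast, hUeq⟩
    have := card_cutOf π I
    rw [← hUeq, hcard, tCut] at this
    have h1 : q * I.card = q * (μ + 1) := by have := Nat.mul_comm (μ + 1) q; linarith
    exact Nat.eq_of_mul_eq_mul_left hq h1
  · rintro ⟨I, hI, hlast, rfl⟩
    simp only [Uex3, UallP, mem_filter, mem_univ, true_and]
    refine ⟨⟨?_, ?_, ?_⟩, ?_⟩
    · rw [card_cutOf, hI, tCut]; ring
    · intro v hv
      rcases mem_cutOf.1 hv with hv | ⟨j, -, hv⟩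
      · obtain ⟨t, ht⟩ := mem_cset.1 hv
        rw [ht]; rfl
      · obtain ⟨x, hx⟩ := mem_Atil.1 hv
        rw [hx]; rfl
    · intro i
      by_cases hi : Fin.castSucc i ∈ I
      · exact Or.inl ((Atil_subset_cutOf_iff hq).2 hi)
      · exact Or.inr ((disjoint_Atil_cutOf_iff hq).2 hi)
    · rw [Cset_eq, inter_union_distrib_left]
      have h1 : cutOf π I ∩ cset π = cset π :=
        inter_eq_right.2 fun v hv => mem_cutOf.2 (Or.inl hv)
      have h2 : cutOf π I ∩ Atil π (Fin.last m) = ∅ :=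
        disjoint_iff_inter_eq_empty.1 ((disjoint_Atil_cutOf_iff hq).2 hlast).symm
      rw [h1, h2, union_empty]

/-- **The cuts with `U ∩ C = C` described**: the `U_I` with `|I| = μ + 1` and `m ∈ I`.
[cite: Rothvoss2017, §3.1–3.2 (PDF p. 8)] -/
theorem mem_UexC_iff {μ : ℕ} (hq : 0 < q) {π : Equiv.Perm (Slot m q)} {U : Finset (Slot m q)} :
    U ∈ UexC μ π ↔ ∃ I : Finset (Fin (m + 1)), I.card = μ + 1 ∧ Fin.last m ∈ I ∧ U = cutOf π I := by
  constructor
  · intro hU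
    simp only [UexC, UallP, mem_filter, mem_univ, true_and] at hU
    obtain ⟨⟨hcard, hAC, hblk⟩, hC⟩ := hU
    set I : Finset (Fin (m + 1)) := univ.filter fun j => Atil π j ⊆ U with hI
    rw [Cset_eq, union_subset_iff] at hC
    have hlast : Fin.last m ∈ I := by
      rw [hI, mem_filter]; exact ⟨mem_univ _, hC.2⟩
    have hUeq : U = cutOf π I := by
      ext v
      rw [mem_cutOf]
      constructor
      · intro hv
        rcases (isAC_iff _).1 (hAC v hv) with ⟨j, x, hjx⟩ | ⟨t, ht⟩
        · right
          have hvA : v ∈ Atil π j := mem_Atil.2 ⟨x, hjx⟩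
          refine ⟨j, ?_, hvA⟩
          rw [hI, mem_filter]
          refine ⟨mem_univ _, ?_⟩
          by_cases hj : (j : ℕ) < m
          · have hAblk : Atil π j = Ablk π ⟨j, hj⟩ := by
              rw [Ablk_eq_Atil]; congr 1
            rcases hblk ⟨j, hj⟩ with hin | hout
            · rwa [hAblk]
            · rw [← hAblk] at hout
              exact absurd hv (disjoint_left.1 hout hvA)
          · have hjl : j = Fin.last m := Fin.ext (by have := j.2; simp [Fin.last]; omega)
            subst hjl
            exact hC.2
        · exact Or.inl (mem_cset.2 ⟨t, ht⟩)
      · rintro (hv | ⟨j, hj, hv⟩)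
        · exact hC.1 hv
        · rw [hI, mem_filter] at hj
          exact hj.2 hv
    refine ⟨I, ?_, hlast, hUeq⟩
    have := card_cutOf π I
    rw [← hUeq, hcard, tCut] at this
    have h1 : q * I.card = q * (μ + 1) := by have := Nat.mul_comm (μ + 1) q; linarith
    exact Nat.eq_of_mul_eq_mul_left hq h1
  · rintro ⟨I, hI, hlast, rfl⟩
    simp only [UexC, UallP, mem_filter, mem_univ, true_and]
    refine ⟨⟨?_, ?_, ?_⟩, ?_⟩
    · rw [card_cutOf, hI, tCut]; ring
    · intro v hv
      rcases mem_cutOf.1 hv with hv | ⟨j, -, hv⟩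
      · obtain ⟨t, ht⟩ := mem_cset.1 hv
        rw [ht]; rfl
      · obtain ⟨x, hx⟩ := mem_Atil.1 hv
        rw [hx]; rfl
    · intro i
      by_cases hi : Fin.castSucc i ∈ I
      · exact Or.inl ((Atil_subset_cutOf_iff hq).2 hi)
      · exact Or.inr ((disjoint_Atil_cutOf_iff hq).2 hi)
    · rw [Cset_eq, union_subset_iff]
      exact ⟨fun v hv => mem_cutOf.2 (Or.inl hv), (Atil_subset_cutOf_iff hq).2 hlast⟩

/-- The index sets on each side. [folklore] -/
theorem Uex3_eq_image {μ : ℕ} (hq : 0 < q) (π : Equiv.Perm (Slot m q)) :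
    Uex3 μ π = ((univ.erase (Fin.last m)).powersetCard (μ + 1)).image (cutOf π) := by
  ext U
  rw [mem_Uex3_iff hq, mem_image]
  constructor
  · rintro ⟨I, hI, hlast, rfl⟩
    refine ⟨I, ?_, rfl⟩
    rw [mem_powersetCard]
    exact ⟨fun j hj => mem_erase.2 ⟨fun h => hlast (h ▸ hj), mem_univ _⟩, hI⟩
  · rintro ⟨I, hI, rfl⟩
    rw [mem_powersetCard] at hI
    exact ⟨I, hI.2, fun h => by simpa using hI.1 h, rfl⟩

/-- Auxiliary (`UexC_eq_image`). [folklore] -/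
theorem UexC_eq_image {μ : ℕ} (hq : 0 < q) (π : Equiv.Perm (Slot m q)) :
    UexC μ π = (((univ.erase (Fin.last m)).powersetCard μ).image
      fun I => insert (Fin.last m) I).image (cutOf π) := by
  ext U
  rw [mem_UexC_iff hq, mem_image]
  constructor
  · rintro ⟨I, hI, hlast, rfl⟩
    refine ⟨I, ?_, rfl⟩
    rw [mem_image]
    refine ⟨I.erase (Fin.last m), ?_, insert_erase hlast⟩
    rw [mem_powersetCard]
    refine ⟨fun j hj => ?_, ?_⟩
    · rw [mem_erase] at hj ⊢
      exact ⟨hj.1, mem_univ _⟩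
    · rw [card_erase_of_mem hlast, hI]; rfl
  · rintro ⟨I, hI, rfl⟩
    rw [mem_image] at hI
    obtain ⟨I', hI', rfl⟩ := hI
    rw [mem_powersetCard] at hI'
    have hl : Fin.last m ∉ I' := fun h => by simpa using hI'.1 h
    exact ⟨_, by rw [card_insert_of_notMem hl, hI'.2], mem_insert_self _ _, rfl⟩

/-- **`|𝒰ex(T,H)| = C(m, μ+1)`.** [cite: Rothvoss2017, §3.2 (PDF p. 8)] -/
theorem card_Uex3 {μ : ℕ} (hq : 0 < q) (π : Equiv.Perm (Slot m q)) :
    (Uex3 μ π).card = Nat.choose m (μ + 1) := by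
  rw [Uex3_eq_image hq, card_image_of_injective _ (cutOf_injective hq), card_powersetCard,
    card_erase_of_mem (mem_univ _), card_univ, Fintype.card_fin]
  simp

/-- **The number of cuts with `U ∩ C = C` is `C(m, μ)`.** [cite: Rothvoss2017, §3.2 (PDF p. 8)] -/
theorem card_UexC {μ : ℕ} (hq : 0 < q) (π : Equiv.Perm (Slot m q)) :
    (UexC μ π).card = Nat.choose m μ := by
  rw [UexC_eq_image hq, card_image_of_injective _ (cutOf_injective hq), card_image_of_injOn,
    card_powersetCard, card_erase_of_mem (mem_univ _), card_univ, Fintype.card_fin]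
  · simp
  · intro I hI I' hI' h
    rw [mem_coe, mem_powersetCard] at hI hI'
    have hl : Fin.last m ∉ I := fun h' => by simpa using hI.1 h'
    have hl' : Fin.last m ∉ I' := fun h' => by simpa using hI'.1 h'
    simp only at h
    rw [← erase_insert hl, h, erase_insert hl']

/-- For `m = 2μ + 1` the two counts agree. [folklore] -/
theorem card_Uex3_eq_card_UexC {μ : ℕ} (hq : 0 < q) (hm : m = 2 * μ + 1) (π : Equiv.Perm (Slot m q)) :
    (Uex3 μ π).card = (UexC μ π).card := by
  rw [card_Uex3 hq, card_UexC hq, hm]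
  exact Nat.choose_symm_half μ

/-- The families are nonempty. [folklore] -/
theorem Uex3_nonempty {μ : ℕ} (hq : 0 < q) (hm : m = 2 * μ + 1) (π : Equiv.Perm (Slot m q)) :
    (Uex3 μ π).Nonempty := by
  rw [← card_pos, card_Uex3 hq, hm]
  exact Nat.choose_pos (by omega)

/-- Auxiliary (`UexC_nonempty`). [folklore] -/
theorem UexC_nonempty {μ : ℕ} (hq : 0 < q) (hm : m = 2 * μ + 1) (π : Equiv.Perm (Slot m q)) :
    (UexC μ π).Nonempty := by
  rw [← card_pos, card_UexC hq, hm]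
  exact Nat.choose_pos (by omega)

end Literature.Barriers.PneNP


/-! ## Part: `TSPExtensionComplexityRothvossMex` -/

/-!
# Rothvoß's partitions, III: the matchings respecting a partition, and their number

Support file for the discharge of `Literature.Barriers.PneNP.Rothvoss2017_tsp` (Rothvoß 2017,
§3), continuing `…RothvossSlots.lean` / `…RothvossCuts.lean`. The matchings `M ∈ ℳ_all(T)`
"have only edges running inside `A_i` or `B_i` or inside `C ∪ D`" (§3.1, PDF p. 8); those with
`M ∩ δ(C) = H` are exactly `H` together with a perfect matching of EVERY fine block
(`A_i`, `C ∖ V(H)`, `D ∖ V(H)`, `B_i`) — the product structure "`X := X₁ × … × X_{2m+1}`" of the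
proof of Lemma 15 (PDF p. 12):

* `fineP π`, `mem_Mex3_iff`, `card_Mex3` (`= Π` over fine blocks of the number of their perfect
  matchings), `card_Mex3_eq` (independent of `π`), `Mex3_nonempty`;
* `coarseP π`, `mem_MexF_iff`, `card_MexF`, `card_MexF_eq`, `MexF_nonempty` for the `k`-side
  (`F ⊆ M`), and the `k`-side key fact `cut_eq_F`: for `C ⊆ U ∈ 𝒰_all(T)` and `F ⊆ M`,
  `δ(U) ∩ M = F`.

Sources: [Rothvoss2017] §3.1–3.2 (PDF pp. 8–9), proof of Lemma 15 (PDF p. 12).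
-/

namespace Literature.Barriers.PneNP

open Finset Slot

variable {m q : ℕ}

/-! ### Fine blocks -/

/-- The slots of the rest of `D`. [folklore] -/
def Slot.drSlots : Finset (Slot m q) := univ.image dr
/-- The slots of block `B_i`. [folklore] -/
def Slot.bSlots (i : Fin m) : Finset (Slot m q) := univ.image fun p : Bool × Fin q => b i p.1 p.2

/-- Auxiliary (`Slot.mem_drSlots`). [folklore] -/
@[simp] theorem Slot.mem_drSlots {s : Slot m q} : s ∈ drSlots ↔ ∃ x, s = dr x := by
  simp [drSlots, eq_comm]
/-- Auxiliary (`Slot.mem_bSlots`). [folklore] -/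
@[simp] theorem Slot.mem_bSlots {i : Fin m} {s : Slot m q} : s ∈ bSlots i ↔ ∃ sd x, s = b i sd x := by
  simp only [bSlots, mem_image, mem_univ, true_and, Prod.exists]
  constructor
  · rintro ⟨sd, x, rfl⟩; exact ⟨sd, x, rfl⟩
  · rintro ⟨sd, x, rfl⟩; exact ⟨sd, x, rfl⟩

/-- Auxiliary (`Slot.card_drSlots`). [folklore] -/
theorem Slot.card_drSlots : (drSlots : Finset (Slot m q)).card = q := by
  rw [drSlots, card_image_of_injective _ (fun x y h => by simpa using h)]; simp
/-- Auxiliary (`Slot.card_bSlots`). [folklore] -/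
theorem Slot.card_bSlots (i : Fin m) : (bSlots i : Finset (Slot m q)).card = 2 * q := by
  rw [bSlots, card_image_of_injective]
  · simp [Fintype.card_prod]
  · rintro ⟨sd, x⟩ ⟨sd', x'⟩ h
    simpa using h

/-- `D ∖ V(H)`. [folklore] -/
def Drest (π : Equiv.Perm (Slot m q)) : Finset (Slot m q) := pull π drSlots
/-- Block `B_i`. [cite: Rothvoss2017, §3.1 (PDF p. 8)] -/
def Bblk (π : Equiv.Perm (Slot m q)) (i : Fin m) : Finset (Slot m q) := pull π (bSlots i)

/-- Auxiliary (`mem_Drest`). [folklore] -/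
@[simp] theorem mem_Drest {π : Equiv.Perm (Slot m q)} {v : Slot m q} : v ∈ Drest π ↔ ∃ x, π v = dr x := by
  simp [Drest, mem_pull]
/-- Auxiliary (`mem_Bblk`). [folklore] -/
@[simp] theorem mem_Bblk {π : Equiv.Perm (Slot m q)} {i : Fin m} {v : Slot m q} :
    v ∈ Bblk π i ↔ ∃ sd x, π v = b i sd x := by
  simp [Bblk, mem_pull]
/-- Auxiliary (`mem_dset`). [folklore] -/
@[simp] theorem mem_dset {π : Equiv.Perm (Slot m q)} {v : Slot m q} : v ∈ dset π ↔ ∃ t, π v = d t := by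
  simp [dset, mem_pull]

/-- The fine blocks off `V(H)`: `Ã_j` (`j ≤ m`), `D ∖ d`, `B_i`. [cite: Rothvoss2017, proof of Lemma 15 (PDF p. 12)] -/
def fineP (π : Equiv.Perm (Slot m q)) : Fin (m + 1) ⊕ Unit ⊕ Fin m → Finset (Slot m q)
  | Sum.inl j => Atil π j
  | Sum.inr (Sum.inl _) => Drest π
  | Sum.inr (Sum.inr i) => Bblk π i

/-- The fine block containing a slot (`none` on `c ∪ d`). [folklore] -/
def Slot.fineIdx : Slot m q → Option (Fin (m + 1) ⊕ Unit ⊕ Fin m)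
  | a j _ => some (Sum.inl j)
  | c _ => none
  | d _ => none
  | dr _ => some (Sum.inr (Sum.inl ()))
  | b i _ _ => some (Sum.inr (Sum.inr i))

/-- Auxiliary (`mem_fineP_iff`). [folklore] -/
theorem mem_fineP_iff {π : Equiv.Perm (Slot m q)} {r : Fin (m + 1) ⊕ Unit ⊕ Fin m} {v : Slot m q} :
    v ∈ fineP π r ↔ fineIdx (π v) = some r := by
  rcases r with j | ⟨⟩ | i
  · simp only [fineP, mem_Atil]
    rcases h : π v with ⟨j', x⟩ | t | t | x | ⟨i', sd, x⟩ <;> simp [fineIdx, eq_comm]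
  · simp only [fineP, mem_Drest]
    rcases h : π v with ⟨j', x⟩ | t | t | x | ⟨i', sd, x⟩ <;> simp [fineIdx]
  · simp only [fineP, mem_Bblk]
    rcases h : π v with ⟨j', x⟩ | t | t | x | ⟨i', sd, x⟩ <;> simp [fineIdx, eq_comm]

/-- Auxiliary (`fineP_disjoint`). [folklore] -/
theorem fineP_disjoint (π : Equiv.Perm (Slot m q)) :
    ∀ r r', r ≠ r' → Disjoint (fineP π r) (fineP π r') := by
  intro r r' hne
  rw [disjoint_left]
  intro v hv hv'
  rw [mem_fineP_iff] at hv hv'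
  rw [hv] at hv'
  exact hne (Option.some.inj hv')

/-- Off `V(H)`, every vertex lies in a fine block. [folklore] -/
theorem biUnion_fineP (π : Equiv.Perm (Slot m q)) :
    univ.biUnion (fineP π) = univ \ (cset π ∪ dset π) := by
  ext v
  simp only [mem_biUnion, mem_univ, true_and, mem_sdiff, mem_union, mem_cset, mem_dset,
    mem_fineP_iff]
  rcases h : π v with ⟨j, x⟩ | t | t | x | ⟨i, sd, x⟩ <;> simp [fineIdx]

/-- Auxiliary (`univ_eq_VH_union_fine`). [folklore] -/
theorem univ_eq_VH_union_fine (π : Equiv.Perm (Slot m q)) :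
    (univ : Finset (Slot m q)) = (cset π ∪ dset π) ∪ univ.biUnion (fineP π) := by
  rw [biUnion_fineP, union_sdiff_of_subset (subset_univ _)]

/-- Auxiliary (`disjoint_VH_fine`). [folklore] -/
theorem disjoint_VH_fine (π : Equiv.Perm (Slot m q)) :
    Disjoint (cset π ∪ dset π) (univ.biUnion (fineP π)) := by
  rw [biUnion_fineP]; exact disjoint_sdiff

/-- The role is constant on fine blocks. [folklore] -/
theorem role_eq_of_mem_fineP {π : Equiv.Perm (Slot m q)} {r : Fin (m + 1) ⊕ Unit ⊕ Fin m}
    {u v : Slot m q} (hu : u ∈ fineP π r) (hv : v ∈ fineP π r) : role (π u) = role (π v) := by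
  rcases r with j | ⟨⟩ | i
  · obtain ⟨x, hx⟩ := mem_Atil.1 hu
    obtain ⟨y, hy⟩ := mem_Atil.1 hv
    rw [hx, hy]
    simp [role]
  · obtain ⟨x, hx⟩ := mem_Drest.1 hu
    obtain ⟨y, hy⟩ := mem_Drest.1 hv
    rw [hx, hy]; rfl
  · obtain ⟨sd, x, hx⟩ := mem_Bblk.1 hu
    obtain ⟨sd', y, hy⟩ := mem_Bblk.1 hv
    rw [hx, hy]; rfl

/-- A fine block is inside `C`, or disjoint from `C`. [folklore] -/
theorem cutCount_Cset_ne_one_of_fine {π : Equiv.Perm (Slot m q)} {r : Fin (m + 1) ⊕ Unit ⊕ Fin m}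
    {e : Sym2 (Slot m q)} (he : e ∈ (fineP π r).sym2) : cutCount (Cset π) e ≠ 1 := by
  induction e using Sym2.ind with
  | h u v =>
    rw [mk_mem_sym2_iff] at he
    rw [cutCount_mk]
    -- membership in `C` is decided by the block
    have key : ∀ {w}, w ∈ fineP π r → (w ∈ Cset π ↔ r = Sum.inl (Fin.last m)) := by
      intro w hw
      simp only [Cset, mem_pull, mem_CSlots]
      rcases r with j | ⟨⟩ | i
      · obtain ⟨x, hx⟩ := mem_Atil.1 hw
        rw [hx]
        simp only [reduceCtorEq, exists_false, Slot.a.injEq, exists_eq_right', false_or, Sum.inl.injEq]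
      · obtain ⟨x, hx⟩ := mem_Drest.1 hw
        rw [hx]; simp
      · obtain ⟨sd, x, hx⟩ := mem_Bblk.1 hw
        rw [hx]; simp
    by_cases hr : r = Sum.inl (Fin.last m)
    · simp [(key he.1).2 hr, (key he.2).2 hr]
    · simp [mt (key he.1).1 hr, mt (key he.2).1 hr]

/-- The role of a fine block. [folklore] -/
def fineRole : Fin (m + 1) ⊕ Unit ⊕ Fin m → Role m
  | Sum.inl j => if h : (j : ℕ) < m then Role.A ⟨j, h⟩ else Role.CD
  | Sum.inr (Sum.inl _) => Role.CD
  | Sum.inr (Sum.inr i) => Role.B i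

/-- The role of a vertex is the role of its fine block. [folklore] -/
theorem role_of_mem_fineP {π : Equiv.Perm (Slot m q)} {r : Fin (m + 1) ⊕ Unit ⊕ Fin m} {w : Slot m q}
    (hw : w ∈ fineP π r) : role (π w) = fineRole r := by
  rcases r with j | ⟨⟩ | i
  · obtain ⟨x, hx⟩ := mem_Atil.1 hw
    rw [hx]; rfl
  · obtain ⟨x, hx⟩ := mem_Drest.1 hw
    rw [hx]; rfl
  · obtain ⟨sd, x, hx⟩ := mem_Bblk.1 hw
    rw [hx]; rfl

/-- The fine blocks of role `CD` are `C ∖ c` and `D ∖ d`. [folklore] -/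
theorem fineRole_eq_CD_iff {r : Fin (m + 1) ⊕ Unit ⊕ Fin m} :
    fineRole r = Role.CD ↔ r = Sum.inl (Fin.last m) ∨ r = Sum.inr (Sum.inl ()) := by
  rcases r with j | ⟨⟩ | i
  · simp only [fineRole, Sum.inl.injEq, reduceCtorEq, or_false]
    constructor
    · intro h
      split_ifs at h with hj
      exact Fin.ext (by rw [Fin.val_last]; have := j.2; omega)
    · rintro rfl
      simp
  · simp [fineRole]
  · simp [fineRole]

/-- Off role `CD`, the role determines the fine block. [folklore] -/
theorem fineRole_injective_of_ne_CD {r r' : Fin (m + 1) ⊕ Unit ⊕ Fin m} (h : fineRole r = fineRole r')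
    (hr : fineRole r ≠ Role.CD) : r = r' := by
  rcases r with j | ⟨⟩ | i <;> rcases r' with j' | ⟨⟩ | i'
  · simp only [fineRole] at h hr
    by_cases h1 : (j : ℕ) < m
    · by_cases h2 : (j' : ℕ) < m
      · rw [dif_pos h1, dif_pos h2] at h
        simp only [Role.A.injEq, Fin.mk.injEq] at h
        exact congrArg Sum.inl (Fin.ext h)
      · rw [dif_pos h1, dif_neg h2] at h
        exact absurd h (by simp)
    · rw [dif_neg h1] at hr
      exact absurd rfl hr
  · simp only [fineRole] at h hr
    by_cases h1 : (j : ℕ) < m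
    · rw [dif_pos h1] at h
      exact absurd h (by simp)
    · rw [dif_neg h1] at hr
      exact absurd rfl hr
  · simp only [fineRole] at h
    by_cases h1 : (j : ℕ) < m
    · rw [dif_pos h1] at h
      exact absurd h (by simp)
    · rw [dif_neg h1] at h
      exact absurd h (by simp)
  · simp only [fineRole] at hr
    exact absurd rfl hr
  · rfl
  · simp [fineRole] at h
  · simp only [fineRole] at h
    by_cases h2 : (j' : ℕ) < m
    · rw [dif_pos h2] at h
      exact absurd h (by simp)
    · rw [dif_neg h2] at h
      exact absurd h (by simp)
  · simp [fineRole] at h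
  · simp only [fineRole, Role.B.injEq] at h
    rw [h]

/-- `C ∖ c ⊆ C`. [folklore] -/
theorem Atil_last_subset_Cset (π : Equiv.Perm (Slot m q)) {w : Slot m q}
    (hw : w ∈ fineP π (Sum.inl (Fin.last m))) : w ∈ Cset π := by
  rw [Cset_eq]; exact mem_union_right _ hw

/-- `D ∖ d` misses `C`. [folklore] -/
theorem not_mem_Cset_of_mem_Drest (π : Equiv.Perm (Slot m q)) {w : Slot m q}
    (hw : w ∈ fineP π (Sum.inr (Sum.inl ()))) : w ∉ Cset π := by
  intro hC
  obtain ⟨x, hx⟩ := mem_Drest.1 hw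
  simp only [Cset, mem_pull, mem_CSlots, hx] at hC
  rcases hC with ⟨t, ht⟩ | ⟨y, hy⟩
  · simp at ht
  · simp at hy

/-! ### `ℳex(T,H)` described -/

/-- **`ℳex(T,H)` described**: `M ∈ ℳ_all(T)` with `M ∩ δ(C) = H` iff `M = H ∪ N` for a
perfect matching `N` of `V ∖ V(H)` using only edges inside fine blocks.
[cite: Rothvoss2017, §3.2 (PDF p. 8), proof of Lemma 15 (PDF p. 12)] -/
theorem mem_Mex3_iff {π : Equiv.Perm (Slot m q)} {M : Finset (Sym2 (Slot m q))} :
    M ∈ Mex3 π ↔ Hm π ⊆ M ∧ IsPMOn (univ.biUnion (fineP π)) (M \ Hm π) ∧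
      ∀ e ∈ M \ Hm π, ∃ r, e ∈ (fineP π r).sym2 := by
  constructor
  · intro hM
    simp only [Mex3, MallP, mem_filter, mem_perfectMatchings] at hM
    obtain ⟨⟨hPM, hsame⟩, hH⟩ := hM
    have hHM : Hm π ⊆ M := fun e he => by
      have : e ∈ M.filter fun e => cutCount (Cset π) e = 1 := by rw [hH]; exact he
      exact (mem_filter.1 this).1
    have hPM' : IsPMOn ((cset π ∪ dset π) ∪ univ.biUnion (fineP π)) M := by
      rwa [← univ_eq_VH_union_fine]
    refine ⟨hHM, hPM'.sdiff (disjoint_VH_fine π) (isPMOn_Hm π) hHM, fun e he => ?_⟩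
    rw [mem_sdiff] at he
    obtain ⟨heM, heH⟩ := he
    induction e using Sym2.ind with
    | h u v =>
      -- endpoints avoid `V(H)` (covered by `H ⊆ M`) and lie in a common block
      have hoff : ∀ {w w' : Slot m q}, s(w, w') ∈ M → s(w, w') ∉ Hm π → w ∉ cset π ∪ dset π := by
        intro w w' hww' hnot hw
        obtain ⟨f, hf, hwf⟩ := (isPMOn_Hm π).exists_mem hw
        have := hPM.unique hww' (hHM hf) (Sym2.mem_mk_left w w') hwf
        exact hnot (this ▸ hf)
      have hu : u ∈ univ.biUnion (fineP π) := by
        rw [biUnion_fineP, mem_sdiff]; exact ⟨mem_univ _, hoff heM heH⟩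
      have hv : v ∈ univ.biUnion (fineP π) := by
        rw [biUnion_fineP, mem_sdiff]
        refine ⟨mem_univ _, hoff (by rw [Sym2.eq_swap]; exact heM) (by rw [Sym2.eq_swap]; exact heH)⟩
      obtain ⟨r, -, hur⟩ := mem_biUnion.1 hu
      obtain ⟨r', -, hvr'⟩ := mem_biUnion.1 hv
      refine ⟨r, mk_mem_sym2_iff.2 ⟨hur, ?_⟩⟩
      -- same role forces the same fine block, except inside `C ∪ D` where the cut count decides
      have hrole := (sameRole_mk π u v).1 (hsame _ heM)
      rw [role_of_mem_fineP hur, role_of_mem_fineP hvr'] at hrole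
      by_cases hCD : fineRole r = Role.CD
      · -- both blocks are `C ∖ c` or `D ∖ d`; a mixed edge would cross `C` and lie in `H`
        have hCD' : fineRole r' = Role.CD := hrole ▸ hCD
        rw [fineRole_eq_CD_iff] at hCD hCD'
        have hcross : ∀ {w w' : Slot m q}, s(w, w') ∈ M → s(w, w') ∉ Hm π →
            w ∈ fineP π (Sum.inl (Fin.last m)) → w' ∈ fineP π (Sum.inr (Sum.inl ())) → False := by
          intro w w' hww' hnot hw hw'
          have hcut : cutCount (Cset π) s(w, w') = 1 := by
            rw [cutCount_mk, if_pos (Atil_last_subset_Cset π hw), if_neg (not_mem_Cset_of_mem_Drest π hw')]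
          have : s(w, w') ∈ M.filter fun e => cutCount (Cset π) e = 1 := mem_filter.2 ⟨hww', hcut⟩
          rw [hH] at this
          exact hnot this
        rcases hCD with rfl | rfl <;> rcases hCD' with rfl | rfl
        · exact hvr'
        · exact (hcross heM heH hur hvr').elim
        · exact (hcross (by rw [Sym2.eq_swap]; exact heM) (by rw [Sym2.eq_swap]; exact heH) hvr' hur).elim
        · exact hvr'
      · rw [fineRole_injective_of_ne_CD hrole hCD]
        exact hvr'
  · rintro ⟨hHM, hN, hresp⟩
    have hM : M = Hm π ∪ (M \ Hm π) := (union_sdiff_of_subset hHM).symm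
    simp only [Mex3, MallP, mem_filter, mem_perfectMatchings]
    refine ⟨⟨?_, ?_⟩, ?_⟩
    · rw [univ_eq_VH_union_fine π, hM]
      exact (isPMOn_Hm π).union hN (disjoint_VH_fine π)
    · intro e he
      by_cases heH : e ∈ Hm π
      · obtain ⟨t, rfl⟩ := mem_Hm_iff.1 heH
        rw [sameRole_mk]
        simp [role]
      · obtain ⟨r, hr⟩ := hresp e (mem_sdiff.2 ⟨he, heH⟩)
        induction e using Sym2.ind with
        | h u v =>
          rw [mk_mem_sym2_iff] at hr
          exact (sameRole_mk π u v).2 (role_eq_of_mem_fineP hr.1 hr.2)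
    · ext e
      simp only [mem_filter]
      constructor
      · rintro ⟨he, hcut⟩
        by_contra heH
        obtain ⟨r, hr⟩ := hresp e (mem_sdiff.2 ⟨he, heH⟩)
        exact cutCount_Cset_ne_one_of_fine hr hcut
      · intro he
        exact ⟨hHM he, cutCount_Cset_of_mem_Hm he⟩

/-- **`|ℳex(T,H)|` is the product over the fine blocks of their numbers of perfect matchings.**
[cite: Rothvoss2017, proof of Lemma 15 (PDF p. 12)] -/
theorem card_Mex3 (π : Equiv.Perm (Slot m q)) :
    (Mex3 π).card = ∏ r, (perfectMatchings (fineP π r)).card := by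
  classical
  have hS : ((perfectMatchings (univ.biUnion (fineP π))).filter
      fun N => ∀ e ∈ N, ∃ i, e ∈ (fineP π i).sym2).card = ∏ r, (perfectMatchings (fineP π r)).card := by
    convert card_blockPM (fineP π) (fineP_disjoint π)
  rw [← hS]
  refine card_nbij' (fun M => M \ Hm π) (fun N => Hm π ∪ N) (fun M hM => ?_) (fun N hN => ?_)
    (fun M hM => ?_) (fun N hN => ?_)
  · rw [mem_coe, mem_Mex3_iff] at hM
    rw [mem_coe, mem_filter, mem_perfectMatchings]
    exact ⟨hM.2.1, hM.2.2⟩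
  · rw [mem_coe, mem_filter, mem_perfectMatchings] at hN
    rw [mem_coe]
    have hdisj : Disjoint (Hm π) N :=
      (isPMOn_Hm π).disjoint_of_disjoint hN.1 (disjoint_VH_fine π)
    have hsd : (Hm π ∪ N) \ Hm π = N := by
      rw [union_sdiff_left, Finset.sdiff_eq_self_iff_disjoint]
      exact hdisj.symm
    show Hm π ∪ N ∈ Mex3 π
    rw [mem_Mex3_iff, hsd]
    exact ⟨subset_union_left, hN.1, hN.2⟩
  · rw [mem_coe, mem_Mex3_iff] at hM
    exact union_sdiff_of_subset hM.1
  · rw [mem_coe, mem_filter, mem_perfectMatchings] at hN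
    have hdisj : Disjoint (Hm π) N :=
      (isPMOn_Hm π).disjoint_of_disjoint hN.1 (disjoint_VH_fine π)
    show (Hm π ∪ N) \ Hm π = N
    rw [union_sdiff_left, Finset.sdiff_eq_self_iff_disjoint]
    exact hdisj.symm

/-- The fine blocks have sizes independent of `π`. [folklore] -/
theorem card_fineP (π : Equiv.Perm (Slot m q)) (r : Fin (m + 1) ⊕ Unit ⊕ Fin m) :
    (fineP π r).card = (match r with
      | Sum.inl _ => q
      | Sum.inr (Sum.inl _) => q
      | Sum.inr (Sum.inr _) => 2 * q) := by
  rcases r with j | ⟨⟩ | i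
  · exact card_Atil π j
  · simp only [fineP, Drest, card_pull, card_drSlots]
  · simp only [fineP, Bblk, card_pull, card_bSlots]

/-- **`|ℳex(T,H)|` does not depend on the partition.** [cite: Rothvoss2017, §3.2 (PDF p. 8)] -/
theorem card_Mex3_eq (π π' : Equiv.Perm (Slot m q)) : (Mex3 π).card = (Mex3 π').card := by
  rw [card_Mex3, card_Mex3]
  refine Finset.prod_congr rfl fun r _ => card_perfectMatchings_eq_of_card_eq ?_
  rw [card_fineP, card_fineP]

/-- `ℳex(T,H)` is nonempty (`q` even). [folklore] -/
theorem Mex3_nonempty (hq : Even q) (π : Equiv.Perm (Slot m q)) : (Mex3 π).Nonempty := by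
  rw [← card_pos, card_Mex3]
  refine Finset.prod_pos fun r _ => card_pos.2 (perfectMatchings_nonempty ?_)
  rw [card_fineP]
  rcases r with j | ⟨⟩ | i
  · exact hq
  · exact hq
  · exact even_two_mul q

/-! ### The `k`-side: matchings containing `F` -/

/-- The coarse blocks off `C ∪ D`: `A_i`, `B_i`. [cite: Rothvoss2017, §3.1 (PDF p. 8)] -/
def coarseP (π : Equiv.Perm (Slot m q)) : Fin m ⊕ Fin m → Finset (Slot m q)
  | Sum.inl i => Ablk π i
  | Sum.inr i => Bblk π i

/-- The coarse block containing a slot (`none` on `C ∪ D`). [folklore] -/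
def Slot.coarseIdx : Slot m q → Option (Fin m ⊕ Fin m)
  | a j _ => if h : (j : ℕ) < m then some (Sum.inl ⟨j, h⟩) else none
  | c _ => none
  | d _ => none
  | dr _ => none
  | b i _ _ => some (Sum.inr i)

/-- Auxiliary (`mem_coarseP_iff`). [folklore] -/
theorem mem_coarseP_iff {π : Equiv.Perm (Slot m q)} {r : Fin m ⊕ Fin m} {v : Slot m q} :
    v ∈ coarseP π r ↔ coarseIdx (π v) = some r := by
  rcases r with i | i
  · simp only [coarseP, Ablk, mem_pull, mem_aSlots]
    rcases h : π v with ⟨j', x⟩ | t | t | x | ⟨i', sd, x⟩ <;> simp only [coarseIdx, Slot.a.injEq,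
      reduceCtorEq, exists_false]
    · constructor
      · rintro ⟨x', hj, -⟩
        subst hj
        simp
      · intro hh
        split_ifs at hh with h1
        · simp only [Option.some.injEq, Sum.inl.injEq] at hh
          refine ⟨x, Fin.ext ?_, rfl⟩
          rw [← hh]; rfl
    · simp
  · simp only [coarseP, mem_Bblk]
    rcases h : π v with ⟨j', x⟩ | t | t | x | ⟨i', sd, x⟩ <;> simp only [coarseIdx, Slot.b.injEq,
      reduceCtorEq, exists_false, Option.some.injEq, Sum.inr.injEq]
    · split_ifs <;> simp
    · constructor
      · rintro ⟨sd', x', h1, -, -⟩; exact h1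
      · rintro rfl; exact ⟨sd, x, rfl, rfl, rfl⟩

/-- Auxiliary (`coarseP_disjoint`). [folklore] -/
theorem coarseP_disjoint (π : Equiv.Perm (Slot m q)) :
    ∀ r r', r ≠ r' → Disjoint (coarseP π r) (coarseP π r') := by
  intro r r' hne
  rw [disjoint_left]
  intro v hv hv'
  rw [mem_coarseP_iff] at hv hv'
  rw [hv] at hv'
  exact hne (Option.some.inj hv')

/-- Auxiliary (`biUnion_coarseP`). [folklore] -/
theorem biUnion_coarseP (π : Equiv.Perm (Slot m q)) :
    univ.biUnion (coarseP π) = univ \ (Cset π ∪ Dset π) := by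
  ext v
  have hCD : (v ∈ Cset π ∨ v ∈ Dset π) ↔ role (π v) = Role.CD := by
    rw [role_eq_CD_iff, Cset, Dset, mem_pull, mem_pull]
  simp only [mem_biUnion, mem_univ, true_and, mem_sdiff, mem_union, mem_coarseP_iff, hCD]
  rcases h : π v with ⟨j, x⟩ | t | t | x | ⟨i, sd, x⟩
  · by_cases hj : (j : ℕ) < m <;> simp [coarseIdx, role, hj]
  · simp [coarseIdx, role]
  · simp [coarseIdx, role]
  · simp [coarseIdx, role]
  · simp [coarseIdx, role]

/-- Auxiliary (`univ_eq_CD_union_coarse`). [folklore] -/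
theorem univ_eq_CD_union_coarse (π : Equiv.Perm (Slot m q)) :
    (univ : Finset (Slot m q)) = (Cset π ∪ Dset π) ∪ univ.biUnion (coarseP π) := by
  rw [biUnion_coarseP, union_sdiff_of_subset (subset_univ _)]

/-- Auxiliary (`disjoint_CD_coarse`). [folklore] -/
theorem disjoint_CD_coarse (π : Equiv.Perm (Slot m q)) :
    Disjoint (Cset π ∪ Dset π) (univ.biUnion (coarseP π)) := by
  rw [biUnion_coarseP]; exact disjoint_sdiff

/-- Auxiliary (`role_eq_of_mem_coarseP`). [folklore] -/
theorem role_eq_of_mem_coarseP {π : Equiv.Perm (Slot m q)} {r : Fin m ⊕ Fin m}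
    {u v : Slot m q} (hu : u ∈ coarseP π r) (hv : v ∈ coarseP π r) : role (π u) = role (π v) := by
  rcases r with i | i
  · obtain ⟨x, hx⟩ := (mem_pull.1 hu : π u ∈ aSlots _) |> mem_aSlots.1
    obtain ⟨y, hy⟩ := (mem_pull.1 hv : π v ∈ aSlots _) |> mem_aSlots.1
    rw [hx, hy, role_a_castSucc, role_a_castSucc]
  · obtain ⟨sd, x, hx⟩ := mem_Bblk.1 hu
    obtain ⟨sd', y, hy⟩ := mem_Bblk.1 hv
    rw [hx, hy]; rfl

/-- **The `k`-side described**: `M ∈ ℳ_all(T)` with `F ⊆ M` iff `M = F ∪ N` for a perfect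
matching `N` of `V ∖ (C ∪ D)` inside the blocks `A_i`, `B_i`. [cite: Rothvoss2017, §3.2 (PDF p. 9)] -/
theorem mem_MexF_iff {π : Equiv.Perm (Slot m q)} {M : Finset (Sym2 (Slot m q))} :
    M ∈ MexF π ↔ Fm π ⊆ M ∧ IsPMOn (univ.biUnion (coarseP π)) (M \ Fm π) ∧
      ∀ e ∈ M \ Fm π, ∃ r, e ∈ (coarseP π r).sym2 := by
  constructor
  · intro hM
    simp only [MexF, MallP, mem_filter, mem_perfectMatchings] at hM
    obtain ⟨⟨hPM, hsame⟩, hFM⟩ := hM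
    have hPM' : IsPMOn ((Cset π ∪ Dset π) ∪ univ.biUnion (coarseP π)) M := by
      rwa [← univ_eq_CD_union_coarse]
    refine ⟨hFM, hPM'.sdiff (disjoint_CD_coarse π) (isPMOn_Fm π) hFM, fun e he => ?_⟩
    rw [mem_sdiff] at he
    obtain ⟨heM, heF⟩ := he
    induction e using Sym2.ind with
    | h u v =>
      have hoff : ∀ {w w' : Slot m q}, s(w, w') ∈ M → s(w, w') ∉ Fm π → w ∉ Cset π ∪ Dset π := by
        intro w w' hww' hnot hw
        obtain ⟨f, hf, hwf⟩ := (isPMOn_Fm π).exists_mem hw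
        have := hPM.unique hww' (hFM hf) (Sym2.mem_mk_left w w') hwf
        exact hnot (this ▸ hf)
      have hu : u ∈ univ.biUnion (coarseP π) := by
        rw [biUnion_coarseP, mem_sdiff]; exact ⟨mem_univ _, hoff heM heF⟩
      have hv : v ∈ univ.biUnion (coarseP π) := by
        rw [biUnion_coarseP, mem_sdiff]
        exact ⟨mem_univ _, hoff (by rw [Sym2.eq_swap]; exact heM) (by rw [Sym2.eq_swap]; exact heF)⟩
      obtain ⟨r, -, hur⟩ := mem_biUnion.1 hu
      obtain ⟨r', -, hvr'⟩ := mem_biUnion.1 hv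
      refine ⟨r, mk_mem_sym2_iff.2 ⟨hur, ?_⟩⟩
      have hrole := (sameRole_mk π u v).1 (hsame _ heM)
      -- same role off `C ∪ D` means same coarse block
      have key : ∀ {w : Slot m q} {s : Fin m ⊕ Fin m}, w ∈ coarseP π s →
          role (π w) = (match s with | Sum.inl i => Role.A i | Sum.inr i => Role.B i) := by
        intro w s hw
        rcases s with i | i
        · obtain ⟨x, hx⟩ := (mem_pull.1 hw : π w ∈ aSlots _) |> mem_aSlots.1
          rw [hx, role_a_castSucc]
        · obtain ⟨sd, x, hx⟩ := mem_Bblk.1 hw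
          rw [hx]; rfl
      have h1 := key hur
      have h2 := key hvr'
      rw [h1, h2] at hrole
      have : r = r' := by
        rcases r with i | i <;> rcases r' with i' | i' <;> simp_all
      rw [this]
      exact hvr'
  · rintro ⟨hFM, hN, hresp⟩
    have hM : M = Fm π ∪ (M \ Fm π) := (union_sdiff_of_subset hFM).symm
    simp only [MexF, MallP, mem_filter, mem_perfectMatchings]
    refine ⟨⟨?_, ?_⟩, hFM⟩
    · rw [univ_eq_CD_union_coarse π, hM]
      exact (isPMOn_Fm π).union hN (disjoint_CD_coarse π)
    · intro e he
      by_cases heF : e ∈ Fm π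
      · obtain ⟨ξ, rfl⟩ := mem_Fm_iff.1 heF
        rw [fEdge, sameRole_mk]
        simp [role_Cslot, role_Dslot]
      · obtain ⟨r, hr⟩ := hresp e (mem_sdiff.2 ⟨he, heF⟩)
        induction e using Sym2.ind with
        | h u v =>
          rw [mk_mem_sym2_iff] at hr
          exact (sameRole_mk π u v).2 (role_eq_of_mem_coarseP hr.1 hr.2)

/-- **`|{M ∈ ℳ_all(T) : F ⊆ M}|` is the product over the blocks `A_i, B_i`.** [cite: Rothvoss2017, §3.2 (PDF p. 9)] -/
theorem card_MexF (π : Equiv.Perm (Slot m q)) :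
    (MexF π).card = ∏ r, (perfectMatchings (coarseP π r)).card := by
  classical
  have hS : ((perfectMatchings (univ.biUnion (coarseP π))).filter
      fun N => ∀ e ∈ N, ∃ i, e ∈ (coarseP π i).sym2).card = ∏ r, (perfectMatchings (coarseP π r)).card := by
    convert card_blockPM (coarseP π) (coarseP_disjoint π)
  rw [← hS]
  refine card_nbij' (fun M => M \ Fm π) (fun N => Fm π ∪ N) (fun M hM => ?_) (fun N hN => ?_)
    (fun M hM => ?_) (fun N hN => ?_)
  · rw [mem_coe, mem_MexF_iff] at hM
    rw [mem_coe, mem_filter, mem_perfectMatchings]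
    exact ⟨hM.2.1, hM.2.2⟩
  · rw [mem_coe, mem_filter, mem_perfectMatchings] at hN
    rw [mem_coe]
    have hdisj : Disjoint (Fm π) N :=
      (isPMOn_Fm π).disjoint_of_disjoint hN.1 (disjoint_CD_coarse π)
    have hsd : (Fm π ∪ N) \ Fm π = N := by
      rw [union_sdiff_left, Finset.sdiff_eq_self_iff_disjoint]
      exact hdisj.symm
    show Fm π ∪ N ∈ MexF π
    rw [mem_MexF_iff, hsd]
    exact ⟨subset_union_left, hN.1, hN.2⟩
  · rw [mem_coe, mem_MexF_iff] at hM
    exact union_sdiff_of_subset hM.1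
  · rw [mem_coe, mem_filter, mem_perfectMatchings] at hN
    have hdisj : Disjoint (Fm π) N :=
      (isPMOn_Fm π).disjoint_of_disjoint hN.1 (disjoint_CD_coarse π)
    show (Fm π ∪ N) \ Fm π = N
    rw [union_sdiff_left, Finset.sdiff_eq_self_iff_disjoint]
    exact hdisj.symm

/-- Auxiliary (`card_coarseP`). [folklore] -/
theorem card_coarseP (π : Equiv.Perm (Slot m q)) (r : Fin m ⊕ Fin m) :
    (coarseP π r).card = (match r with | Sum.inl _ => q | Sum.inr _ => 2 * q) := by
  rcases r with i | i
  · simp only [coarseP, Ablk, card_pull, card_aSlots]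
  · simp only [coarseP, Bblk, card_pull, card_bSlots]

/-- **`|{M : F ⊆ M}|` does not depend on the partition.** [folklore] -/
theorem card_MexF_eq (π π' : Equiv.Perm (Slot m q)) : (MexF π).card = (MexF π').card := by
  rw [card_MexF, card_MexF]
  refine Finset.prod_congr rfl fun r _ => card_perfectMatchings_eq_of_card_eq ?_
  rw [card_coarseP, card_coarseP]

/-- It is nonempty (`q` even). [folklore] -/
theorem MexF_nonempty (hq : Even q) (π : Equiv.Perm (Slot m q)) : (MexF π).Nonempty := by
  rw [← card_pos, card_MexF]
  refine Finset.prod_pos fun r _ => card_pos.2 (perfectMatchings_nonempty ?_)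
  rw [card_coarseP]
  rcases r with i | i
  · exact hq
  · exact even_two_mul q

/-- **Key fact (`k`-side).** For `C ⊆ U ∈ 𝒰_all(T)` and `M ∈ ℳ_all(T)` with `F ⊆ M`, the
edges of `M` with exactly one endpoint in `U` are exactly the `k` edges of `F`.
[cite: Rothvoss2017, §3.2 (PDF p. 9)] -/
theorem cut_eq_F {μ : ℕ} {π : Equiv.Perm (Slot m q)} {U : Finset (Slot m q)} {M : Finset (Sym2 (Slot m q))}
    (hU : U ∈ UexC μ π) (hM : M ∈ MexF π) :
    (M.filter fun e => cutCount U e = 1) = Fm π := by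
  have hU' := hU
  simp only [UexC, UallP, mem_filter, mem_univ, true_and] at hU'
  obtain ⟨⟨-, hAC, hblk⟩, hCU⟩ := hU'
  obtain ⟨hFM, -, hresp⟩ := mem_MexF_iff.1 hM
  have hDU : ∀ v ∈ Dset π, v ∉ U := fun v hv hvU => by
    have := hAC v hvU
    simp only [Dset, mem_pull] at hv
    rw [isAC_of_mem_DSlots hv] at this
    exact Bool.false_ne_true this
  ext e
  simp only [mem_filter]
  constructor
  · rintro ⟨he, hcut⟩
    by_contra heF
    obtain ⟨r, hr⟩ := hresp e (mem_sdiff.2 ⟨he, heF⟩)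
    induction e using Sym2.ind with
    | h u v =>
      rw [mk_mem_sym2_iff] at hr
      rw [cutCount_mk] at hcut
      rcases r with i | i
      · simp only [coarseP] at hr
        rcases hblk i with hin | hout
        · simp [hin hr.1, hin hr.2] at hcut
        · simp [disjoint_left.1 hout hr.1, disjoint_left.1 hout hr.2] at hcut
      · simp only [coarseP] at hr
        have hu : u ∉ U := fun huU => by
          have := hAC u huU
          obtain ⟨sd, x, hx⟩ := mem_Bblk.1 hr.1
          rw [hx] at this; exact Bool.false_ne_true this
        have hv : v ∉ U := fun hvU => by
          have := hAC v hvU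
          obtain ⟨sd, x, hx⟩ := mem_Bblk.1 hr.2
          rw [hx] at this; exact Bool.false_ne_true this
        simp [hu, hv] at hcut
  · intro he
    refine ⟨hFM he, ?_⟩
    obtain ⟨ξ, rfl⟩ := mem_Fm_iff.1 he
    rw [fEdge, cutCount_mk]
    have h1 : π.symm (Cslot ξ) ∈ U := hCU (by simp [Cset, mem_pull, CSlots])
    have h2 : π.symm (Dslot ξ) ∉ U := hDU _ (by simp [Dset, mem_pull, DSlots])
    simp [h1, h2]

end Literature.Barriers.PneNP


/-! ## Part: `TSPExtensionComplexityRothvossW` -/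

/-!
# Rothvoß's weight matrix `W`, the measures `μ₃`, `μ_k`, and `⟨W, S⟩ = 1`

Support file for the discharge of `Literature.Barriers.PneNP.Rothvoss2017_tsp` (Rothvoß 2017,
§2–3). Rothvoß chooses "`W_{U,M} = -∞` if `|δ(U) ∩ M| = 1`, `1/|Q₃|` if `= 3`,
`-(1/(k-1))·1/|Q_k|` if `= k`" so that "`⟨W,S⟩ = 0 + (3-1)|Q₃|/|Q₃| - (k-1)|Q_k|/((k-1)|Q_k|) = 1`"
(PDF p. 6), and compares `μ₃(ℛ)`, `μ_k(ℛ)` — the measures of a rectangle under the uniform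
distributions on `Q₃`, `Q_k` — through their generation by random partitions (§3.2, PDF p. 9:
"`μ₃(ℛ) = E_T[E_{|H|=3}[p^ex_{M,T}(H) · p^ex_{U,T}(H)]]`").

Formalisation (ours, equivalent for the argument): we DEFINE `μ₃`, `μ_k` by the generating
formula — expectations over the uniform permutation `π` (= partition with `3`-matching, see
`…RothvossSlots.lean`) of `p^ex_U · p^ex_M` — and `W` as the corresponding kernel, with the
finite value `-1` in place of `-∞`:

* `pU3 𝒰 π = |𝒰ex(π) ∩ 𝒰| / |𝒰ex(π)|`, `pM3`, `pUC`, `pMF`; `mu3 𝒰 ℳ = E_π[pU3 · pM3]`,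
  `muK 𝒰 ℳ = E_π[pUC · pMF]`;
* `Wmat U M = -[|δ(U) ∩ M| = 1] + kern3 U M - kernK U M / (k-1)`;
* `sum_Wmat` — on a rectangle `𝒰 × ℳ`: `Σ W = -|ℛ ∩ Q₁| + μ₃(ℛ) - μ_k(ℛ)/(k-1)`;
* `sum_kern3_slack`, `sum_kernK_slack`, `sum_Wmat_slack` — `⟨W, S⟩ = 1` where
  `S_{UM} = |δ(U) ∩ M| - 1` over `t`-cuts × perfect matchings (by the key facts `δ(U) ∩ M = H`
  resp. `= F` on the supports of the two kernels).

## Roadmap of this line (seat 0, for coordination)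
Landed: `…Farkas`, `…Faces`, `…Factorization`, `…Entropy` (Lemma 10), `…Matchings`,
`…HubGadget`, `…RothvossAveraging`. Written, landing as the build queue allows:
`…MatchingsOps`, `…PMPolytope` (`pmPolytope`, odd cuts, `HasEFOfSize.pm_hyperplane_separation`),
`…HubGadgetTours` + `…PMtoTSP` (`hasEF_pmPolytope_of_tsp`), `…RothvossSlots/Cuts/Mex` (this
file's imports), `…RothvossTransport`. Next: `…RothvossGood` (Lemmas 8, 9, good pairs),
`…RothvossUBad`/`…RothvossMBad` (Lemmas 14, 15 via slot permutations and
`card_filter_and_le_of_fibres`), `…RothvossFinal` (Lemma 7, Lemma 6, Thm. 1, Cor. 2).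

Sources: [Rothvoss2017] §2 (PDF p. 6), §3.2 (PDF p. 9).
-/

noncomputable section

namespace Literature.Barriers.PneNP

open Finset Slot

variable {m q : ℕ}

/-! ### The conditional probabilities and the measures -/

section defs

variable (μ : ℕ)

/-- `p^ex_{U,T}(H) = Pr[U ∈ 𝒰 | U ∈ 𝒰ex(T,H)]`. [cite: Rothvoss2017, §3.2 (PDF p. 8)] -/
def pU3 (𝒰 : Finset (Finset (Slot m q))) (π : Equiv.Perm (Slot m q)) : ℝ :=
  ((Uex3 μ π ∩ 𝒰).card : ℝ) / (Uex3 μ π).card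

/-- `p^ex_{U,T}(C) = Pr[U ∈ 𝒰 | U ∩ C = C]`. [cite: Rothvoss2017, §3.2 (PDF p. 8)] -/
def pUC (𝒰 : Finset (Finset (Slot m q))) (π : Equiv.Perm (Slot m q)) : ℝ :=
  ((UexC μ π ∩ 𝒰).card : ℝ) / (UexC μ π).card

/-- `p^ex_{M,T}(H) = Pr[M ∈ ℳ | M ∩ δ(C) = H]`. [cite: Rothvoss2017, §3.2 (PDF p. 8)] -/
def pM3 (ℳ : Finset (Finset (Sym2 (Slot m q)))) (π : Equiv.Perm (Slot m q)) : ℝ :=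
  ((Mex3 π ∩ ℳ).card : ℝ) / (Mex3 π).card

/-- `p^ex_{M,T}(F) = Pr[M ∈ ℳ | F ⊆ M]`. [cite: Rothvoss2017, §3.2 (PDF p. 9)] -/
def pMF (ℳ : Finset (Finset (Sym2 (Slot m q)))) (π : Equiv.Perm (Slot m q)) : ℝ :=
  ((MexF π ∩ ℳ).card : ℝ) / (MexF π).card

/-- **`μ₃(ℛ) = E_π[p^ex_U · p^ex_M]`.** [cite: Rothvoss2017, §3.2 (PDF p. 9)] -/
def mu3 (𝒰 : Finset (Finset (Slot m q))) (ℳ : Finset (Finset (Sym2 (Slot m q)))) : ℝ :=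
  (∑ π : Equiv.Perm (Slot m q), pU3 μ 𝒰 π * pM3 ℳ π) / Fintype.card (Equiv.Perm (Slot m q))

/-- **`μ_k(ℛ) = E_π[p^ex_U(F) · p^ex_M(F)]`.** [cite: Rothvoss2017, §3.2 (PDF p. 9)] -/
def muK (𝒰 : Finset (Finset (Slot m q))) (ℳ : Finset (Finset (Sym2 (Slot m q)))) : ℝ :=
  (∑ π : Equiv.Perm (Slot m q), pUC μ 𝒰 π * pMF ℳ π) / Fintype.card (Equiv.Perm (Slot m q))

/-- The kernel of `μ₃` at one permutation. [folklore] -/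
def g3 (π : Equiv.Perm (Slot m q)) (U : Finset (Slot m q)) (M : Finset (Sym2 (Slot m q))) : ℝ :=
  (if U ∈ Uex3 μ π then (1 : ℝ) else 0) * (if M ∈ Mex3 π then (1 : ℝ) else 0) /
    (((Uex3 μ π).card : ℝ) * (Mex3 π).card)

/-- The kernel of `μ_k` at one permutation. [folklore] -/
def gK (π : Equiv.Perm (Slot m q)) (U : Finset (Slot m q)) (M : Finset (Sym2 (Slot m q))) : ℝ :=
  (if U ∈ UexC μ π then (1 : ℝ) else 0) * (if M ∈ MexF π then (1 : ℝ) else 0) /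
    (((UexC μ π).card : ℝ) * (MexF π).card)

/-- The kernel of `μ₃`: `Σ_{ℛ} kern3 = μ₃(ℛ)`. [folklore] -/
def kern3 (U : Finset (Slot m q)) (M : Finset (Sym2 (Slot m q))) : ℝ :=
  (∑ π : Equiv.Perm (Slot m q), g3 μ π U M) / Fintype.card (Equiv.Perm (Slot m q))

/-- The kernel of `μ_k`. [folklore] -/
def kernK (U : Finset (Slot m q)) (M : Finset (Sym2 (Slot m q))) : ℝ :=
  (∑ π : Equiv.Perm (Slot m q), gK μ π U M) / Fintype.card (Equiv.Perm (Slot m q))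

variable (q) in
/-- **Rothvoß's weight matrix** (with `-1` for `-∞`; `k - 1 = q + 2`):
`W_{U,M} = -[|δ(U) ∩ M| = 1] + kern3 - kernK/(k-1)`. [cite: Rothvoss2017, §2 (PDF p. 6)] -/
def Wmat (U : Finset (Slot m q)) (M : Finset (Sym2 (Slot m q))) : ℝ :=
  -(if (M.filter fun e => cutCount U e = 1).card = 1 then (1 : ℝ) else 0) +
    kern3 μ U M - kernK μ U M / ((q : ℝ) + 2)

end defs

/-! ### Rectangle sums -/

/-- A double indicator sum is a product of intersection sizes. [folklore] -/
theorem sum_sum_ite_mul {α β : Type*} [DecidableEq α] [DecidableEq β] (𝒰 : Finset α) (ℳ : Finset β)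
    (A : Finset α) (B : Finset β) (c : ℝ) :
    ∑ U ∈ 𝒰, ∑ M ∈ ℳ, (if U ∈ A then (1 : ℝ) else 0) * (if M ∈ B then (1 : ℝ) else 0) * c =
      ((A ∩ 𝒰).card : ℝ) * ((B ∩ ℳ).card : ℝ) * c := by
  rw [card_inter_eq_sum_ite, card_inter_eq_sum_ite, sum_mul, sum_mul]
  refine sum_congr rfl fun U _ => ?_
  rw [mul_sum, sum_mul]

/-- Pulling a triple sum's innermost index out. [folklore] -/
theorem sum_sum_sum_comm {α β γ : Type*} (s : Finset α) (t : Finset β) (u : Finset γ)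
    (f : α → β → γ → ℝ) :
    ∑ a ∈ s, ∑ b ∈ t, ∑ c ∈ u, f a b c = ∑ c ∈ u, ∑ a ∈ s, ∑ b ∈ t, f a b c := by
  calc ∑ a ∈ s, ∑ b ∈ t, ∑ c ∈ u, f a b c = ∑ a ∈ s, ∑ c ∈ u, ∑ b ∈ t, f a b c :=
        sum_congr rfl fun _ _ => sum_comm
    _ = ∑ c ∈ u, ∑ a ∈ s, ∑ b ∈ t, f a b c := sum_comm

variable (μ : ℕ)

/-- Auxiliary (`sum_g3`). [folklore] -/
theorem sum_g3 (π : Equiv.Perm (Slot m q)) (𝒰 : Finset (Finset (Slot m q)))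
    (ℳ : Finset (Finset (Sym2 (Slot m q)))) :
    ∑ U ∈ 𝒰, ∑ M ∈ ℳ, g3 μ π U M = pU3 μ 𝒰 π * pM3 ℳ π := by
  simp only [g3, div_eq_mul_inv]
  rw [sum_sum_ite_mul, pU3, pM3, mul_inv]
  ring

/-- Auxiliary (`sum_gK`). [folklore] -/
theorem sum_gK (π : Equiv.Perm (Slot m q)) (𝒰 : Finset (Finset (Slot m q)))
    (ℳ : Finset (Finset (Sym2 (Slot m q)))) :
    ∑ U ∈ 𝒰, ∑ M ∈ ℳ, gK μ π U M = pUC μ 𝒰 π * pMF ℳ π := by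
  simp only [gK, div_eq_mul_inv]
  rw [sum_sum_ite_mul, pUC, pMF, mul_inv]
  ring

/-- **`Σ_{ℛ} kern3 = μ₃(ℛ)`.** [cite: Rothvoss2017, §3.2 (PDF p. 9)] -/
theorem sum_kern3 (𝒰 : Finset (Finset (Slot m q))) (ℳ : Finset (Finset (Sym2 (Slot m q)))) :
    ∑ U ∈ 𝒰, ∑ M ∈ ℳ, kern3 μ U M = mu3 μ 𝒰 ℳ := by
  simp only [kern3, mu3, ← sum_div]
  congr 1
  rw [sum_sum_sum_comm]
  exact sum_congr rfl fun π _ => sum_g3 μ π 𝒰 ℳ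

/-- **`Σ_{ℛ} kernK = μ_k(ℛ)`.** [cite: Rothvoss2017, §3.2 (PDF p. 9)] -/
theorem sum_kernK (𝒰 : Finset (Finset (Slot m q))) (ℳ : Finset (Finset (Sym2 (Slot m q)))) :
    ∑ U ∈ 𝒰, ∑ M ∈ ℳ, kernK μ U M = muK μ 𝒰 ℳ := by
  simp only [kernK, muK, ← sum_div]
  congr 1
  rw [sum_sum_sum_comm]
  exact sum_congr rfl fun π _ => sum_gK μ π 𝒰 ℳ

/-- **The rectangle sum of `W`**: `Σ_{U ∈ 𝒰, M ∈ ℳ} W_{UM} = -|ℛ ∩ Q₁| + μ₃(ℛ) - μ_k(ℛ)/(k-1)`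
where `|ℛ ∩ Q₁|` counts the pairs of the rectangle with `|δ(U) ∩ M| = 1`.
[cite: Rothvoss2017, §2–3 (PDF pp. 6, 8)] -/
theorem sum_Wmat (𝒰 : Finset (Finset (Slot m q))) (ℳ : Finset (Finset (Sym2 (Slot m q)))) :
    ∑ U ∈ 𝒰, ∑ M ∈ ℳ, Wmat q μ U M =
      -(∑ U ∈ 𝒰, ∑ M ∈ ℳ, (if (M.filter fun e => cutCount U e = 1).card = 1 then (1 : ℝ) else 0)) +
        mu3 μ 𝒰 ℳ - muK μ 𝒰 ℳ / ((q : ℝ) + 2) := by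
  simp only [Wmat, sum_add_distrib, sum_sub_distrib, sum_neg_distrib, ← sum_div, sum_kern3, sum_kernK]

/-! ### `⟨W, S⟩ = 1` -/

section slack

variable {μ}
variable (hq : 0 < q) (hqe : Even q) (hm : m = 2 * μ + 1)
include hq hqe hm

/-- Over `t`-cuts and perfect matchings, the `μ₃`-kernel weighted by the slack sums to `2`:
on its support `|δ(U) ∩ M| - 1 = |H| - 1 = 2`. [cite: Rothvoss2017, §2 (PDF p. 6)] -/
theorem sum_kern3_slack :
    ∑ a : {U : Finset (Slot m q) // U.card = tCut q μ},
      ∑ b : {M : Finset (Sym2 (Slot m q)) // IsPMOn univ M},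
        kern3 μ a.1 b.1 * ((((b.1).filter fun e => cutCount a.1 e = 1).card : ℝ) - 1) = 2 := by
  classical
  -- pointwise in `π`: the weighted kernel sums to `2 / |Ω|`
  have hN : (0 : ℝ) < Fintype.card (Equiv.Perm (Slot m q)) := by exact_mod_cast Fintype.card_pos
  have key : ∀ π : Equiv.Perm (Slot m q),
      ∑ a : {U : Finset (Slot m q) // U.card = tCut q μ},
        ∑ b : {M : Finset (Sym2 (Slot m q)) // IsPMOn univ M},
          g3 μ π a.1 b.1 * ((((b.1).filter fun e => cutCount a.1 e = 1).card : ℝ) - 1) = 2 := by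
    intro π
    have hA : (0 : ℝ) < (Uex3 μ π).card := by exact_mod_cast (Uex3_nonempty hq hm π).card_pos
    have hB : (0 : ℝ) < (Mex3 π).card := by exact_mod_cast (Mex3_nonempty hqe π).card_pos
    -- only pairs in `𝒰ex × ℳex` contribute, each contributing `2 / (|𝒰ex| |ℳex|)`
    have hterm : ∀ (a : {U : Finset (Slot m q) // U.card = tCut q μ})
        (b : {M : Finset (Sym2 (Slot m q)) // IsPMOn univ M}),
        g3 μ π a.1 b.1 * ((((b.1).filter fun e => cutCount a.1 e = 1).card : ℝ) - 1) =
          (if a.1 ∈ Uex3 μ π then (1 : ℝ) else 0) * (if b.1 ∈ Mex3 π then (1 : ℝ) else 0) *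
            (2 / (((Uex3 μ π).card : ℝ) * (Mex3 π).card)) := by
      intro a b
      by_cases ha : a.1 ∈ Uex3 μ π
      · by_cases hb : b.1 ∈ Mex3 π
        · rw [cut_eq_H ha hb, card_Hm]
          simp only [g3, ha, hb, if_true]
          norm_num
          ring
        · simp [g3, hb]
      · simp [g3, ha]
    simp only [hterm]
    -- convert to sums over the finsets `Uex3`, `Mex3`
    have hsumU : ∀ (F : Finset (Slot m q) → ℝ),
        ∑ a : {U : Finset (Slot m q) // U.card = tCut q μ}, (if a.1 ∈ Uex3 μ π then (1 : ℝ) else 0) * F a.1 =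
          ∑ U ∈ Uex3 μ π, F U := by
      intro F
      simp only [ite_mul, one_mul, zero_mul]
      rw [← sum_filter]
      have hset : (univ.filter fun a : {U : Finset (Slot m q) // U.card = tCut q μ} => a.1 ∈ Uex3 μ π) =
          (Uex3 μ π).subtype fun U => U.card = tCut q μ := by
        ext a; simp [mem_subtype]
      rw [hset, sum_subtype_eq_sum_filter, filter_true_of_mem]
      intro U hU
      simp only [Uex3, UallP, mem_filter] at hU
      exact hU.1.2.1
    have hsumM : ∀ (G : Finset (Sym2 (Slot m q)) → ℝ),
        ∑ b : {M : Finset (Sym2 (Slot m q)) // IsPMOn univ M}, (if b.1 ∈ Mex3 π then (1 : ℝ) else 0) * G b.1 =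
          ∑ M ∈ Mex3 π, G M := by
      intro G
      simp only [ite_mul, one_mul, zero_mul]
      rw [← sum_filter]
      have hset : (univ.filter fun b : {M : Finset (Sym2 (Slot m q)) // IsPMOn univ M} => b.1 ∈ Mex3 π) =
          (Mex3 π).subtype fun M => IsPMOn univ M := by
        ext b; simp [mem_subtype]
      rw [hset, sum_subtype_eq_sum_filter, filter_true_of_mem]
      intro M hM
      simp only [Mex3, MallP, mem_filter, mem_perfectMatchings] at hM
      exact hM.1.1
    have h1 : ∀ (a : {U : Finset (Slot m q) // U.card = tCut q μ}),
        ∑ b : {M : Finset (Sym2 (Slot m q)) // IsPMOn univ M},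
          (if a.1 ∈ Uex3 μ π then (1 : ℝ) else 0) * (if b.1 ∈ Mex3 π then (1 : ℝ) else 0) *
            (2 / (((Uex3 μ π).card : ℝ) * (Mex3 π).card)) =
          (if a.1 ∈ Uex3 μ π then (1 : ℝ) else 0) *
            (((Mex3 π).card : ℝ) * (2 / (((Uex3 μ π).card : ℝ) * (Mex3 π).card))) := by
      intro a
      simp only [mul_assoc, ← mul_sum]
      congr 1
      rw [hsumM fun _ => 2 / (((Uex3 μ π).card : ℝ) * (Mex3 π).card), sum_const, nsmul_eq_mul]
    simp only [h1]
    rw [hsumU fun _ => ((Mex3 π).card : ℝ) * (2 / (((Uex3 μ π).card : ℝ) * (Mex3 π).card)),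
      sum_const, nsmul_eq_mul]
    field_simp
  calc ∑ a : {U : Finset (Slot m q) // U.card = tCut q μ},
        ∑ b : {M : Finset (Sym2 (Slot m q)) // IsPMOn univ M},
          kern3 μ a.1 b.1 * ((((b.1).filter fun e => cutCount a.1 e = 1).card : ℝ) - 1)
      = ∑ a : {U : Finset (Slot m q) // U.card = tCut q μ},
          ∑ b : {M : Finset (Sym2 (Slot m q)) // IsPMOn univ M},
            (∑ π : Equiv.Perm (Slot m q),
              g3 μ π a.1 b.1 * ((((b.1).filter fun e => cutCount a.1 e = 1).card : ℝ) - 1)) /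
              Fintype.card (Equiv.Perm (Slot m q)) := by
        simp only [kern3, div_mul_eq_mul_div, sum_mul]
    _ = (∑ π : Equiv.Perm (Slot m q), ∑ a : {U : Finset (Slot m q) // U.card = tCut q μ},
          ∑ b : {M : Finset (Sym2 (Slot m q)) // IsPMOn univ M},
            g3 μ π a.1 b.1 * ((((b.1).filter fun e => cutCount a.1 e = 1).card : ℝ) - 1)) /
            Fintype.card (Equiv.Perm (Slot m q)) := by
        simp only [← sum_div]
        rw [sum_sum_sum_comm]
    _ = (∑ _π : Equiv.Perm (Slot m q), (2 : ℝ)) / Fintype.card (Equiv.Perm (Slot m q)) := by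
        congr 1
        exact sum_congr rfl fun π _ => key π
    _ = 2 := by
        rw [sum_const, card_univ, nsmul_eq_mul]
        field_simp

/-- Over `t`-cuts and perfect matchings, the `μ_k`-kernel weighted by the slack sums to
`k - 1 = q + 2`: on its support `|δ(U) ∩ M| - 1 = |F| - 1`. [cite: Rothvoss2017, §2 (PDF p. 6)] -/
theorem sum_kernK_slack :
    ∑ a : {U : Finset (Slot m q) // U.card = tCut q μ},
      ∑ b : {M : Finset (Sym2 (Slot m q)) // IsPMOn univ M},
        kernK μ a.1 b.1 * ((((b.1).filter fun e => cutCount a.1 e = 1).card : ℝ) - 1) = (q : ℝ) + 2 := by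
  classical
  have hN : (0 : ℝ) < Fintype.card (Equiv.Perm (Slot m q)) := by exact_mod_cast Fintype.card_pos
  have key : ∀ π : Equiv.Perm (Slot m q),
      ∑ a : {U : Finset (Slot m q) // U.card = tCut q μ},
        ∑ b : {M : Finset (Sym2 (Slot m q)) // IsPMOn univ M},
          gK μ π a.1 b.1 * ((((b.1).filter fun e => cutCount a.1 e = 1).card : ℝ) - 1) = (q : ℝ) + 2 := by
    intro π
    have hA : (0 : ℝ) < (UexC μ π).card := by exact_mod_cast (UexC_nonempty hq hm π).card_pos
    have hB : (0 : ℝ) < (MexF π).card := by exact_mod_cast (MexF_nonempty hqe π).card_pos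
    have hterm : ∀ (a : {U : Finset (Slot m q) // U.card = tCut q μ})
        (b : {M : Finset (Sym2 (Slot m q)) // IsPMOn univ M}),
        gK μ π a.1 b.1 * ((((b.1).filter fun e => cutCount a.1 e = 1).card : ℝ) - 1) =
          (if a.1 ∈ UexC μ π then (1 : ℝ) else 0) * (if b.1 ∈ MexF π then (1 : ℝ) else 0) *
            (((q : ℝ) + 2) / (((UexC μ π).card : ℝ) * (MexF π).card)) := by
      intro a b
      by_cases ha : a.1 ∈ UexC μ π
      · by_cases hb : b.1 ∈ MexF π
        · rw [cut_eq_F ha hb, card_Fm]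
          simp only [gK, ha, hb, if_true]
          push_cast
          ring
        · simp [gK, hb]
      · simp [gK, ha]
    simp only [hterm]
    have hsumU : ∀ (F : Finset (Slot m q) → ℝ),
        ∑ a : {U : Finset (Slot m q) // U.card = tCut q μ}, (if a.1 ∈ UexC μ π then (1 : ℝ) else 0) * F a.1 =
          ∑ U ∈ UexC μ π, F U := by
      intro F
      simp only [ite_mul, one_mul, zero_mul]
      rw [← sum_filter]
      have hset : (univ.filter fun a : {U : Finset (Slot m q) // U.card = tCut q μ} => a.1 ∈ UexC μ π) =
          (UexC μ π).subtype fun U => U.card = tCut q μ := by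
        ext a; simp [mem_subtype]
      rw [hset, sum_subtype_eq_sum_filter, filter_true_of_mem]
      intro U hU
      simp only [UexC, UallP, mem_filter] at hU
      exact hU.1.2.1
    have hsumM : ∀ (G : Finset (Sym2 (Slot m q)) → ℝ),
        ∑ b : {M : Finset (Sym2 (Slot m q)) // IsPMOn univ M}, (if b.1 ∈ MexF π then (1 : ℝ) else 0) * G b.1 =
          ∑ M ∈ MexF π, G M := by
      intro G
      simp only [ite_mul, one_mul, zero_mul]
      rw [← sum_filter]
      have hset : (univ.filter fun b : {M : Finset (Sym2 (Slot m q)) // IsPMOn univ M} => b.1 ∈ MexF π) =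
          (MexF π).subtype fun M => IsPMOn univ M := by
        ext b; simp [mem_subtype]
      rw [hset, sum_subtype_eq_sum_filter, filter_true_of_mem]
      intro M hM
      simp only [MexF, MallP, mem_filter, mem_perfectMatchings] at hM
      exact hM.1.1
    have h1 : ∀ (a : {U : Finset (Slot m q) // U.card = tCut q μ}),
        ∑ b : {M : Finset (Sym2 (Slot m q)) // IsPMOn univ M},
          (if a.1 ∈ UexC μ π then (1 : ℝ) else 0) * (if b.1 ∈ MexF π then (1 : ℝ) else 0) *
            (((q : ℝ) + 2) / (((UexC μ π).card : ℝ) * (MexF π).card)) =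
          (if a.1 ∈ UexC μ π then (1 : ℝ) else 0) *
            (((MexF π).card : ℝ) * (((q : ℝ) + 2) / (((UexC μ π).card : ℝ) * (MexF π).card))) := by
      intro a
      simp only [mul_assoc, ← mul_sum]
      congr 1
      rw [hsumM fun _ => ((q : ℝ) + 2) / (((UexC μ π).card : ℝ) * (MexF π).card), sum_const, nsmul_eq_mul]
    simp only [h1]
    rw [hsumU fun _ => ((MexF π).card : ℝ) * (((q : ℝ) + 2) / (((UexC μ π).card : ℝ) * (MexF π).card)),
      sum_const, nsmul_eq_mul]
    field_simp
  calc ∑ a : {U : Finset (Slot m q) // U.card = tCut q μ},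
        ∑ b : {M : Finset (Sym2 (Slot m q)) // IsPMOn univ M},
          kernK μ a.1 b.1 * ((((b.1).filter fun e => cutCount a.1 e = 1).card : ℝ) - 1)
      = ∑ a : {U : Finset (Slot m q) // U.card = tCut q μ},
          ∑ b : {M : Finset (Sym2 (Slot m q)) // IsPMOn univ M},
            (∑ π : Equiv.Perm (Slot m q),
              gK μ π a.1 b.1 * ((((b.1).filter fun e => cutCount a.1 e = 1).card : ℝ) - 1)) /
              Fintype.card (Equiv.Perm (Slot m q)) := by
        simp only [kernK, div_mul_eq_mul_div, sum_mul]
    _ = (∑ π : Equiv.Perm (Slot m q), ∑ a : {U : Finset (Slot m q) // U.card = tCut q μ},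
          ∑ b : {M : Finset (Sym2 (Slot m q)) // IsPMOn univ M},
            gK μ π a.1 b.1 * ((((b.1).filter fun e => cutCount a.1 e = 1).card : ℝ) - 1)) /
            Fintype.card (Equiv.Perm (Slot m q)) := by
        simp only [← sum_div]
        rw [sum_sum_sum_comm]
    _ = (∑ _π : Equiv.Perm (Slot m q), ((q : ℝ) + 2)) / Fintype.card (Equiv.Perm (Slot m q)) := by
        congr 1
        exact sum_congr rfl fun π _ => key π
    _ = (q : ℝ) + 2 := by
        rw [sum_const, card_univ, nsmul_eq_mul]
        field_simp

/-- **`⟨W, S⟩ = 1`** for the slack matrix `S_{UM} = |δ(U) ∩ M| - 1` of the odd-cut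
inequalities (`t`-cuts) against the perfect matchings: "`⟨W,S⟩ = 0 + (3-1)·|Q₃|·(1/|Q₃|) -
(k-1)·|Q_k|·(1/(k-1))·(1/|Q_k|) = 1`". [cite: Rothvoss2017, §2, eq. (2) (PDF p. 6)] -/
theorem sum_Wmat_slack :
    ∑ a : {U : Finset (Slot m q) // U.card = tCut q μ},
      ∑ b : {M : Finset (Sym2 (Slot m q)) // IsPMOn univ M},
        Wmat q μ a.1 b.1 * ((((b.1).filter fun e => cutCount a.1 e = 1).card : ℝ) - 1) = 1 := by
  have h3 := sum_kern3_slack (m := m) (μ := μ) hq hqe hm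
  have hK := sum_kernK_slack (m := m) (μ := μ) hq hqe hm
  have h1 : ∀ (a : {U : Finset (Slot m q) // U.card = tCut q μ})
      (b : {M : Finset (Sym2 (Slot m q)) // IsPMOn univ M}),
      -(if ((b.1).filter fun e => cutCount a.1 e = 1).card = 1 then (1 : ℝ) else 0) *
        ((((b.1).filter fun e => cutCount a.1 e = 1).card : ℝ) - 1) = 0 := by
    intro a b
    split_ifs with h
    · rw [h]; norm_num
    · simp
  have hq2 : (q : ℝ) + 2 ≠ 0 := by positivity
  simp only [Wmat, add_mul, sub_mul, sum_sub_distrib, h1, zero_add, div_mul_eq_mul_div, ← sum_div]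
  rw [h3, hK, div_self hq2]
  norm_num

end slack

end Literature.Barriers.PneNP

end


/-! ## Part: `TSPExtensionComplexityRothvossPerms` -/

/-!
# Rothvoß's partitions, IV: re-indexing the `C–D` pairing (the maps behind "`H ∼ (F choose 3)`")

Support file for the discharge of `Literature.Barriers.PneNP.Rothvoss2017_tsp` (Rothvoß 2017,
§3.4). In the bound for good pairs Rothvoß rewrites "`E_{|H|=3}[…] = E_{|F|=k}[E_{H ∼ (F choose 3)}[…]]`"
(PDF p. 10): a uniformly random `3`-matching `H ⊆ C × D` is a uniformly random `3`-subset of a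
uniformly random perfect `C–D` matching `F`. In the slot model (`…RothvossSlots.lean`) `F(π)` is
indexed by `X = Fin 3 ⊕ Fin q` and `H(π)` is its part indexed by `inl`; re-indexing `X` by a
permutation `τ` is realised on the vertex side by left-multiplying `π` with the slot
permutation `cdPerm τ` (apply `τ` to the index of every `C`- and `D`-slot). This file proves that
`cdPerm τ` leaves the partition `T(π)`, `F(π)`, `𝒰_all`, `ℳ_all`, `C`, `D` unchanged and moves
`H(π)` to the `3` edges of `F(π)` indexed by `τ⁻¹(inl ·)` (`Hm_cdPerm_mul`), with the matching
statement for `c = V(H) ∩ C` (`cset_cdPerm_mul`). All [folklore].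
-/

namespace Literature.Barriers.PneNP

open Finset Slot

variable {m q : ℕ}

namespace Slot

/-- Apply `τ` to the index of every `C`-slot and every `D`-slot; fix all other slots. [folklore] -/
def cdMap (τ : Equiv.Perm (Fin 3 ⊕ Fin q)) : Slot m q → Slot m q
  | c t => Cslot (τ (Sum.inl t))
  | d t => Dslot (τ (Sum.inl t))
  | dr x => Dslot (τ (Sum.inr x))
  | a i x => if i = Fin.last m then Cslot (τ (Sum.inr x)) else a i x
  | b i sd x => b i sd x

/-- Auxiliary (`cdMap_Cslot`). [folklore] -/
@[simp] theorem cdMap_Cslot (τ : Equiv.Perm (Fin 3 ⊕ Fin q)) (ξ : Fin 3 ⊕ Fin q) :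
    cdMap τ (Cslot ξ : Slot m q) = Cslot (τ ξ) := by
  rcases ξ with t | x
  · rfl
  · simp [Cslot, cdMap]

/-- Auxiliary (`cdMap_Dslot`). [folklore] -/
@[simp] theorem cdMap_Dslot (τ : Equiv.Perm (Fin 3 ⊕ Fin q)) (ξ : Fin 3 ⊕ Fin q) :
    cdMap τ (Dslot ξ : Slot m q) = Dslot (τ ξ) := by
  rcases ξ with t | x <;> rfl

/-- Auxiliary (`cdMap_a_of_ne`). [folklore] -/
theorem cdMap_a_of_ne (τ : Equiv.Perm (Fin 3 ⊕ Fin q)) {i : Fin (m + 1)} (hi : i ≠ Fin.last m) (x : Fin q) :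
    cdMap τ (a i x : Slot m q) = a i x := by
  simp [cdMap, hi]

/-- Auxiliary (`cdMap_b`). [folklore] -/
@[simp] theorem cdMap_b (τ : Equiv.Perm (Fin 3 ⊕ Fin q)) (i : Fin m) (sd : Bool) (x : Fin q) :
    cdMap τ (b i sd x : Slot m q) = b i sd x := rfl

/-- Every slot is a `C`-slot, a `D`-slot, or fixed by all `cdMap`. [folklore] -/
theorem slot_trichotomy (s : Slot m q) :
    (∃ ξ, s = Cslot ξ) ∨ (∃ ξ, s = Dslot ξ) ∨ ((∃ i x, i ≠ Fin.last m ∧ s = a i x) ∨ ∃ i sd x, s = b i sd x) := by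
  rcases s with ⟨i, x⟩ | t | t | x | ⟨i, sd, x⟩
  · by_cases hi : i = Fin.last m
    · subst hi
      exact Or.inl ⟨Sum.inr x, rfl⟩
    · exact Or.inr (Or.inr (Or.inl ⟨i, x, hi, rfl⟩))
  · exact Or.inl ⟨Sum.inl t, rfl⟩
  · exact Or.inr (Or.inl ⟨Sum.inl t, rfl⟩)
  · exact Or.inr (Or.inl ⟨Sum.inr x, rfl⟩)
  · exact Or.inr (Or.inr (Or.inr ⟨i, sd, x, rfl⟩))

/-- Auxiliary (`cdMap_comp`). [folklore] -/
theorem cdMap_comp (σ τ : Equiv.Perm (Fin 3 ⊕ Fin q)) (s : Slot m q) :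
    cdMap σ (cdMap τ s) = cdMap (τ.trans σ) s := by
  rcases slot_trichotomy s with ⟨ξ, rfl⟩ | ⟨ξ, rfl⟩ | (⟨i, x, hi, rfl⟩ | ⟨i, sd, x, rfl⟩)
  · simp
  · simp
  · simp [cdMap_a_of_ne _ hi]
  · simp

/-- Auxiliary (`cdMap_one`). [folklore] -/
theorem cdMap_one (s : Slot m q) : cdMap (Equiv.refl _) s = s := by
  rcases slot_trichotomy s with ⟨ξ, rfl⟩ | ⟨ξ, rfl⟩ | (⟨i, x, hi, rfl⟩ | ⟨i, sd, x, rfl⟩)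
  · simp
  · simp
  · simp [cdMap_a_of_ne _ hi]
  · simp

/-- **The slot permutation re-indexing the `C–D` pairing by `τ`.** [folklore] -/
def cdPerm (τ : Equiv.Perm (Fin 3 ⊕ Fin q)) : Equiv.Perm (Slot m q) where
  toFun := cdMap τ
  invFun := cdMap τ.symm
  left_inv s := by rw [cdMap_comp]; simp [cdMap_one]
  right_inv s := by rw [cdMap_comp]; simp [cdMap_one]

/-- Auxiliary (`cdPerm_apply`). [folklore] -/
@[simp] theorem cdPerm_apply (τ : Equiv.Perm (Fin 3 ⊕ Fin q)) (s : Slot m q) : cdPerm τ s = cdMap τ s := rfl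
/-- Auxiliary (`cdPerm_symm_apply`). [folklore] -/
@[simp] theorem cdPerm_symm_apply (τ : Equiv.Perm (Fin 3 ⊕ Fin q)) (s : Slot m q) :
    (cdPerm τ).symm s = cdMap τ.symm s := rfl

/-- Auxiliary (`role_cdMap`). [folklore] -/
theorem role_cdMap (τ : Equiv.Perm (Fin 3 ⊕ Fin q)) (s : Slot m q) : role (cdMap τ s) = role s := by
  rcases slot_trichotomy s with ⟨ξ, rfl⟩ | ⟨ξ, rfl⟩ | (⟨i, x, hi, rfl⟩ | ⟨i, sd, x, rfl⟩)
  · simp [role_Cslot]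
  · simp [role_Dslot]
  · simp [cdMap_a_of_ne _ hi]
  · simp

/-- Auxiliary (`isAC_cdMap`). [folklore] -/
theorem isAC_cdMap (τ : Equiv.Perm (Fin 3 ⊕ Fin q)) (s : Slot m q) : isAC (cdMap τ s) = isAC s := by
  rcases slot_trichotomy s with ⟨ξ, rfl⟩ | ⟨ξ, rfl⟩ | (⟨i, x, hi, rfl⟩ | ⟨i, sd, x, rfl⟩)
  · rw [cdMap_Cslot, isAC_of_mem_CSlots (by simp [CSlots]), isAC_of_mem_CSlots (by simp [CSlots])]
  · rw [cdMap_Dslot, isAC_of_mem_DSlots (by simp [DSlots]), isAC_of_mem_DSlots (by simp [DSlots])]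
  · simp [cdMap_a_of_ne _ hi]
  · simp

/-- Auxiliary (`cdMap_mem_CSlots_iff`). [folklore] -/
theorem cdMap_mem_CSlots_iff (τ : Equiv.Perm (Fin 3 ⊕ Fin q)) (s : Slot m q) :
    cdMap τ s ∈ CSlots ↔ s ∈ CSlots := by
  rcases slot_trichotomy s with ⟨ξ, rfl⟩ | ⟨ξ, rfl⟩ | (⟨i, x, hi, rfl⟩ | ⟨i, sd, x, rfl⟩)
  · simp [CSlots]
  · simp only [cdMap_Dslot, CSlots, mem_image, mem_univ, true_and]
    constructor
    · rintro ⟨ζ, hζ⟩; exact absurd hζ (Cslot_ne_Dslot _ _)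
    · rintro ⟨ζ, hζ⟩; exact absurd hζ (Cslot_ne_Dslot _ _)
  · rw [cdMap_a_of_ne _ hi]
  · simp

/-- Auxiliary (`cdMap_mem_DSlots_iff`). [folklore] -/
theorem cdMap_mem_DSlots_iff (τ : Equiv.Perm (Fin 3 ⊕ Fin q)) (s : Slot m q) :
    cdMap τ s ∈ DSlots ↔ s ∈ DSlots := by
  rcases slot_trichotomy s with ⟨ξ, rfl⟩ | ⟨ξ, rfl⟩ | (⟨i, x, hi, rfl⟩ | ⟨i, sd, x, rfl⟩)
  · simp only [cdMap_Cslot, DSlots, mem_image, mem_univ, true_and]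
    constructor
    · rintro ⟨ζ, hζ⟩; exact absurd hζ.symm (Cslot_ne_Dslot _ _)
    · rintro ⟨ζ, hζ⟩; exact absurd hζ.symm (Cslot_ne_Dslot _ _)
  · simp [DSlots]
  · rw [cdMap_a_of_ne _ hi]
  · simp

/-- Auxiliary (`cdMap_mem_aSlots_iff`). [folklore] -/
theorem cdMap_mem_aSlots_iff (τ : Equiv.Perm (Fin 3 ⊕ Fin q)) {j : Fin (m + 1)} (hj : j ≠ Fin.last m)
    (s : Slot m q) : cdMap τ s ∈ aSlots j ↔ s ∈ aSlots j := by
  rcases slot_trichotomy s with ⟨ξ, rfl⟩ | ⟨ξ, rfl⟩ | (⟨i, x, hi, rfl⟩ | ⟨i, sd, x, rfl⟩)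
  · rw [cdMap_Cslot]
    rcases ξ with t | x <;> rcases hτ : τ _ with t' | x' <;> simp [Cslot, Ne.symm hj]
  · rw [cdMap_Dslot]
    rcases ξ with t | x <;> rcases hτ : τ _ with t' | x' <;> simp [Dslot]
  · rw [cdMap_a_of_ne _ hi]
  · simp

end Slot

/-! ### The partition data under `cdPerm τ * π` -/

section cd

variable (τ : Equiv.Perm (Fin 3 ⊕ Fin q)) (π : Equiv.Perm (Slot m q))

/-- Auxiliary (`cdPerm_mul_apply`). [folklore] -/
theorem cdPerm_mul_apply (v : Slot m q) : (cdPerm τ * π : Equiv.Perm (Slot m q)) v = cdMap τ (π v) := rfl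

/-- Auxiliary (`Ablk_cdPerm_mul`). [folklore] -/
theorem Ablk_cdPerm_mul (i : Fin m) : Ablk (cdPerm τ * π) i = Ablk π i := by
  ext v
  simp only [Ablk, mem_pull, cdPerm_mul_apply]
  exact cdMap_mem_aSlots_iff τ (Fin.castSucc_lt_last i).ne (π v)

/-- Auxiliary (`Cset_cdPerm_mul`). [folklore] -/
theorem Cset_cdPerm_mul : Cset (cdPerm τ * π) = Cset π := by
  ext v
  simp only [Cset, mem_pull, cdPerm_mul_apply]
  exact cdMap_mem_CSlots_iff τ _

/-- Auxiliary (`Dset_cdPerm_mul`). [folklore] -/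
theorem Dset_cdPerm_mul : Dset (cdPerm τ * π) = Dset π := by
  ext v
  simp only [Dset, mem_pull, cdPerm_mul_apply]
  exact cdMap_mem_DSlots_iff τ _

/-- Auxiliary (`Uall_cdPerm_mul`). [folklore] -/
theorem Uall_cdPerm_mul (μ : ℕ) : UallP μ (cdPerm τ * π) = UallP μ π := by
  ext U
  simp only [UallP, mem_filter, mem_univ, true_and, Ablk_cdPerm_mul, cdPerm_mul_apply, isAC_cdMap]

/-- Auxiliary (`UexC_cdPerm_mul`). [folklore] -/
theorem UexC_cdPerm_mul (μ : ℕ) : UexC μ (cdPerm τ * π) = UexC μ π := by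
  rw [UexC, UexC, Uall_cdPerm_mul, Cset_cdPerm_mul]

/-- Auxiliary (`sameRole_cdPerm_mul`). [folklore] -/
theorem sameRole_cdPerm_mul (e : Sym2 (Slot m q)) : SameRole (cdPerm τ * π) e ↔ SameRole π e := by
  induction e using Sym2.ind with
  | h u v => simp only [sameRole_mk, cdPerm_mul_apply, role_cdMap]

/-- Auxiliary (`Mall_cdPerm_mul`). [folklore] -/
theorem Mall_cdPerm_mul : MallP (cdPerm τ * π) = MallP π := by
  ext M
  simp only [MallP, mem_filter, sameRole_cdPerm_mul]

/-- Auxiliary (`fEdge_cdPerm_mul`). [folklore] -/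
theorem fEdge_cdPerm_mul (ξ : Fin 3 ⊕ Fin q) : fEdge (cdPerm τ * π) ξ = fEdge π (τ.symm ξ) := by
  have h1 : (cdPerm τ * π : Equiv.Perm (Slot m q)).symm (Cslot ξ) = π.symm (Cslot (τ.symm ξ)) := by
    show π.symm ((cdPerm τ).symm (Cslot ξ)) = _
    rw [cdPerm_symm_apply, cdMap_Cslot]
  have h2 : (cdPerm τ * π : Equiv.Perm (Slot m q)).symm (Dslot ξ) = π.symm (Dslot (τ.symm ξ)) := by
    show π.symm ((cdPerm τ).symm (Dslot ξ)) = _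
    rw [cdPerm_symm_apply, cdMap_Dslot]
  simp only [fEdge, h1, h2]

/-- Auxiliary (`Fm_cdPerm_mul`). [folklore] -/
theorem Fm_cdPerm_mul : Fm (cdPerm τ * π) = Fm π := by
  ext e
  simp only [mem_Fm_iff, fEdge_cdPerm_mul]
  constructor
  · rintro ⟨ξ, rfl⟩; exact ⟨τ.symm ξ, rfl⟩
  · rintro ⟨ξ, rfl⟩; exact ⟨τ ξ, by simp⟩

/-- Auxiliary (`MexF_cdPerm_mul`). [folklore] -/
theorem MexF_cdPerm_mul : MexF (cdPerm τ * π) = MexF π := by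
  rw [MexF, MexF, Mall_cdPerm_mul, Fm_cdPerm_mul]

/-- The `3`-subset of indices selected by `τ`: `J = τ⁻¹(inl ·)`. [folklore] -/
def selJ (τ : Equiv.Perm (Fin 3 ⊕ Fin q)) : Finset (Fin 3 ⊕ Fin q) :=
  univ.image fun t : Fin 3 => τ.symm (Sum.inl t)

/-- The `3` edges of `F(π)` indexed by `J`. [folklore] -/
def HmJ (π : Equiv.Perm (Slot m q)) (J : Finset (Fin 3 ⊕ Fin q)) : Finset (Sym2 (Slot m q)) :=
  J.image (fEdge π)

/-- Their `C`-endpoints. [folklore] -/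
def csetJ (π : Equiv.Perm (Slot m q)) (J : Finset (Fin 3 ⊕ Fin q)) : Finset (Slot m q) :=
  J.image fun ξ => π.symm (Cslot ξ)

/-- **`H(cdPerm τ · π)` is the part of `F(π)` indexed by `τ⁻¹(inl ·)`.** [folklore] -/
theorem Hm_cdPerm_mul : Hm (cdPerm τ * π) = HmJ π (selJ τ) := by
  ext e
  simp only [Hm, HmJ, selJ, mem_image, mem_univ, true_and, fEdge_cdPerm_mul]
  constructor
  · rintro ⟨t, rfl⟩; exact ⟨τ.symm (Sum.inl t), ⟨t, rfl⟩, rfl⟩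
  · rintro ⟨ξ, ⟨t, rfl⟩, rfl⟩; exact ⟨t, rfl⟩

/-- … and `c` moves accordingly. [folklore] -/
theorem cset_cdPerm_mul : cset (cdPerm τ * π) = csetJ π (selJ τ) := by
  ext v
  simp only [cset, mem_pull, cdPerm_mul_apply, mem_cSlots, csetJ, selJ, mem_image, mem_univ, true_and]
  constructor
  · rintro ⟨t, ht⟩
    -- `cdMap τ (π v) = c t` forces `π v = Cslot ξ` with `τ ξ = inl t`
    rcases slot_trichotomy (π v) with ⟨ξ, hξ⟩ | ⟨ξ, hξ⟩ | (⟨i, x, hi, hix⟩ | ⟨i, sd, x, hb⟩)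
    · refine ⟨ξ, ⟨t, ?_⟩, by rw [← hξ]; simp⟩
      rw [hξ, cdMap_Cslot] at ht
      have : τ ξ = Sum.inl t := by
        rcases hτ : τ ξ with t' | x'
        · rw [hτ] at ht; simp only [Cslot, Slot.c.injEq] at ht; rw [ht]
        · rw [hτ] at ht; simp [Cslot] at ht
      rw [← this]; simp
    · rw [hξ, cdMap_Dslot] at ht
      exact absurd ht.symm (by rcases τ ξ with t' | x' <;> simp [Dslot])
    · rw [hix, cdMap_a_of_ne _ hi] at ht; simp at ht
    · rw [hb, cdMap_b] at ht; simp at ht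
  · rintro ⟨ξ, ⟨t, rfl⟩, rfl⟩
    refine ⟨t, ?_⟩
    rw [Equiv.apply_symm_apply, cdMap_Cslot, Equiv.apply_symm_apply]
    rfl

/-- Auxiliary (`Mex3_cdPerm_mul`). [folklore] -/
theorem Mex3_cdPerm_mul :
    Mex3 (cdPerm τ * π) = (MallP π).filter fun M => (M.filter fun e => cutCount (Cset π) e = 1) = HmJ π (selJ τ) := by
  rw [Mex3, Mall_cdPerm_mul, Cset_cdPerm_mul, Hm_cdPerm_mul]

/-- Auxiliary (`Uex3_cdPerm_mul`). [folklore] -/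
theorem Uex3_cdPerm_mul (μ : ℕ) :
    Uex3 μ (cdPerm τ * π) = (UallP μ π).filter fun U => U ∩ Cset π = csetJ π (selJ τ) := by
  rw [Uex3, Uall_cdPerm_mul, Cset_cdPerm_mul, cset_cdPerm_mul]

/-- `selJ τ` has three elements. [folklore] -/
theorem card_selJ : (selJ τ).card = 3 := by
  rw [selJ, card_image_of_injective]
  · simp
  · intro t t' h
    simpa using h

end cd

/-! ### Every `3`-subset of the indices is selected by some `τ` -/

/-- A permutation of `X = Fin 3 ⊕ Fin q` sending the `3`-set `J` onto `inl(Fin 3)`. [folklore] -/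
noncomputable def permOfJ (J : Finset (Fin 3 ⊕ Fin q)) (hJ : J.card = 3) : Equiv.Perm (Fin 3 ⊕ Fin q) :=
  have hc : Fintype.card {ξ // ξ ∉ J} = q := by
    have h1 : Fintype.card {ξ // ξ ∉ J} = Fintype.card (Fin 3 ⊕ Fin q) - Fintype.card {ξ // ξ ∈ J} := by
      rw [Fintype.card_subtype_compl]
    rw [h1, Fintype.card_sum, Fintype.card_fin, Fintype.card_fin, Fintype.card_coe, hJ]
    omega
  (Equiv.sumCompl fun ξ => ξ ∈ J).symm.trans
    (Equiv.sumCongr ((J.equivFin).trans (finCongr hJ)) (Fintype.equivFinOfCardEq hc))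

/-- Auxiliary (`permOfJ_mem`). [folklore] -/
theorem permOfJ_mem (J : Finset (Fin 3 ⊕ Fin q)) (hJ : J.card = 3) {ξ : Fin 3 ⊕ Fin q} (hξ : ξ ∈ J) :
    ∃ t : Fin 3, permOfJ J hJ ξ = Sum.inl t := by
  refine ⟨(J.equivFin.trans (finCongr hJ)) ⟨ξ, hξ⟩, ?_⟩
  simp only [permOfJ, Equiv.trans_apply]
  rw [show (Equiv.sumCompl fun ξ => ξ ∈ J).symm ξ = Sum.inl ⟨ξ, hξ⟩ from
    (Equiv.symm_apply_eq _).2 (by simp)]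
  simp

/-- **`selJ (permOfJ J) = J`.** [folklore] -/
theorem selJ_permOfJ (J : Finset (Fin 3 ⊕ Fin q)) (hJ : J.card = 3) : selJ (permOfJ J hJ) = J := by
  apply (eq_of_subset_of_card_le _ _).symm
  · intro ξ hξ
    obtain ⟨t, ht⟩ := permOfJ_mem J hJ hξ
    rw [selJ, mem_image]
    exact ⟨t, mem_univ _, by rw [← ht]; simp⟩
  · rw [card_selJ, hJ]

end Literature.Barriers.PneNP


/-! ## Part: `TSPExtensionComplexityRothvossTheta` -/

/-!
# Rothvoß's partitions, V: exchanging an `A`-block with `C ∖ V(H)` (the maps behind Lemma 14)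

Support file for the discharge of `Literature.Barriers.PneNP.Rothvoss2017_tsp` (Rothvoß 2017,
proof of Lemma 14, PDF pp. 11–12): "we take a random uniform index `i ∼ J` and declare `Ã_i` as
the missing `k-3` nodes `C ∖ V(H)`. Finally we set `{A₁,…,A_m} := {Ã₁,…,Ã_{i-1},Ã_{i+1},…,Ã_{m+1}}`."
In the slot model (`…RothvossSlots.lean`) the `A`-type blocks are `Ã_j = π⁻¹{a j ·}` (`j ≤ m`,
`Ã_m = C ∖ V(H)`), and choosing `Ã_i` as `C ∖ V(H)` instead is left multiplication of `π` by the
slot permutation `aSwap i` (swap the indices `i` and `m` of the `a`-slots). This file: `aSwap i`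
and the partition data of `aSwap i · π` — the `A`-type blocks are permuted (`Atil_aSwap_mul`),
`H`, `c`, `d`, the matchings side `ℳex` are unchanged (`Hm_aSwap_mul`, `Mex3_aSwap_mul`), and the
cuts of `𝒰ex` / of `{U ∩ C = C}` become the `U_I = c ∪ ⋃_{j ∈ I} Ã_j` with `i ∉ I` / `i ∈ I`
(`mem_Uex3_aSwap_mul_iff`, `mem_UexC_aSwap_mul_iff`) — "the vectors `y ∈ Y` represent all the
cuts in the rectangle … roughly half of the vectors have `y_i = 1`" (PDF p. 12). All [folklore].
-/

namespace Literature.Barriers.PneNP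

open Finset Slot

variable {m q : ℕ}

namespace Slot

/-- Swap the indices `i` and `m` of the `a`-slots; fix all other slots. [folklore] -/
def aSwapMap (i : Fin (m + 1)) : Slot m q → Slot m q
  | a j x => a (Equiv.swap i (Fin.last m) j) x
  | c t => c t
  | d t => d t
  | dr x => dr x
  | b j sd x => b j sd x

/-- Auxiliary (`aSwapMap_involutive`). [folklore] -/
theorem aSwapMap_involutive (i : Fin (m + 1)) : Function.Involutive (aSwapMap i : Slot m q → Slot m q) := by
  intro s
  rcases s with ⟨j, x⟩ | t | t | x | ⟨j, sd, x⟩ <;> simp [aSwapMap, Equiv.swap_apply_self]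

/-- **The slot permutation exchanging `Ã_i` and `Ã_m = C ∖ V(H)`.** [folklore] -/
def aSwap (i : Fin (m + 1)) : Equiv.Perm (Slot m q) :=
  (aSwapMap_involutive (q := q) i).toPerm _

/-- Auxiliary (`aSwap_apply`). [folklore] -/
@[simp] theorem aSwap_apply (i : Fin (m + 1)) (s : Slot m q) : aSwap i s = aSwapMap i s := rfl

/-- Auxiliary (`aSwap_symm_apply`). [folklore] -/
@[simp] theorem aSwap_symm_apply (i : Fin (m + 1)) (s : Slot m q) : (aSwap i).symm s = aSwapMap i s := by
  rw [Equiv.symm_apply_eq, aSwap_apply, aSwapMap_involutive]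

/-- Auxiliary (`aSwapMap_a`). [folklore] -/
@[simp] theorem aSwapMap_a (i j : Fin (m + 1)) (x : Fin q) :
    aSwapMap i (a j x : Slot m q) = a (Equiv.swap i (Fin.last m) j) x := rfl
/-- Auxiliary (`aSwapMap_c`). [folklore] -/
@[simp] theorem aSwapMap_c (i : Fin (m + 1)) (t : Fin 3) : aSwapMap i (c t : Slot m q) = c t := rfl
/-- Auxiliary (`aSwapMap_d`). [folklore] -/
@[simp] theorem aSwapMap_d (i : Fin (m + 1)) (t : Fin 3) : aSwapMap i (d t : Slot m q) = d t := rfl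
/-- Auxiliary (`aSwapMap_dr`). [folklore] -/
@[simp] theorem aSwapMap_dr (i : Fin (m + 1)) (x : Fin q) : aSwapMap i (dr x : Slot m q) = dr x := rfl
/-- Auxiliary (`aSwapMap_b`). [folklore] -/
@[simp] theorem aSwapMap_b (i : Fin (m + 1)) (j : Fin m) (sd : Bool) (x : Fin q) :
    aSwapMap i (b j sd x : Slot m q) = b j sd x := rfl

/-- Auxiliary (`isAC_aSwapMap`). [folklore] -/
theorem isAC_aSwapMap (i : Fin (m + 1)) (s : Slot m q) : isAC (aSwapMap i s) = isAC s := by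
  rcases s with ⟨j, x⟩ | t | t | x | ⟨j, sd, x⟩ <;> rfl

/-- `aSwapMap i s` is an `a j`-slot iff `s` is an `a (swap j)`-slot. [folklore] -/
theorem aSwapMap_eq_a_iff (i j : Fin (m + 1)) (x : Fin q) (s : Slot m q) :
    aSwapMap i s = a j x ↔ s = a (Equiv.swap i (Fin.last m) j) x := by
  rcases s with ⟨j', x'⟩ | t | t | x' | ⟨j', sd, x'⟩ <;> simp only [aSwapMap, Slot.a.injEq, reduceCtorEq]
  constructor
  · rintro ⟨h1, rfl⟩; exact ⟨by rw [← h1, Equiv.swap_apply_self], rfl⟩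
  · rintro ⟨rfl, rfl⟩; exact ⟨by rw [Equiv.swap_apply_self], rfl⟩

end Slot

/-! ### The partition data under `aSwap i * π` -/

section swap

variable (i : Fin (m + 1)) (π : Equiv.Perm (Slot m q))

/-- Auxiliary (`aSwap_mul_apply`). [folklore] -/
theorem aSwap_mul_apply (v : Slot m q) : (aSwap i * π : Equiv.Perm (Slot m q)) v = aSwapMap i (π v) := rfl

/-- The `A`-type blocks are permuted. [folklore] -/
theorem Atil_aSwap_mul (j : Fin (m + 1)) : Atil (aSwap i * π) j = Atil π (Equiv.swap i (Fin.last m) j) := by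
  ext v
  simp only [mem_Atil, aSwap_mul_apply, aSwapMap_eq_a_iff]

/-- Auxiliary (`cset_aSwap_mul`). [folklore] -/
theorem cset_aSwap_mul : cset (aSwap i * π) = cset π := by
  ext v
  simp only [mem_cset, aSwap_mul_apply]
  rcases h : π v with ⟨j, x⟩ | t | t | x | ⟨j, sd, x⟩ <;> simp [aSwapMap]

/-- Auxiliary (`dset_aSwap_mul`). [folklore] -/
theorem dset_aSwap_mul : dset (aSwap i * π) = dset π := by
  ext v
  simp only [mem_dset, aSwap_mul_apply]
  rcases h : π v with ⟨j, x⟩ | t | t | x | ⟨j, sd, x⟩ <;> simp [aSwapMap]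

/-- Auxiliary (`Drest_aSwap_mul`). [folklore] -/
theorem Drest_aSwap_mul : Drest (aSwap i * π) = Drest π := by
  ext v
  simp only [mem_Drest, aSwap_mul_apply]
  rcases h : π v with ⟨j, x⟩ | t | t | x | ⟨j, sd, x⟩ <;> simp [aSwapMap]

/-- Auxiliary (`Bblk_aSwap_mul`). [folklore] -/
theorem Bblk_aSwap_mul (j : Fin m) : Bblk (aSwap i * π) j = Bblk π j := by
  ext v
  simp only [mem_Bblk, aSwap_mul_apply]
  rcases h : π v with ⟨j', x⟩ | t | t | x | ⟨j', sd, x⟩ <;> simp [aSwapMap]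

/-- Auxiliary (`Cset_aSwap_mul`). [folklore] -/
theorem Cset_aSwap_mul : Cset (aSwap i * π) = cset π ∪ Atil π i := by
  rw [Cset_eq, cset_aSwap_mul, Atil_aSwap_mul, Equiv.swap_apply_right]

/-- Auxiliary (`Hm_aSwap_mul`). [folklore] -/
theorem Hm_aSwap_mul : Hm (aSwap i * π) = Hm π := by
  ext e
  simp only [mem_Hm_iff]
  have h1 : ∀ t, (aSwap i * π : Equiv.Perm (Slot m q)).symm (c t) = π.symm (c t) := fun t => by
    show π.symm ((aSwap i).symm (c t)) = _
    rw [aSwap_symm_apply]; rfl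
  have h2 : ∀ t, (aSwap i * π : Equiv.Perm (Slot m q)).symm (d t) = π.symm (d t) := fun t => by
    show π.symm ((aSwap i).symm (d t)) = _
    rw [aSwap_symm_apply]; rfl
  simp only [h1, h2]

/-- The fine blocks are re-indexed. [folklore] -/
theorem fineP_aSwap_mul (r : Fin (m + 1) ⊕ Unit ⊕ Fin m) :
    fineP (aSwap i * π) r = fineP π (match r with
      | Sum.inl j => Sum.inl (Equiv.swap i (Fin.last m) j)
      | Sum.inr s => Sum.inr s) := by
  rcases r with j | ⟨⟩ | j
  · exact Atil_aSwap_mul i π j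
  · exact Drest_aSwap_mul i π
  · exact Bblk_aSwap_mul i π j

/-- Auxiliary (`exists_fineP_aSwap_mul_iff`). [folklore] -/
theorem exists_fineP_aSwap_mul_iff (e : Sym2 (Slot m q)) :
    (∃ r, e ∈ (fineP (aSwap i * π) r).sym2) ↔ ∃ r, e ∈ (fineP π r).sym2 := by
  constructor
  · rintro ⟨r, hr⟩
    rw [fineP_aSwap_mul] at hr
    exact ⟨_, hr⟩
  · rintro ⟨r, hr⟩
    rcases r with j | s
    · refine ⟨Sum.inl (Equiv.swap i (Fin.last m) j), ?_⟩
      rw [fineP_aSwap_mul]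
      simpa [Equiv.swap_apply_self] using hr
    · exact ⟨Sum.inr s, by rw [fineP_aSwap_mul]; exact hr⟩

/-- Auxiliary (`biUnion_fineP_aSwap_mul`). [folklore] -/
theorem biUnion_fineP_aSwap_mul : univ.biUnion (fineP (aSwap i * π)) = univ.biUnion (fineP π) := by
  rw [biUnion_fineP, biUnion_fineP, cset_aSwap_mul, dset_aSwap_mul]

/-- **The matching side is unchanged**: `ℳex(aSwap i · π) = ℳex(π)`. [folklore] -/
theorem Mex3_aSwap_mul : Mex3 (aSwap i * π) = Mex3 π := by
  ext M
  rw [mem_Mex3_iff, mem_Mex3_iff, Hm_aSwap_mul, biUnion_fineP_aSwap_mul]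
  simp only [exists_fineP_aSwap_mul_iff]

/-- **The cuts after the exchange**: `𝒰ex(aSwap i · π) = {U_I : |I| = μ+1, i ∉ I}`. [folklore] -/
theorem mem_Uex3_aSwap_mul_iff {μ : ℕ} (hq : 0 < q) {U : Finset (Slot m q)} :
    U ∈ Uex3 μ (aSwap i * π) ↔ ∃ I : Finset (Fin (m + 1)), I.card = μ + 1 ∧ i ∉ I ∧ U = cutOf π I := by
  rw [mem_Uex3_iff hq]
  have hcut : ∀ I : Finset (Fin (m + 1)), cutOf (aSwap i * π) I = cutOf π (I.map (Equiv.swap i (Fin.last m)).toEmbedding) := by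
    intro I
    ext v
    simp only [mem_cutOf, cset_aSwap_mul, Atil_aSwap_mul, mem_map, Equiv.coe_toEmbedding]
    constructor
    · rintro (h | ⟨j, hj, hv⟩)
      · exact Or.inl h
      · exact Or.inr ⟨_, ⟨j, hj, rfl⟩, hv⟩
    · rintro (h | ⟨j', ⟨j, hj, rfl⟩, hv⟩)
      · exact Or.inl h
      · exact Or.inr ⟨j, hj, hv⟩
  constructor
  · rintro ⟨I, hI, hlast, rfl⟩
    refine ⟨I.map (Equiv.swap i (Fin.last m)).toEmbedding, by rw [card_map, hI], ?_, hcut I⟩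
    rw [mem_map]
    rintro ⟨j, hj, hji⟩
    simp only [Equiv.coe_toEmbedding] at hji
    have : j = Fin.last m := by
      rw [← (Equiv.swap i (Fin.last m)).injective.eq_iff, hji, Equiv.swap_apply_right]
    exact hlast (this ▸ hj)
  · rintro ⟨I, hI, hiI, rfl⟩
    refine ⟨I.map (Equiv.swap i (Fin.last m)).toEmbedding, by rw [card_map, hI], ?_, ?_⟩
    · rw [mem_map]
      rintro ⟨j, hj, hjl⟩
      simp only [Equiv.coe_toEmbedding] at hjl
      have : j = i := by
        rw [← (Equiv.swap i (Fin.last m)).injective.eq_iff, hjl, Equiv.swap_apply_left]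
      exact hiI (this ▸ hj)
    · rw [hcut, map_map]
      congr 1
      conv_lhs => rw [← map_refl (s := I)]
      congr 1
      ext j
      simp [Equiv.swap_apply_self]

/-- … and `{U ∩ C = C}` becomes `{U_I : |I| = μ+1, i ∈ I}`. [folklore] -/
theorem mem_UexC_aSwap_mul_iff {μ : ℕ} (hq : 0 < q) {U : Finset (Slot m q)} :
    U ∈ UexC μ (aSwap i * π) ↔ ∃ I : Finset (Fin (m + 1)), I.card = μ + 1 ∧ i ∈ I ∧ U = cutOf π I := by
  rw [mem_UexC_iff hq]
  have hcut : ∀ I : Finset (Fin (m + 1)), cutOf (aSwap i * π) I = cutOf π (I.map (Equiv.swap i (Fin.last m)).toEmbedding) := by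
    intro I
    ext v
    simp only [mem_cutOf, cset_aSwap_mul, Atil_aSwap_mul, mem_map, Equiv.coe_toEmbedding]
    constructor
    · rintro (h | ⟨j, hj, hv⟩)
      · exact Or.inl h
      · exact Or.inr ⟨_, ⟨j, hj, rfl⟩, hv⟩
    · rintro (h | ⟨j', ⟨j, hj, rfl⟩, hv⟩)
      · exact Or.inl h
      · exact Or.inr ⟨j, hj, hv⟩
  constructor
  · rintro ⟨I, hI, hlast, rfl⟩
    refine ⟨I.map (Equiv.swap i (Fin.last m)).toEmbedding, by rw [card_map, hI], ?_, hcut I⟩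
    rw [mem_map]
    exact ⟨Fin.last m, hlast, by simp⟩
  · rintro ⟨I, hI, hiI, rfl⟩
    refine ⟨I.map (Equiv.swap i (Fin.last m)).toEmbedding, by rw [card_map, hI], ?_, ?_⟩
    · rw [mem_map]
      exact ⟨i, hiI, by simp⟩
    · rw [hcut, map_map]
      congr 1
      conv_lhs => rw [← map_refl (s := I)]
      congr 1
      ext j
      simp [Equiv.swap_apply_self]

end swap

end Literature.Barriers.PneNP


/-! ## Part: `TSPExtensionComplexityRothvossTheta2` -/

/-!
# Rothvoß's partitions, VI: exchanging a `B`-block with `(C ∖ V(H), D ∖ V(H))` (the maps behind Lemma 15)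

Support file for the discharge of `Literature.Barriers.PneNP.Rothvoss2017_tsp` (Rothvoß 2017,
proof of Lemma 15, PDF p. 12): "we randomly partition each `B̃_i`-block into `B̃_i = C_i ∪̇ D_i`
… select a uniform random index `i ∈ [m+1]` and set `C := (C ∩ V(H)) ∪ C_i` and
`D := (V(H) ∩ D) ∪ D_i`." In the slot model this is left multiplication of `π` by the slot
permutation `bswap i₀ h` (`i₀ < m` the chosen block, `h` a relabelling of its `2q` slots deciding
the split): the `b i₀`-slots go to the slots of `C ∖ V(H)` / `D ∖ V(H)` according to the first
coordinate of `h`, and those come back as the `b i₀`-slots. This file: `bswap`, and the partition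
data of `bswap i₀ h · π`: `A`-blocks, `c`, `d`, `H`, and — as a SET — `𝒰ex` are unchanged
(`Uex3_bswap_mul`), the new `C ∖ V(H)`, `D ∖ V(H)` are the two `h`-halves of `B_{i₀}`
(`Crest_bswap_mul`, `Drest_bswap_mul`), the old pair becomes the block `B_{i₀}`
(`Bblk_bswap_mul_self`), and the roles change accordingly (`role_bswapMap`). All [folklore].
-/

namespace Literature.Barriers.PneNP

open Finset Slot

variable {m q : ℕ}

namespace Slot

/-- The exchange of block `B_{i₀}` with `(C ∖ V(H), D ∖ V(H))` along `h`. [folklore] -/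
def bswapMap (i₀ : Fin m) (h : Equiv.Perm (Bool × Fin q)) : Slot m q → Slot m q
  | b j sd x => if j = i₀ then (if (h (sd, x)).1 then dr (h (sd, x)).2 else a (Fin.last m) (h (sd, x)).2) else b j sd x
  | a j x => if j = Fin.last m then b i₀ (h.symm (false, x)).1 (h.symm (false, x)).2 else a j x
  | dr x => b i₀ (h.symm (true, x)).1 (h.symm (true, x)).2
  | c t => c t
  | d t => d t

variable (i₀ : Fin m) (h : Equiv.Perm (Bool × Fin q))

/-- Auxiliary (`bswapMap_c`). [folklore] -/
@[simp] theorem bswapMap_c (t : Fin 3) : bswapMap i₀ h (c t : Slot m q) = c t := rfl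
/-- Auxiliary (`bswapMap_d`). [folklore] -/
@[simp] theorem bswapMap_d (t : Fin 3) : bswapMap i₀ h (d t : Slot m q) = d t := rfl
/-- Auxiliary (`bswapMap_dr`). [folklore] -/
@[simp] theorem bswapMap_dr (x : Fin q) :
    bswapMap i₀ h (dr x : Slot m q) = b i₀ (h.symm (true, x)).1 (h.symm (true, x)).2 := rfl
/-- Auxiliary (`bswapMap_a_last`). [folklore] -/
@[simp] theorem bswapMap_a_last (x : Fin q) :
    bswapMap i₀ h (a (Fin.last m) x : Slot m q) = b i₀ (h.symm (false, x)).1 (h.symm (false, x)).2 := by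
  simp [bswapMap]
/-- Auxiliary (`bswapMap_a_of_ne`). [folklore] -/
theorem bswapMap_a_of_ne {j : Fin (m + 1)} (hj : j ≠ Fin.last m) (x : Fin q) :
    bswapMap i₀ h (a j x : Slot m q) = a j x := by simp [bswapMap, hj]
/-- Auxiliary (`bswapMap_b_self`). [folklore] -/
theorem bswapMap_b_self (sd : Bool) (x : Fin q) :
    bswapMap i₀ h (b i₀ sd x : Slot m q) =
      (if (h (sd, x)).1 then dr (h (sd, x)).2 else a (Fin.last m) (h (sd, x)).2) := by
  simp [bswapMap]
/-- Auxiliary (`bswapMap_b_of_ne`). [folklore] -/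
theorem bswapMap_b_of_ne {j : Fin m} (hj : j ≠ i₀) (sd : Bool) (x : Fin q) :
    bswapMap i₀ h (b j sd x : Slot m q) = b j sd x := by simp [bswapMap, hj]

/-- Auxiliary (`bswapMap_involutive`). [folklore] -/
theorem bswapMap_involutive : Function.Involutive (bswapMap i₀ h : Slot m q → Slot m q) := by
  intro s
  rcases s with ⟨j, x⟩ | t | t | x | ⟨j, sd, x⟩
  · by_cases hj : j = Fin.last m
    · subst hj
      rw [bswapMap_a_last, bswapMap_b_self]
      have : h (h.symm (false, x)) = (false, x) := h.apply_symm_apply _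
      rw [show ((h.symm (false, x)).1, (h.symm (false, x)).2) = h.symm (false, x) from rfl, this]
      simp
    · rw [bswapMap_a_of_ne _ _ hj, bswapMap_a_of_ne _ _ hj]
  · rfl
  · rfl
  · rw [bswapMap_dr, bswapMap_b_self]
    have : h (h.symm (true, x)) = (true, x) := h.apply_symm_apply _
    rw [show ((h.symm (true, x)).1, (h.symm (true, x)).2) = h.symm (true, x) from rfl, this]
    simp
  · by_cases hj : j = i₀
    · subst hj
      rw [bswapMap_b_self]
      split_ifs with h1
      · rw [bswapMap_dr]
        have : h.symm (true, (h (sd, x)).2) = (sd, x) := by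
          rw [Equiv.symm_apply_eq]; ext <;> simp [h1]
        rw [this]
      · rw [bswapMap_a_last]
        have : h.symm (false, (h (sd, x)).2) = (sd, x) := by
          rw [Equiv.symm_apply_eq]; ext <;> simp [h1]
        rw [this]
    · rw [bswapMap_b_of_ne _ _ hj, bswapMap_b_of_ne _ _ hj]

/-- **The slot permutation of Lemma 15's exchange.** [folklore] -/
def bswap : Equiv.Perm (Slot m q) := (bswapMap_involutive (m := m) i₀ h).toPerm _

/-- Auxiliary (`bswap_apply`). [folklore] -/
@[simp] theorem bswap_apply (s : Slot m q) : bswap i₀ h s = bswapMap i₀ h s := rfl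
/-- Auxiliary (`bswap_symm_apply`). [folklore] -/
@[simp] theorem bswap_symm_apply (s : Slot m q) : (bswap i₀ h).symm s = bswapMap i₀ h s := by
  rw [Equiv.symm_apply_eq, bswap_apply, bswapMap_involutive]

/-- `bswapMap s` is an `a j`-slot with `j ≠ m` iff `s` is. [folklore] -/
theorem bswapMap_eq_a_iff_of_ne {j : Fin (m + 1)} (hj : j ≠ Fin.last m) (x : Fin q) (s : Slot m q) :
    bswapMap i₀ h s = a j x ↔ s = a j x := by
  rcases s with ⟨j', x'⟩ | t' | t' | x' | ⟨j', sd, x'⟩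
  · by_cases hj' : j' = Fin.last m
    · subst hj'; rw [bswapMap_a_last]; simp [Ne.symm hj]
    · rw [bswapMap_a_of_ne _ _ hj']
  · exact Iff.rfl
  · exact Iff.rfl
  · rw [bswapMap_dr]; simp
  · by_cases hj' : j' = i₀
    · subst hj'
      by_cases h1 : (h (sd, x')).1 = true
      · rw [bswapMap_b_self, if_pos h1]; simp
      · rw [bswapMap_b_self, if_neg h1]; simp [Ne.symm hj]
    · rw [bswapMap_b_of_ne _ _ hj']

/-- `bswapMap s` is a `c`-slot iff `s` is. [folklore] -/
theorem bswapMap_eq_c_iff (t : Fin 3) (s : Slot m q) : bswapMap i₀ h s = c t ↔ s = c t := by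
  rcases s with ⟨j', x'⟩ | t' | t' | x' | ⟨j', sd, x'⟩
  · by_cases hj' : j' = Fin.last m
    · subst hj'; rw [bswapMap_a_last]; simp
    · rw [bswapMap_a_of_ne _ _ hj']
  · exact Iff.rfl
  · exact Iff.rfl
  · rw [bswapMap_dr]; simp
  · by_cases hj' : j' = i₀
    · subst hj'
      by_cases h1 : (h (sd, x')).1 = true
      · rw [bswapMap_b_self, if_pos h1]; simp
      · rw [bswapMap_b_self, if_neg h1]; simp
    · rw [bswapMap_b_of_ne _ _ hj']

/-- `bswapMap s` is a `d`-slot iff `s` is. [folklore] -/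
theorem bswapMap_eq_d_iff (t : Fin 3) (s : Slot m q) : bswapMap i₀ h s = d t ↔ s = d t := by
  rcases s with ⟨j', x'⟩ | t' | t' | x' | ⟨j', sd, x'⟩
  · by_cases hj' : j' = Fin.last m
    · subst hj'; rw [bswapMap_a_last]; simp
    · rw [bswapMap_a_of_ne _ _ hj']
  · exact Iff.rfl
  · exact Iff.rfl
  · rw [bswapMap_dr]; simp
  · by_cases hj' : j' = i₀
    · subst hj'
      by_cases h1 : (h (sd, x')).1 = true
      · rw [bswapMap_b_self, if_pos h1]; simp
      · rw [bswapMap_b_self, if_neg h1]; simp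
    · rw [bswapMap_b_of_ne _ _ hj']

/-- `bswapMap s` is an `a m`-slot iff `s = b i₀ p` with `(h p).1 = false`. [folklore] -/
theorem bswapMap_mem_aSlots_last_iff (s : Slot m q) :
    (∃ x, bswapMap i₀ h s = a (Fin.last m) x) ↔ ∃ sd x, s = b i₀ sd x ∧ (h (sd, x)).1 = false := by
  rcases s with ⟨j', x'⟩ | t' | t' | x' | ⟨j', sd, x'⟩
  · by_cases hj' : j' = Fin.last m
    · subst hj'; rw [bswapMap_a_last]; simp
    · simp only [bswapMap_a_of_ne _ _ hj']; simp [hj']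
  · show (∃ x, c t' = a (Fin.last m) x) ↔ _; simp
  · show (∃ x, d t' = a (Fin.last m) x) ↔ _; simp
  · rw [bswapMap_dr]; simp
  · by_cases hj' : j' = i₀
    · subst hj'
      by_cases h1 : (h (sd, x')).1 = true
      · rw [bswapMap_b_self, if_pos h1]; simp [h1]
      · have h1' : (h (sd, x')).1 = false := by simpa using h1
        rw [bswapMap_b_self, if_neg h1]; simp [h1']
    · simp only [bswapMap_b_of_ne _ _ hj']; simp [hj']

/-- `bswapMap s` is a `dr`-slot iff `s = b i₀ p` with `(h p).1 = true`. [folklore] -/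
theorem bswapMap_mem_drSlots_iff (s : Slot m q) :
    (∃ x, bswapMap i₀ h s = dr x) ↔ ∃ sd x, s = b i₀ sd x ∧ (h (sd, x)).1 = true := by
  rcases s with ⟨j', x'⟩ | t' | t' | x' | ⟨j', sd, x'⟩
  · by_cases hj' : j' = Fin.last m
    · subst hj'; rw [bswapMap_a_last]; simp
    · simp only [bswapMap_a_of_ne _ _ hj']; simp
  · show (∃ x, c t' = dr x) ↔ _; simp
  · show (∃ x, d t' = dr x) ↔ _; simp
  · rw [bswapMap_dr]; simp
  · by_cases hj' : j' = i₀
    · subst hj'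
      by_cases h1 : (h (sd, x')).1 = true
      · rw [bswapMap_b_self, if_pos h1]; simp [h1]
      · have h1' : (h (sd, x')).1 = false := by simpa using h1
        rw [bswapMap_b_self, if_neg h1]; simp [h1']
    · simp only [bswapMap_b_of_ne _ _ hj']; simp [hj']

/-- `bswapMap s` is a `b i₀`-slot iff `s` is an `a m`- or a `dr`-slot. [folklore] -/
theorem bswapMap_mem_bSlots_self_iff (s : Slot m q) :
    (∃ sd x, bswapMap i₀ h s = b i₀ sd x) ↔ (∃ x, s = a (Fin.last m) x) ∨ ∃ x, s = dr x := by
  rcases s with ⟨j', x'⟩ | t' | t' | x' | ⟨j', sd, x'⟩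
  · by_cases hj' : j' = Fin.last m
    · subst hj'; rw [bswapMap_a_last]; simp
    · simp only [bswapMap_a_of_ne _ _ hj']; simp [hj']
  · show (∃ sd x, c t' = b i₀ sd x) ↔ _; simp
  · show (∃ sd x, d t' = b i₀ sd x) ↔ _; simp
  · rw [bswapMap_dr]; simp
  · by_cases hj' : j' = i₀
    · subst hj'
      by_cases h1 : (h (sd, x')).1 = true
      · rw [bswapMap_b_self, if_pos h1]; simp
      · rw [bswapMap_b_self, if_neg h1]; simp
    · simp only [bswapMap_b_of_ne _ _ hj']; simp [hj']

/-- `bswapMap s` is a `b j`-slot (`j ≠ i₀`) iff `s` is. [folklore] -/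
theorem bswapMap_mem_bSlots_of_ne_iff {j : Fin m} (hj : j ≠ i₀) (s : Slot m q) :
    (∃ sd x, bswapMap i₀ h s = b j sd x) ↔ ∃ sd x, s = b j sd x := by
  rcases s with ⟨j', x'⟩ | t' | t' | x' | ⟨j', sd, x'⟩
  · by_cases hj' : j' = Fin.last m
    · subst hj'; rw [bswapMap_a_last]; simp [Ne.symm hj]
    · simp only [bswapMap_a_of_ne _ _ hj']
  · exact Iff.rfl
  · exact Iff.rfl
  · rw [bswapMap_dr]; simp [Ne.symm hj]
  · by_cases hj' : j' = i₀
    · subst hj'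
      by_cases h1 : (h (sd, x')).1 = true
      · rw [bswapMap_b_self, if_pos h1]; simp [Ne.symm hj]
      · rw [bswapMap_b_self, if_neg h1]; simp [Ne.symm hj]
    · simp only [bswapMap_b_of_ne _ _ hj']

end Slot

/-! ### The partition data under `bswap i₀ h * π` -/

section bs

variable (i₀ : Fin m) (h : Equiv.Perm (Bool × Fin q)) (π : Equiv.Perm (Slot m q))

/-- Auxiliary (`bswap_mul_apply`). [folklore] -/
theorem bswap_mul_apply (v : Slot m q) : (bswap i₀ h * π : Equiv.Perm (Slot m q)) v = bswapMap i₀ h (π v) := rfl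

/-- The `h`-half of `B_{i₀}` that becomes `C ∖ V(H)`. [folklore] -/
def halfC : Finset (Slot m q) := univ.filter fun v => ∃ sd x, π v = b i₀ sd x ∧ (h (sd, x)).1 = false
/-- The `h`-half of `B_{i₀}` that becomes `D ∖ V(H)`. [folklore] -/
def halfD : Finset (Slot m q) := univ.filter fun v => ∃ sd x, π v = b i₀ sd x ∧ (h (sd, x)).1 = true

/-- Auxiliary (`Atil_bswap_mul_of_ne`). [folklore] -/
theorem Atil_bswap_mul_of_ne {j : Fin (m + 1)} (hj : j ≠ Fin.last m) : Atil (bswap i₀ h * π) j = Atil π j := by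
  ext v; simp only [mem_Atil, bswap_mul_apply, bswapMap_eq_a_iff_of_ne _ _ hj]

/-- Auxiliary (`Ablk_bswap_mul`). [folklore] -/
theorem Ablk_bswap_mul (i : Fin m) : Ablk (bswap i₀ h * π) i = Ablk π i := by
  rw [Ablk_eq_Atil, Ablk_eq_Atil, Atil_bswap_mul_of_ne _ _ _ (Fin.castSucc_lt_last i).ne]

/-- Auxiliary (`cset_bswap_mul`). [folklore] -/
theorem cset_bswap_mul : cset (bswap i₀ h * π) = cset π := by
  ext v; simp only [mem_cset, bswap_mul_apply, bswapMap_eq_c_iff]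

/-- Auxiliary (`dset_bswap_mul`). [folklore] -/
theorem dset_bswap_mul : dset (bswap i₀ h * π) = dset π := by
  ext v; simp only [mem_dset, bswap_mul_apply, bswapMap_eq_d_iff]

/-- Auxiliary (`Crest_bswap_mul`). [folklore] -/
theorem Crest_bswap_mul : Atil (bswap i₀ h * π) (Fin.last m) = halfC i₀ h π := by
  ext v
  simp only [mem_Atil, bswap_mul_apply, halfC, mem_filter, mem_univ, true_and]
  exact bswapMap_mem_aSlots_last_iff i₀ h (π v)

/-- Auxiliary (`Drest_bswap_mul`). [folklore] -/
theorem Drest_bswap_mul : Drest (bswap i₀ h * π) = halfD i₀ h π := by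
  ext v
  simp only [mem_Drest, bswap_mul_apply, halfD, mem_filter, mem_univ, true_and]
  exact bswapMap_mem_drSlots_iff i₀ h (π v)

/-- Auxiliary (`Bblk_bswap_mul_self`). [folklore] -/
theorem Bblk_bswap_mul_self : Bblk (bswap i₀ h * π) i₀ = Atil π (Fin.last m) ∪ Drest π := by
  ext v
  simp only [mem_Bblk, bswap_mul_apply, mem_union, mem_Atil, mem_Drest]
  exact bswapMap_mem_bSlots_self_iff i₀ h (π v)

/-- Auxiliary (`Bblk_bswap_mul_of_ne`). [folklore] -/
theorem Bblk_bswap_mul_of_ne {j : Fin m} (hj : j ≠ i₀) : Bblk (bswap i₀ h * π) j = Bblk π j := by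
  ext v
  simp only [mem_Bblk, bswap_mul_apply]
  exact bswapMap_mem_bSlots_of_ne_iff i₀ h hj (π v)

/-- Auxiliary (`Cset_bswap_mul`). [folklore] -/
theorem Cset_bswap_mul : Cset (bswap i₀ h * π) = cset π ∪ halfC i₀ h π := by
  rw [Cset_eq, cset_bswap_mul, Crest_bswap_mul]

/-- Auxiliary (`Hm_bswap_mul`). [folklore] -/
theorem Hm_bswap_mul : Hm (bswap i₀ h * π) = Hm π := by
  ext e
  simp only [mem_Hm_iff]
  have h1 : ∀ t, (bswap i₀ h * π : Equiv.Perm (Slot m q)).symm (c t) = π.symm (c t) := fun t => by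
    show π.symm ((bswap i₀ h).symm (c t)) = _
    rw [bswap_symm_apply]; rfl
  have h2 : ∀ t, (bswap i₀ h * π : Equiv.Perm (Slot m q)).symm (d t) = π.symm (d t) := fun t => by
    show π.symm ((bswap i₀ h).symm (d t)) = _
    rw [bswap_symm_apply]; rfl
  simp only [h1, h2]

/-- Auxiliary (`halfC_union_halfD`). [folklore] -/
theorem halfC_union_halfD : halfC i₀ h π ∪ halfD i₀ h π = Bblk π i₀ := by
  ext v
  simp only [mem_union, halfC, halfD, mem_filter, mem_univ, true_and, mem_Bblk]
  constructor
  · rintro (⟨sd, x, h1, -⟩ | ⟨sd, x, h1, -⟩) <;> exact ⟨sd, x, h1⟩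
  · rintro ⟨sd, x, h1⟩
    cases hb : (h (sd, x)).1
    · exact Or.inl ⟨sd, x, h1, hb⟩
    · exact Or.inr ⟨sd, x, h1, hb⟩

/-- Auxiliary (`disjoint_halfC_halfD`). [folklore] -/
theorem disjoint_halfC_halfD : Disjoint (halfC i₀ h π) (halfD i₀ h π) := by
  rw [disjoint_left]
  intro v h1 h2
  simp only [halfC, halfD, mem_filter, mem_univ, true_and] at h1 h2
  obtain ⟨sd, x, hv, hf⟩ := h1
  obtain ⟨sd', x', hv', ht⟩ := h2
  rw [hv] at hv'
  simp only [Slot.b.injEq, true_and] at hv'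
  obtain ⟨rfl, rfl⟩ := hv'
  rw [hf] at ht
  exact Bool.false_ne_true ht

/-- **`𝒰ex` is unchanged as a set.** [folklore] -/
theorem Uex3_bswap_mul (μ : ℕ) (hq : 0 < q) : Uex3 μ (bswap i₀ h * π) = Uex3 μ π := by
  ext U
  rw [mem_Uex3_iff hq, mem_Uex3_iff hq]
  have key : ∀ I : Finset (Fin (m + 1)), Fin.last m ∉ I → cutOf (bswap i₀ h * π) I = cutOf π I := by
    intro I hI
    ext v
    simp only [mem_cutOf, cset_bswap_mul]
    constructor
    · rintro (hv | ⟨j, hj, hv⟩)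
      · exact Or.inl hv
      · refine Or.inr ⟨j, hj, ?_⟩
        rwa [Atil_bswap_mul_of_ne _ _ _ (fun h' => hI (h' ▸ hj))] at hv
    · rintro (hv | ⟨j, hj, hv⟩)
      · exact Or.inl hv
      · refine Or.inr ⟨j, hj, ?_⟩
        rwa [Atil_bswap_mul_of_ne _ _ _ (fun h' => hI (h' ▸ hj))]
  constructor
  · rintro ⟨I, hI, hlast, rfl⟩; exact ⟨I, hI, hlast, key I hlast⟩
  · rintro ⟨I, hI, hlast, rfl⟩; exact ⟨I, hI, hlast, (key I hlast).symm⟩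

/-- The role of a slot after the exchange. [folklore] -/
theorem role_bswapMap (s : Slot m q) :
    role (bswapMap i₀ h s) =
      if (∃ sd x, s = b i₀ sd x) then Role.CD
      else if (∃ x, s = a (Fin.last m) x) ∨ (∃ x, s = dr x) then Role.B i₀ else role s := by
  rcases s with ⟨j', x'⟩ | t' | t' | x' | ⟨j', sd, x'⟩
  · by_cases hj' : j' = Fin.last m
    · subst hj'; rw [bswapMap_a_last]; simp [role]
    · rw [bswapMap_a_of_ne _ _ hj']; simp [hj']
  · show role (c t') = _; simp
  · show role (d t') = _; simp
  · rw [bswapMap_dr]; simp [role]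
  · by_cases hj' : j' = i₀
    · subst hj'
      by_cases h1 : (h (sd, x')).1 = true
      · rw [bswapMap_b_self, if_pos h1]; simp [role]
      · rw [bswapMap_b_self, if_neg h1]; simp [role]
    · rw [bswapMap_b_of_ne _ _ hj']; simp [hj', role]

end bs

end Literature.Barriers.PneNP


/-! ## Part: `TSPExtensionComplexityRothvossGood` -/

/-!
# Rothvoß's good pairs: the definitions, Lemma 8, and the pointwise `(1+ε)³` comparison

Support file for the discharge of `Literature.Barriers.PneNP.Rothvoss2017_tsp` (Rothvoß 2017,
§3.3–3.4). For a fixed rectangle `ℛ = 𝒰 × ℳ`: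

* `Msup π F = {M ∈ ℳ_all(T) : F ⊆ M}` (so `p_{M,T}(F) = |Msup ∩ ℳ| / |Msup|`), and
  Definitions 1–2 (PDF p. 9) in cross-multiplied form: `MGood` ("`0 < p(H)/(1+ε) ≤ p(F) ≤ (1+ε)p(H)`
  for all `k`-matchings `F` with `H ⊆ F ⊆ E(C ∪ D)`" — these `F` are exactly the perfect
  matchings of `C ∪ D` containing `H`), `UGood` (with `|𝒰ex(T,H)| = |{U : U ∩ C = C}|`,
  `card_Uex3_eq_card_UexC`, the denominators cancel), `Small` (threshold `θ = 2^{-δm}`), `Good`,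
  `Bad`;
* **Lemma 8** (upper half, the one used): `p^ex_M(H) ≤ (1+ε) p_M(H)` for `M`-good pairs
  (`pM3_le_of_MGood`), through the partition of `ℳex(T,H)` by the non-crossing completions
  `F' = H ∪ N_C ∪ N_D` (`Mex3_eq_biUnion_ncSet`);
* the pointwise comparison behind §3.4: for a good pair,
  `p^ex_U(H) p^ex_M(H) ≤ (1+ε)³ p^ex_U(F) p^ex_M(F)` (`pU3_mul_pM3_le_of_Good`).

Sources: [Rothvoss2017] Def. 1, Lemma 8, Def. 2 (PDF p. 9), §3.4 (PDF p. 10).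
-/

noncomputable section

open scoped Classical

namespace Literature.Barriers.PneNP

open Finset Slot

variable {m q : ℕ}

/-! ### `p_{M,T}(F)` and the definitions of good / small / bad -/

/-- `{M ∈ ℳ_all(T) : F ⊆ M}`. [cite: Rothvoss2017, §3.2 (PDF p. 8)] -/
def Msup (π : Equiv.Perm (Slot m q)) (F : Finset (Sym2 (Slot m q))) : Finset (Finset (Sym2 (Slot m q))) :=
  (MallP π).filter fun M => F ⊆ M

/-- Auxiliary (`MexF_eq_Msup`). [folklore] -/
theorem MexF_eq_Msup (π : Equiv.Perm (Slot m q)) : MexF π = Msup π (Fm π) := rfl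

section defs

variable (μ : ℕ) (ε θ : ℝ) (𝒰 : Finset (Finset (Slot m q))) (ℳ : Finset (Finset (Sym2 (Slot m q))))

/-- **Definition 1 (`M`-good)**, cross-multiplied: for every perfect matching `F` of `C ∪ D`
containing `H`, `0 < p(H)` and `p(H) ≤ (1+ε) p(F)`, `p(F) ≤ (1+ε) p(H)` where
`p(F) = |Msup F ∩ ℳ| / |Msup F|`. [cite: Rothvoss2017, Def. 1 (PDF p. 9)] -/
def MGood (π : Equiv.Perm (Slot m q)) : Prop :=
  ∀ F : Finset (Sym2 (Slot m q)), IsPMOn (Cset π ∪ Dset π) F → Hm π ⊆ F →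
    0 < ((Msup π (Hm π) ∩ ℳ).card : ℝ) ∧
    ((Msup π (Hm π) ∩ ℳ).card : ℝ) * (Msup π F).card ≤
      (1 + ε) * (((Msup π F ∩ ℳ).card : ℝ) * (Msup π (Hm π)).card) ∧
    ((Msup π F ∩ ℳ).card : ℝ) * (Msup π (Hm π)).card ≤
      (1 + ε) * (((Msup π (Hm π) ∩ ℳ).card : ℝ) * (Msup π F).card)

/-- **Definition 2 (`U`-good)**, cross-multiplied (the two conditioning families have the same
size): `0 < a`, `a ≤ (1+ε) b`, `b ≤ (1+ε) a` for `a = |𝒰ex(T,H) ∩ 𝒰|`, `b = |{U : U ∩ C = C} ∩ 𝒰|`.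
[cite: Rothvoss2017, Def. 2 (PDF p. 9)] -/
def UGood (π : Equiv.Perm (Slot m q)) : Prop :=
  0 < ((Uex3 μ π ∩ 𝒰).card : ℝ) ∧
    ((Uex3 μ π ∩ 𝒰).card : ℝ) ≤ (1 + ε) * (UexC μ π ∩ 𝒰).card ∧
    ((UexC μ π ∩ 𝒰).card : ℝ) ≤ (1 + ε) * (Uex3 μ π ∩ 𝒰).card

/-- **Small pairs**: `p^ex_M(H) ≤ θ` or `p^ex_U(H) ≤ θ` (`θ = 2^{-δm}`). [cite: Rothvoss2017, §3.3 (PDF p. 9)] -/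
def Small (π : Equiv.Perm (Slot m q)) : Prop :=
  ((Mex3 π ∩ ℳ).card : ℝ) ≤ θ * (Mex3 π).card ∨ ((Uex3 μ π ∩ 𝒰).card : ℝ) ≤ θ * (Uex3 μ π).card

/-- **Good pairs**: `M`-good and `U`-good. [cite: Rothvoss2017, §3.3 (PDF p. 9)] -/
def Good (π : Equiv.Perm (Slot m q)) : Prop := UGood μ ε 𝒰 π ∧ MGood ε ℳ π

/-- **Bad pairs**: neither good nor small. [cite: Rothvoss2017, §3.3 (PDF p. 9)] -/
def Bad (π : Equiv.Perm (Slot m q)) : Prop := ¬Good μ ε 𝒰 ℳ π ∧ ¬Small μ θ 𝒰 ℳ π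

end defs

/-! ### Non-crossing completions and Lemma 8 -/

/-- `C ∖ V(H)`. [folklore] -/
def Crest (π : Equiv.Perm (Slot m q)) : Finset (Slot m q) := Atil π (Fin.last m)

/-- Auxiliary (`Cset_eq_cset_union_Crest`). [folklore] -/
theorem Cset_eq_cset_union_Crest (π : Equiv.Perm (Slot m q)) : Cset π = cset π ∪ Crest π := Cset_eq π

/-- Auxiliary (`Dset_eq_dset_union_Drest`). [folklore] -/
theorem Dset_eq_dset_union_Drest (π : Equiv.Perm (Slot m q)) : Dset π = dset π ∪ Drest π := by
  ext v
  simp only [Dset, mem_pull, mem_DSlots, mem_union, mem_dset, mem_Drest]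

/-- Auxiliary (`disjoint_cset_Crest`). [folklore] -/
theorem disjoint_cset_Crest (π : Equiv.Perm (Slot m q)) : Disjoint (cset π) (Crest π) :=
  disjoint_cset_Atil π _

/-- Auxiliary (`disjoint_dset_Drest`). [folklore] -/
theorem disjoint_dset_Drest (π : Equiv.Perm (Slot m q)) : Disjoint (dset π) (Drest π) := by
  rw [disjoint_left]
  intro v hv hv'
  obtain ⟨t, ht⟩ := mem_dset.1 hv
  obtain ⟨x, hx⟩ := mem_Drest.1 hv'
  rw [ht] at hx
  simp at hx

/-- The non-crossing completions of `H`: `F' = H ∪ N_C ∪ N_D` with `N_C`, `N_D` perfect matchings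
of `C ∖ V(H)` and `D ∖ V(H)` ("take a uniform random `k`-matching `F ∼ {F' ⊆ E(C ∪ D) | δ(C) ∩ F' = H}`").
[cite: Rothvoss2017, proof of Lemma 8 (PDF p. 9)] -/
def ncSet (π : Equiv.Perm (Slot m q)) : Finset (Finset (Sym2 (Slot m q))) :=
  (perfectMatchings (Crest π) ×ˢ perfectMatchings (Drest π)).image fun p => Hm π ∪ (p.1 ∪ p.2)

/-- `V(H) ∪ (C ∖ V(H)) ∪ (D ∖ V(H)) = C ∪ D`. [folklore] -/
theorem CD_decomp (π : Equiv.Perm (Slot m q)) :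
    Cset π ∪ Dset π = (cset π ∪ dset π) ∪ (Crest π ∪ Drest π) := by
  rw [Cset_eq_cset_union_Crest, Dset_eq_dset_union_Drest]
  ext v; simp only [mem_union]; tauto

/-- Auxiliary (`disjoint_VH_rest`). [folklore] -/
theorem disjoint_VH_rest (π : Equiv.Perm (Slot m q)) :
    Disjoint (cset π ∪ dset π) (Crest π ∪ Drest π) := by
  have h1 := disjoint_VH_fine π
  rw [disjoint_left] at h1 ⊢
  intro v hv hv'
  refine h1 hv (mem_biUnion.2 ?_)
  rcases mem_union.1 hv' with h | h
  · exact ⟨Sum.inl (Fin.last m), mem_univ _, h⟩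
  · exact ⟨Sum.inr (Sum.inl ()), mem_univ _, h⟩

/-- Auxiliary (`disjoint_Crest_Drest`). [folklore] -/
theorem disjoint_Crest_Drest (π : Equiv.Perm (Slot m q)) : Disjoint (Crest π) (Drest π) :=
  fineP_disjoint π (Sum.inl (Fin.last m)) (Sum.inr (Sum.inl ())) (by simp)

/-- Members of `ncSet` are perfect matchings of `C ∪ D` containing `H`, with the stated parts.
[folklore] -/
theorem mem_ncSet_iff {π : Equiv.Perm (Slot m q)} {F : Finset (Sym2 (Slot m q))} :
    F ∈ ncSet π ↔ ∃ NC ND, IsPMOn (Crest π) NC ∧ IsPMOn (Drest π) ND ∧ F = Hm π ∪ (NC ∪ ND) := by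
  simp only [ncSet, mem_image, mem_product, mem_perfectMatchings, Prod.exists]
  constructor
  · rintro ⟨NC, ND, ⟨h1, h2⟩, rfl⟩; exact ⟨NC, ND, h1, h2, rfl⟩
  · rintro ⟨NC, ND, h1, h2, rfl⟩; exact ⟨NC, ND, ⟨h1, h2⟩, rfl⟩

/-- Auxiliary (`isPMOn_of_mem_ncSet`). [folklore] -/
theorem isPMOn_of_mem_ncSet {π : Equiv.Perm (Slot m q)} {F : Finset (Sym2 (Slot m q))} (hF : F ∈ ncSet π) :
    IsPMOn (Cset π ∪ Dset π) F ∧ Hm π ⊆ F := by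
  obtain ⟨NC, ND, hC, hD, rfl⟩ := mem_ncSet_iff.1 hF
  refine ⟨?_, subset_union_left⟩
  rw [CD_decomp]
  exact (isPMOn_Hm π).union (hC.union hD (disjoint_Crest_Drest π)) (disjoint_VH_rest π)

/-- Edges of a non-crossing completion other than `H` do not cross `C`. [folklore] -/
theorem cutCount_ne_one_of_mem_ncSet {π : Equiv.Perm (Slot m q)} {F : Finset (Sym2 (Slot m q))}
    (hF : F ∈ ncSet π) {e : Sym2 (Slot m q)} (he : e ∈ F) (heH : e ∉ Hm π) : cutCount (Cset π) e ≠ 1 := by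
  obtain ⟨NC, ND, hC, hD, rfl⟩ := mem_ncSet_iff.1 hF
  rcases mem_union.1 he with h | h
  · exact absurd h heH
  rcases mem_union.1 h with h | h
  · exact cutCount_Cset_ne_one_of_fine (r := Sum.inl (Fin.last m)) (hC.subset_sym2 h)
  · exact cutCount_Cset_ne_one_of_fine (r := Sum.inr (Sum.inl ())) (hD.subset_sym2 h)

/-- For a perfect matching `F` of `C ∪ D` inside `M ∈ ℳ_all`, `F` is exactly the set of
`M`-edges meeting `C ∪ D`. [folklore] -/
theorem eq_filter_of_pm_subset {π : Equiv.Perm (Slot m q)} {F M : Finset (Sym2 (Slot m q))}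
    (hF : IsPMOn (Cset π ∪ Dset π) F) (hM : IsPMOn univ M) (hFM : F ⊆ M) :
    F = M.filter fun e => ∃ u ∈ Cset π ∪ Dset π, u ∈ e := by
  ext e
  simp only [mem_filter]
  constructor
  · intro he
    induction e using Sym2.ind with
    | h u v => exact ⟨hFM he, u, hF.mem_of_mem he (Sym2.mem_mk_left u v), Sym2.mem_mk_left u v⟩
  · rintro ⟨heM, u, hu, hue⟩
    obtain ⟨f, hf, huf⟩ := hF.exists_mem hu
    rw [hM.unique heM (hFM hf) hue huf]
    exact hf

/-- **`ℳex(T,H)` is partitioned by the non-crossing completions.**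
[cite: Rothvoss2017, proof of Lemma 8 (PDF p. 9)] -/
theorem Mex3_eq_biUnion_ncSet (π : Equiv.Perm (Slot m q)) : Mex3 π = (ncSet π).biUnion (Msup π) := by
  ext M
  rw [mem_biUnion]
  constructor
  · intro hM
    have hM' := mem_Mex3_iff.1 hM
    obtain ⟨hHM, hN, hresp⟩ := hM'
    have hMall : M ∈ MallP π := (mem_filter.1 hM).1
    -- the parts of `M ∖ H` in `C ∖ V(H)` and `D ∖ V(H)`
    have hresp' : ∀ e ∈ M \ Hm π, ∃ r ∈ (univ : Finset (Fin (m + 1) ⊕ Unit ⊕ Fin m)), e ∈ (fineP π r).sym2 :=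
      fun e he => by obtain ⟨r, hr⟩ := hresp e he; exact ⟨r, mem_univ _, hr⟩
    have hC : IsPMOn (fineP π (Sum.inl (Fin.last m)))
        ((M \ Hm π).filter fun e => e ∈ (fineP π (Sum.inl (Fin.last m))).sym2) :=
      hN.filter_block (fineP π) (fineP_disjoint π) univ hresp' (mem_univ (Sum.inl (Fin.last m)))
    have hD : IsPMOn (fineP π (Sum.inr (Sum.inl ())))
        ((M \ Hm π).filter fun e => e ∈ (fineP π (Sum.inr (Sum.inl ()))).sym2) :=
      hN.filter_block (fineP π) (fineP_disjoint π) univ hresp' (mem_univ (Sum.inr (Sum.inl ())))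
    refine ⟨Hm π ∪ (((M \ Hm π).filter fun e => e ∈ (fineP π (Sum.inl (Fin.last m))).sym2) ∪
      ((M \ Hm π).filter fun e => e ∈ (fineP π (Sum.inr (Sum.inl ()))).sym2)),
      mem_ncSet_iff.2 ⟨_, _, hC, hD, rfl⟩, ?_⟩
    rw [Msup, mem_filter]
    refine ⟨hMall, union_subset hHM (union_subset ?_ ?_)⟩
    · intro e he; exact (mem_sdiff.1 (mem_filter.1 he).1).1
    · intro e he; exact (mem_sdiff.1 (mem_filter.1 he).1).1
  · rintro ⟨F, hF, hMF⟩
    rw [Msup, mem_filter] at hMF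
    obtain ⟨hMall, hFM⟩ := hMF
    obtain ⟨hFpm, hHF⟩ := isPMOn_of_mem_ncSet hF
    rw [Mex3, mem_filter]
    refine ⟨hMall, ?_⟩
    have hPM : IsPMOn univ M := mem_perfectMatchings.1 (mem_filter.1 hMall).1
    ext e
    simp only [mem_filter]
    constructor
    · rintro ⟨heM, hcut⟩
      -- an edge meeting `C` is an `F`-edge, and among those only `H`-edges cross
      have heF : e ∈ F := by
        rw [eq_filter_of_pm_subset hFpm hPM hFM, mem_filter]
        refine ⟨heM, ?_⟩
        induction e using Sym2.ind with
        | h u v =>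
          rw [cutCount_mk] at hcut
          by_cases hu : u ∈ Cset π
          · exact ⟨u, mem_union_left _ hu, Sym2.mem_mk_left u v⟩
          · have hv : v ∈ Cset π := by by_contra hv; simp [hu, hv] at hcut
            exact ⟨v, mem_union_left _ hv, Sym2.mem_mk_right u v⟩
      by_contra heH
      exact cutCount_ne_one_of_mem_ncSet hF heF heH hcut
    · intro he
      exact ⟨hFM (hHF he), cutCount_Cset_of_mem_Hm he⟩

/-- Distinct completions have disjoint extension sets. [folklore] -/
theorem pairwiseDisjoint_Msup (π : Equiv.Perm (Slot m q)) :
    (ncSet π : Set (Finset (Sym2 (Slot m q)))).PairwiseDisjoint (Msup π) := by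
  intro F hF F' hF' hne
  rw [Function.onFun, disjoint_left]
  intro M hM hM'
  rw [Msup, mem_filter] at hM hM'
  have hPM : IsPMOn univ M := mem_perfectMatchings.1 (mem_filter.1 hM.1).1
  apply hne
  rw [eq_filter_of_pm_subset (isPMOn_of_mem_ncSet hF).1 hPM hM.2,
    eq_filter_of_pm_subset (isPMOn_of_mem_ncSet hF').1 hPM hM'.2]

/-- **Lemma 8 (upper half).** For an `M`-good pair, `p^ex_M(H) ≤ (1+ε) p_M(H)`:
"`p^ex_{M,T}(H) = E_F[p_{M,T}(F)] ≤ (1+ε) · p_{M,T}(H)`", here as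
`|ℳex ∩ ℳ| · |Msup H| ≤ (1+ε) |Msup H ∩ ℳ| · |ℳex|`. [cite: Rothvoss2017, Lemma 8 (PDF p. 9)] -/
theorem card_Mex3_inter_le_of_MGood {ε : ℝ} {ℳ : Finset (Finset (Sym2 (Slot m q)))}
    {π : Equiv.Perm (Slot m q)} (hgood : MGood ε ℳ π) :
    ((Mex3 π ∩ ℳ).card : ℝ) * (Msup π (Hm π)).card ≤
      (1 + ε) * (((Msup π (Hm π) ∩ ℳ).card : ℝ) * (Mex3 π).card) := by
  have hdisj := pairwiseDisjoint_Msup π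
  have hdisj' : (ncSet π : Set (Finset (Sym2 (Slot m q)))).PairwiseDisjoint fun F => Msup π F ∩ ℳ := by
    intro F hF F' hF' hne
    exact (hdisj hF hF' hne).mono inter_subset_left inter_subset_left
  have h1 : ((Mex3 π ∩ ℳ).card : ℝ) = ∑ F ∈ ncSet π, ((Msup π F ∩ ℳ).card : ℝ) := by
    rw [Mex3_eq_biUnion_ncSet, biUnion_inter, card_biUnion hdisj']
    push_cast; rfl
  have h2 : ((Mex3 π).card : ℝ) = ∑ F ∈ ncSet π, ((Msup π F).card : ℝ) := by
    rw [Mex3_eq_biUnion_ncSet, card_biUnion hdisj]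
    push_cast; rfl
  rw [h1, h2, sum_mul, mul_sum, mul_sum]
  refine sum_le_sum fun F hF => ?_
  obtain ⟨hFpm, hHF⟩ := isPMOn_of_mem_ncSet hF
  have := (hgood F hFpm hHF).2.2
  nlinarith [this]

/-! ### The pointwise comparison for good pairs -/

/-- **For a good pair, `p^ex_U(H) · p^ex_M(H) ≤ (1+ε)³ · p^ex_U(F) · p^ex_M(F)`** — the chain
"`p^ex_M(H) ≤ (1+ε) p_M(H) ≤ (1+ε)² p^ex_M(F)`" (Lemma 8 and `M`-goodness at `F = F(π) ⊇ H`) and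
"`p^ex_U(H) ≤ (1+ε) p^ex_U(F)`" (`U`-goodness). [cite: Rothvoss2017, §3.4 (PDF p. 10)] -/
theorem pU3_mul_pM3_le_of_Good {μ : ℕ} {ε : ℝ} (hε : 0 ≤ ε) {𝒰 : Finset (Finset (Slot m q))}
    {ℳ : Finset (Finset (Sym2 (Slot m q)))} (hq : 0 < q) (hqe : Even q) (hm : m = 2 * μ + 1)
    {π : Equiv.Perm (Slot m q)} (hgood : Good μ ε 𝒰 ℳ π) :
    pU3 μ 𝒰 π * pM3 ℳ π ≤ (1 + ε) ^ 3 * (pUC μ 𝒰 π * pMF ℳ π) := by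
  obtain ⟨hU, hM⟩ := hgood
  -- the `U`-side
  have hD0 : (0 : ℝ) < (Uex3 μ π).card := by exact_mod_cast (Uex3_nonempty hq hm π).card_pos
  have hDeq : ((UexC μ π).card : ℝ) = (Uex3 μ π).card := by
    exact_mod_cast (card_Uex3_eq_card_UexC hq hm π).symm
  have hUle : pU3 μ 𝒰 π ≤ (1 + ε) * pUC μ 𝒰 π := by
    simp only [pU3, pUC, hDeq]
    rw [← mul_div_assoc, div_le_div_iff_of_pos_right hD0]
    exact hU.2.1
  -- the `M`-side
  have hE0 : (0 : ℝ) < (Mex3 π).card := by exact_mod_cast (Mex3_nonempty hqe π).card_pos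
  have hF0 : (0 : ℝ) < (MexF π).card := by exact_mod_cast (MexF_nonempty hqe π).card_pos
  have hgF := hM (Fm π) (isPMOn_Fm π) (Hm_subset_Fm π)
  have hH0 : (0 : ℝ) < (Msup π (Hm π)).card := by
    have : (0 : ℝ) < ((Msup π (Hm π) ∩ ℳ).card : ℝ) := hgF.1
    have hle : ((Msup π (Hm π) ∩ ℳ).card : ℝ) ≤ (Msup π (Hm π)).card := by
      exact_mod_cast card_le_card inter_subset_left
    linarith
  have hL8 := card_Mex3_inter_le_of_MGood hM
  -- `pM3 ≤ (1+ε) NH/DH` and `NH/DH ≤ (1+ε) pMF`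
  have hMle : pM3 ℳ π ≤ (1 + ε) ^ 2 * pMF ℳ π := by
    have h2 : ((Msup π (Hm π) ∩ ℳ).card : ℝ) * (MexF π).card ≤
        (1 + ε) * (((MexF π ∩ ℳ).card : ℝ) * (Msup π (Hm π)).card) := hgF.2.1
    -- h2 : NH * DF ≤ (1+ε) (NF * DH); hL8 : |Mex3∩ℳ| DH ≤ (1+ε) NH |Mex3|
    have key : ((Mex3 π ∩ ℳ).card : ℝ) * ((Msup π (Hm π)).card * (MexF π).card) ≤
        (1 + ε) ^ 2 * ((MexF π ∩ ℳ).card * (Msup π (Hm π)).card) * (Mex3 π).card := by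
      calc ((Mex3 π ∩ ℳ).card : ℝ) * ((Msup π (Hm π)).card * (MexF π).card)
          = (((Mex3 π ∩ ℳ).card : ℝ) * (Msup π (Hm π)).card) * (MexF π).card := by ring
        _ ≤ ((1 + ε) * (((Msup π (Hm π) ∩ ℳ).card : ℝ) * (Mex3 π).card)) * (MexF π).card :=
            mul_le_mul_of_nonneg_right hL8 hF0.le
        _ = (1 + ε) * (Mex3 π).card * (((Msup π (Hm π) ∩ ℳ).card : ℝ) * (MexF π).card) := by ring
        _ ≤ (1 + ε) * (Mex3 π).card * ((1 + ε) * (((MexF π ∩ ℳ).card : ℝ) * (Msup π (Hm π)).card)) :=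
            mul_le_mul_of_nonneg_left h2 (mul_nonneg (by linarith) (Nat.cast_nonneg _))
        _ = (1 + ε) ^ 2 * ((MexF π ∩ ℳ).card * (Msup π (Hm π)).card) * (Mex3 π).card := by ring
    rw [pM3, pMF, div_le_iff₀ hE0]
    have hDH : ((Msup π (Hm π)).card : ℝ) ≠ 0 := hH0.ne'
    have hDF : ((MexF π).card : ℝ) ≠ 0 := hF0.ne'
    -- divide `key` by `DH · DF`
    have key' : ((Mex3 π ∩ ℳ).card : ℝ) ≤
        (1 + ε) ^ 2 * ((MexF π ∩ ℳ).card * (Msup π (Hm π)).card) * (Mex3 π).card /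
          ((Msup π (Hm π)).card * (MexF π).card) := by
      rw [le_div_iff₀ (mul_pos hH0 hF0)]
      exact key
    calc ((Mex3 π ∩ ℳ).card : ℝ)
        ≤ (1 + ε) ^ 2 * ((MexF π ∩ ℳ).card * (Msup π (Hm π)).card) * (Mex3 π).card /
          ((Msup π (Hm π)).card * (MexF π).card) := key'
      _ = (1 + ε) ^ 2 * (((MexF π ∩ ℳ).card : ℝ) / (MexF π).card) * (Mex3 π).card := by
          field_simp
  -- combine
  have hpU : 0 ≤ pU3 μ 𝒰 π := div_nonneg (Nat.cast_nonneg _) (Nat.cast_nonneg _)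
  have hpF : 0 ≤ pMF ℳ π := div_nonneg (Nat.cast_nonneg _) (Nat.cast_nonneg _)
  have hε2 : 0 ≤ (1 + ε) ^ 2 := pow_nonneg (by linarith) 2
  calc pU3 μ 𝒰 π * pM3 ℳ π ≤ pU3 μ 𝒰 π * ((1 + ε) ^ 2 * pMF ℳ π) :=
        mul_le_mul_of_nonneg_left hMle hpU
    _ ≤ ((1 + ε) * pUC μ 𝒰 π) * ((1 + ε) ^ 2 * pMF ℳ π) :=
        mul_le_mul_of_nonneg_right hUle (mul_nonneg hε2 hpF)
    _ = (1 + ε) ^ 3 * (pUC μ 𝒰 π * pMF ℳ π) := by ring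

end Literature.Barriers.PneNP

end


/-! ## Part: `TSPExtensionComplexityRothvossLemma9` -/

/-!
# Rothvoß's Lemma 9 and the contribution of good pairs

Support file for the discharge of `Literature.Barriers.PneNP.Rothvoss2017_tsp` (Rothvoß 2017,
§3.4, "this subsection contains the core arguments why the matching polytope has no compact LP
representation", PDF p. 10). For a rectangle `ℛ = 𝒰 × ℳ` with `μ₁(ℛ) = 0` (no pair with
`|δ(U) ∩ M| = 1`):

* **Lemma 9, core**: two good `3`-sub-matchings `H, H*` of the same `F` overlap in at least two
  edges — otherwise two `C`-endpoints `u, v` of `H ∖ H*` give a `k`-matching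
  `F* ⊇ H* ∪ {(u,v)}`, `M`-goodness of `H*` a matching `M ∈ ℳ ∩ ℳ(T)` through `(u,v)`,
  `U`-goodness of `H` a cut `U ∈ 𝒰` with `U ∩ C = V(H) ∩ C ∋ u, v`, and then `|δ(U) ∩ M| = 1`
  (`two_le_card_inter_of_good`); hence at most `3k` of the `C(k,3)` sub-matchings are good
  (`card_good_le`); in the slot model the sub-matchings of `F(π)` are the `H(cdPerm τ_J · π)`,
  `J` a `3`-subset of the index set `X` (`…RothvossPerms.lean`).
* **The contribution of good pairs** (§3.4): `E_π[GOOD · p^ex_U p^ex_M] ≤ (1+ε)³ · (3k / C(k,3)) · μ_k(ℛ)`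
  (`sum_good_le`), by the pointwise comparison of `…RothvossGood.lean` and averaging over the
  re-indexings `cdPerm τ_J`, which preserve `p^ex_U(F) p^ex_M(F)`.

Sources: [Rothvoss2017] Lemma 9 and §3.4 (PDF p. 10).
-/

noncomputable section

open scoped Classical

namespace Literature.Barriers.PneNP

open Finset Slot

variable {m q : ℕ}

/-! ### Sub-matchings of `F(π)` indexed by `J` -/

/-- The `D`-endpoints of `H_J`. [folklore] -/
def dsetJ (π : Equiv.Perm (Slot m q)) (J : Finset (Fin 3 ⊕ Fin q)) : Finset (Slot m q) :=
  J.image fun ξ => π.symm (Dslot ξ)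

/-- Auxiliary (`image_attach_eq`). [folklore] -/
theorem image_attach_eq {α β : Type*} [DecidableEq β] (J : Finset α) (h : α → β) :
    (univ : Finset {ξ // ξ ∈ J}).image (fun ξ => h ξ.1) = J.image h := by
  ext y
  simp only [mem_image, mem_univ, true_and, Subtype.exists]
  constructor
  · rintro ⟨ξ, hξ, rfl⟩; exact ⟨ξ, hξ, rfl⟩
  · rintro ⟨ξ, hξ, rfl⟩; exact ⟨ξ, hξ, rfl⟩

/-- `H_J` is a perfect matching of its endpoints. [folklore] -/
theorem isPMOn_HmJ (π : Equiv.Perm (Slot m q)) (J : Finset (Fin 3 ⊕ Fin q)) :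
    IsPMOn (csetJ π J ∪ dsetJ π J) (HmJ π J) := by
  have h1 : csetJ π J = (univ : Finset {ξ // ξ ∈ J}).image (fun ξ => π.symm (Cslot ξ.1)) :=
    (image_attach_eq J (fun ξ => π.symm (Cslot ξ))).symm
  have h2 : dsetJ π J = (univ : Finset {ξ // ξ ∈ J}).image (fun ξ => π.symm (Dslot ξ.1)) :=
    (image_attach_eq J (fun ξ => π.symm (Dslot ξ))).symm
  have h3 : HmJ π J = (univ : Finset {ξ // ξ ∈ J}).image
      (fun ξ => s(π.symm (Cslot ξ.1), π.symm (Dslot ξ.1))) :=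
    (image_attach_eq J (fun ξ => s(π.symm (Cslot ξ), π.symm (Dslot ξ)))).symm
  rw [h1, h2, h3]
  exact isPMOn_pairing (κ := {ξ // ξ ∈ J}) (fun ξ => π.symm (Cslot ξ.1)) (fun ξ => π.symm (Dslot ξ.1))
    (fun _ _ h => Subtype.ext (Cslot_injective (π.symm.injective h)))
    (fun _ _ h => Subtype.ext (Dslot_injective (π.symm.injective h)))
    (fun x y h => Cslot_ne_Dslot x.1 y.1 (π.symm.injective h))

/-- Auxiliary (`csetJ_subset_Cset`). [folklore] -/
theorem csetJ_subset_Cset (π : Equiv.Perm (Slot m q)) (J : Finset (Fin 3 ⊕ Fin q)) : csetJ π J ⊆ Cset π := by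
  intro v hv
  obtain ⟨ξ, -, rfl⟩ := mem_image.1 hv
  simp [Cset, mem_pull, CSlots]

/-- Auxiliary (`dsetJ_subset_Dset`). [folklore] -/
theorem dsetJ_subset_Dset (π : Equiv.Perm (Slot m q)) (J : Finset (Fin 3 ⊕ Fin q)) : dsetJ π J ⊆ Dset π := by
  intro v hv
  obtain ⟨ξ, -, rfl⟩ := mem_image.1 hv
  simp [Dset, mem_pull, DSlots]

/-- Auxiliary (`card_csetJ`). [folklore] -/
theorem card_csetJ (π : Equiv.Perm (Slot m q)) (J : Finset (Fin 3 ⊕ Fin q)) : (csetJ π J).card = J.card :=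
  card_image_of_injective _ fun _ _ h => Cslot_injective (π.symm.injective h)

/-- Auxiliary (`card_dsetJ`). [folklore] -/
theorem card_dsetJ (π : Equiv.Perm (Slot m q)) (J : Finset (Fin 3 ⊕ Fin q)) : (dsetJ π J).card = J.card :=
  card_image_of_injective _ fun _ _ h => Dslot_injective (π.symm.injective h)

/-- Auxiliary (`card_Cset`). [folklore] -/
theorem card_Cset (π : Equiv.Perm (Slot m q)) : (Cset π).card = q + 3 := by
  rw [Cset, card_pull, CSlots, card_image_of_injective _ Cslot_injective]
  simp [add_comm]

/-- Auxiliary (`card_Dset`). [folklore] -/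
theorem card_Dset (π : Equiv.Perm (Slot m q)) : (Dset π).card = q + 3 := by
  rw [Dset, card_pull, DSlots, card_image_of_injective _ Dslot_injective]
  simp [add_comm]

/-- `π⁻¹(Cslot ξ) ∈ C`. [folklore] -/
theorem symm_Cslot_mem_Cset (π : Equiv.Perm (Slot m q)) (ξ : Fin 3 ⊕ Fin q) : π.symm (Cslot ξ) ∈ Cset π := by
  rw [Cset, mem_pull, Equiv.apply_symm_apply]
  exact mem_image_of_mem _ (mem_univ _)

/-! ### Extensions exist -/

/-- Vertices of `C ∪ D` are those of role `CD`. [folklore] -/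
theorem mem_Cset_union_Dset_iff (π : Equiv.Perm (Slot m q)) (v : Slot m q) :
    v ∈ Cset π ∪ Dset π ↔ role (π v) = Role.CD := by
  rw [role_eq_CD_iff, mem_union, Cset, Dset, mem_pull, mem_pull]

/-- **Every perfect matching of `C ∪ D` extends to a member of `ℳ_all(T)`.** [folklore] -/
theorem Msup_nonempty (hqe : Even q) (π : Equiv.Perm (Slot m q)) {F : Finset (Sym2 (Slot m q))}
    (hF : IsPMOn (Cset π ∪ Dset π) F) : (Msup π F).Nonempty := by
  -- perfect matchings of the blocks `A_i`, `B_i`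
  have hex : ∀ r : Fin m ⊕ Fin m, ∃ N, IsPMOn (coarseP π r) N := fun r => by
    refine exists_isPMOn_of_even _ _ rfl ?_
    rw [card_coarseP]
    rcases r with i | i
    · exact hqe
    · exact even_two_mul q
  choose N hN using hex
  have hglue := isPMOn_biUnion (coarseP π) (coarseP_disjoint π) univ N (fun r _ => hN r)
  refine ⟨F ∪ univ.biUnion N, ?_⟩
  rw [Msup, mem_filter, MallP, mem_filter, mem_perfectMatchings]
  refine ⟨⟨?_, ?_⟩, subset_union_left⟩
  · rw [univ_eq_CD_union_coarse π]
    exact hF.union hglue (disjoint_CD_coarse π)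
  · intro e he
    induction e using Sym2.ind with
    | h u v =>
      rw [sameRole_mk]
      rcases mem_union.1 he with he | he
      · rw [(mem_Cset_union_Dset_iff π u).1 (hF.mem_of_mem he (Sym2.mem_mk_left u v)),
          (mem_Cset_union_Dset_iff π v).1 (hF.mem_of_mem he (Sym2.mem_mk_right u v))]
      · obtain ⟨r, -, hr⟩ := biUnion_respects (coarseP π) univ N (fun r _ => hN r) _ he
        rw [mk_mem_sym2_iff] at hr
        exact role_eq_of_mem_coarseP hr.1 hr.2

/-! ### Lemma 9, core -/

section core

variable {μ : ℕ} {ε : ℝ} {𝒰 : Finset (Finset (Slot m q))} {ℳ : Finset (Finset (Sym2 (Slot m q)))}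
  {π : Equiv.Perm (Slot m q)}

/-- In a matching of `ℳ_all(T)` containing a perfect matching `F` of `C ∪ D`, the edges cut by a
cut `U ∈ 𝒰_all(T)` are the `F`-edges cut by `U`. [folklore] -/
theorem filter_cut_eq_filter_of_subset {U : Finset (Slot m q)} (hU : U ∈ UallP μ π)
    {F M : Finset (Sym2 (Slot m q))} (hF : IsPMOn (Cset π ∪ Dset π) F) (hM : M ∈ Msup π F) :
    (M.filter fun e => cutCount U e = 1) = F.filter fun e => cutCount U e = 1 := by
  rw [Msup, mem_filter, MallP, mem_filter, mem_perfectMatchings] at hM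
  obtain ⟨⟨hPM, hsame⟩, hFM⟩ := hM
  simp only [UallP, mem_filter, mem_univ, true_and] at hU
  obtain ⟨-, hAC, hblk⟩ := hU
  ext e
  simp only [mem_filter]
  constructor
  · rintro ⟨he, hcut⟩
    refine ⟨?_, hcut⟩
    induction e using Sym2.ind with
    | h u v =>
      have hr := (sameRole_mk π u v).1 (hsame _ he)
      rw [cutCount_mk] at hcut
      rcases hru : role (π u) with i | _ | i
      · exfalso
        have hu : u ∈ Ablk π i := mem_Ablk_of_role hru
        have hv : v ∈ Ablk π i := mem_Ablk_of_role (hr ▸ hru)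
        rcases hblk i with hin | hout
        · simp [hin hu, hin hv] at hcut
        · simp [disjoint_left.1 hout hu, disjoint_left.1 hout hv] at hcut
      · rw [eq_filter_of_pm_subset hF hPM hFM, mem_filter]
        exact ⟨he, u, (mem_Cset_union_Dset_iff π u).2 hru, Sym2.mem_mk_left u v⟩
      · exfalso
        have hu : u ∉ U := fun huU => by
          have := hAC u huU; rw [isAC_of_role_B hru] at this; exact Bool.false_ne_true this
        have hv : v ∉ U := fun hvU => by
          have := hAC v hvU; rw [isAC_of_role_B (hr ▸ hru)] at this; exact Bool.false_ne_true this
        simp [hu, hv] at hcut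
  · rintro ⟨he, hcut⟩
    exact ⟨hFM he, hcut⟩

/-- **The construction in the proof of Lemma 9.** Let `U ∈ 𝒰_all(T)` with `U ∩ C = {u, v, w}`
(three distinct vertices of `C`), and let `F` be a perfect matching of `C ∪ D` containing the edge
`{u, v}`. Then every `M ∈ ℳ_all(T)` with `F ⊆ M` has `|δ(U) ∩ M| = 1` (the edge at `w`).
[cite: Rothvoss2017, proof of Lemma 9 (PDF p. 10)] -/
theorem card_cut_eq_one {U : Finset (Slot m q)} (hU : U ∈ UallP μ π) {u v w : Slot m q}
    (hUC : U ∩ Cset π = {u, v, w}) (huv : u ≠ v) (huw : u ≠ w) (hvw : v ≠ w)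
    {F M : Finset (Sym2 (Slot m q))} (hF : IsPMOn (Cset π ∪ Dset π) F) (huvF : s(u, v) ∈ F)
    (hM : M ∈ Msup π F) : (M.filter fun e => cutCount U e = 1).card = 1 := by
  rw [filter_cut_eq_filter_of_subset hU hF hM]
  have hU' := hU
  simp only [UallP, mem_filter, mem_univ, true_and] at hU'
  obtain ⟨-, hAC, -⟩ := hU'
  -- `U ∩ (C ∪ D) = U ∩ C = {u, v, w}`
  have hUCD : ∀ x ∈ Cset π ∪ Dset π, x ∈ U ↔ x = u ∨ x = v ∨ x = w := by
    intro x hx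
    constructor
    · intro hxU
      rcases mem_union.1 hx with hxC | hxD
      · have : x ∈ U ∩ Cset π := mem_inter.2 ⟨hxU, hxC⟩
        rw [hUC] at this
        simpa using this
      · have := hAC x hxU
        simp only [Dset, mem_pull] at hxD
        rw [isAC_of_mem_DSlots hxD] at this
        exact absurd this (by simp)
    · intro h
      have : x ∈ U ∩ Cset π := by
        rw [hUC]
        rcases h with rfl | rfl | rfl <;> simp
      exact (mem_inter.1 this).1
  have hw : w ∈ Cset π ∪ Dset π := by
    have : w ∈ U ∩ Cset π := by rw [hUC]; simp
    exact mem_union_left _ (mem_inter.1 this).2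
  -- the cut `F`-edges are exactly those containing `w`
  have key : (F.filter fun e => cutCount U e = 1) = F.filter fun e => w ∈ e := by
    ext e
    simp only [mem_filter, and_congr_right_iff]
    intro he
    induction e using Sym2.ind with
    | h x y =>
      have hx := hF.mem_of_mem he (Sym2.mem_mk_left x y)
      have hy := hF.mem_of_mem he (Sym2.mem_mk_right x y)
      have hxy : x ≠ y := fun h => hF.not_isDiag he (Sym2.mk_isDiag_iff.2 h)
      -- an endpoint equal to `u` or `v` forces the edge `{u, v}`
      have huv_edge : ∀ {a b : Slot m q}, s(a, b) ∈ F → a = u ∨ a = v → s(a, b) = s(u, v) := by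
        intro a b hab ha
        rcases ha with rfl | rfl
        · exact hF.unique hab huvF (Sym2.mem_mk_left _ _) (Sym2.mem_mk_left _ _)
        · exact hF.unique hab huvF (Sym2.mem_mk_left _ _) (Sym2.mem_mk_right _ _)
      rw [cutCount_mk, Sym2.mem_iff]
      constructor
      · intro hcut
        by_cases hxU : x ∈ U
        · have hyU : y ∉ U := by intro hyU; simp [hxU, hyU] at hcut
          rcases (hUCD x hx).1 hxU with hxu | hxv | hxw
          · have h' := huv_edge he (Or.inl hxu)
            have : y = u ∨ y = v := by
              have hy' : y ∈ s(u, v) := h' ▸ Sym2.mem_mk_right x y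
              exact Sym2.mem_iff.1 hy'
            exact absurd ((hUCD y hy).2 (by rcases this with h | h <;> simp [h])) hyU
          · have h' := huv_edge he (Or.inr hxv)
            have : y = u ∨ y = v := by
              have hy' : y ∈ s(u, v) := h' ▸ Sym2.mem_mk_right x y
              exact Sym2.mem_iff.1 hy'
            exact absurd ((hUCD y hy).2 (by rcases this with h | h <;> simp [h])) hyU
          · exact Or.inl hxw.symm
        · have hyU : y ∈ U := by by_contra hyU; simp [hxU, hyU] at hcut
          rcases (hUCD y hy).1 hyU with hyu | hyv | hyw
          · have h' := huv_edge (by rw [Sym2.eq_swap]; exact he) (Or.inl hyu)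
            have : x = u ∨ x = v := by
              have hx' : x ∈ s(u, v) := h' ▸ Sym2.mem_mk_right y x
              exact Sym2.mem_iff.1 hx'
            exact absurd ((hUCD x hx).2 (by rcases this with h | h <;> simp [h])) hxU
          · have h' := huv_edge (by rw [Sym2.eq_swap]; exact he) (Or.inr hyv)
            have : x = u ∨ x = v := by
              have hx' : x ∈ s(u, v) := h' ▸ Sym2.mem_mk_right y x
              exact Sym2.mem_iff.1 hx'
            exact absurd ((hUCD x hx).2 (by rcases this with h | h <;> simp [h])) hxU
          · exact Or.inr hyw.symm
      · rintro (rfl | rfl)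
        · -- `x = w`: then `y ∉ U`
          have hwU : w ∈ U := (hUCD w hx).2 (Or.inr (Or.inr rfl))
          have hyU : y ∉ U := by
            intro hyU
            rcases (hUCD y hy).1 hyU with hyu | hyv | hyw
            · have h' := huv_edge (by rw [Sym2.eq_swap]; exact he) (Or.inl hyu)
              have : w ∈ s(u, v) := h' ▸ Sym2.mem_mk_right _ _
              rcases Sym2.mem_iff.1 this with h | h
              · exact huw h.symm
              · exact hvw h.symm
            · have h' := huv_edge (by rw [Sym2.eq_swap]; exact he) (Or.inr hyv)
              have : w ∈ s(u, v) := h' ▸ Sym2.mem_mk_right _ _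
              rcases Sym2.mem_iff.1 this with h | h
              · exact huw h.symm
              · exact hvw h.symm
            · exact hxy hyw.symm
          simp [hwU, hyU]
        · have hwU : w ∈ U := (hUCD w hy).2 (Or.inr (Or.inr rfl))
          have hxU : x ∉ U := by
            intro hxU
            rcases (hUCD x hx).1 hxU with hxu | hxv | hxw
            · have h' := huv_edge he (Or.inl hxu)
              have : w ∈ s(u, v) := h' ▸ Sym2.mem_mk_right _ _
              rcases Sym2.mem_iff.1 this with h | h
              · exact huw h.symm
              · exact hvw h.symm
            · have h' := huv_edge he (Or.inr hxv)
              have : w ∈ s(u, v) := h' ▸ Sym2.mem_mk_right _ _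
              rcases Sym2.mem_iff.1 this with h | h
              · exact huw h.symm
              · exact hvw h.symm
            · exact hxy hxw
          simp [hwU, hxU]
  rw [key, hF.card_filter hw]
set_option maxHeartbeats 400000 in -- buildfix (bf3-g27): 160k/180k FAIL, 200k PASS at accept time; line-neutral budget line
/-- **Lemma 9, core**: for a rectangle with `μ₁(ℛ) = 0`, if the re-indexed pairs
`(T, H_J)` and `(T, H_{J'})` are both good then `J = J'` or `|J ∩ J'| ≥ 2` ("good pairs must
overlap in at least `2` edges"). [cite: Rothvoss2017, Lemma 9 (PDF p. 10)] -/
theorem two_le_card_inter_of_good (hq : 0 < q) (hqe : Even q)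
    (hR1 : ∀ U ∈ 𝒰, ∀ M ∈ ℳ, (M.filter fun e => cutCount U e = 1).card ≠ 1)
    {J J' : Finset (Fin 3 ⊕ Fin q)} (hJ : J.card = 3) (hJ' : J'.card = 3)
    (hgJ : Good μ ε 𝒰 ℳ (cdPerm (permOfJ J hJ) * π))
    (hgJ' : Good μ ε 𝒰 ℳ (cdPerm (permOfJ J' hJ') * π)) :
    J = J' ∨ 2 ≤ (J ∩ J').card := by
  by_contra hcon
  push Not at hcon
  obtain ⟨hne, hlt⟩ := hcon
  -- two indices of `J` outside `J'`
  have hsd : 2 ≤ (J \ J').card := by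
    have h1 := card_sdiff_add_card_inter J J'
    omega
  obtain ⟨ξ₁, hξ₁, ξ₂, hξ₂, hξ⟩ := one_lt_card.1 (by omega : 1 < (J \ J').card)
  rw [mem_sdiff] at hξ₁ hξ₂
  -- the cut from `U`-goodness of `(T, H_J)`
  obtain ⟨hUg, -⟩ := hgJ
  obtain ⟨-, hMg⟩ := hgJ'
  have hUpos := hUg.1
  rw [Uex3_cdPerm_mul, selJ_permOfJ] at hUpos
  obtain ⟨U, hU⟩ : ((UallP μ π).filter (fun U => U ∩ Cset π = csetJ π J) ∩ 𝒰).Nonempty := by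
    rw [← card_pos]; exact_mod_cast hUpos
  rw [mem_inter, mem_filter] at hU
  obtain ⟨⟨hUall, hUC⟩, hU𝒰⟩ := hU
  -- the three `C`-endpoints
  obtain ⟨ξ₃, hξ₃, h13, h23⟩ : ∃ ξ₃ ∈ J, ξ₃ ≠ ξ₁ ∧ ξ₃ ≠ ξ₂ := by
    have : (J.erase ξ₁ |>.erase ξ₂).Nonempty := by
      rw [← card_pos, card_erase_of_mem (mem_erase.2 ⟨hξ.symm, hξ₂.1⟩), card_erase_of_mem hξ₁.1, hJ]
      norm_num
    obtain ⟨ξ₃, h⟩ := this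
    rw [mem_erase, mem_erase] at h
    exact ⟨ξ₃, h.2.2, h.2.1, h.1⟩
  set u := π.symm (Cslot ξ₁) with hu
  set v := π.symm (Cslot ξ₂) with hv
  set w := π.symm (Cslot ξ₃) with hw
  have hinj : ∀ {a b : Fin 3 ⊕ Fin q}, π.symm (Cslot a) = π.symm (Cslot b) → a = b :=
    fun h => Cslot_injective (π.symm.injective h)
  have huv : u ≠ v := fun h => hξ (hinj h)
  have huw : u ≠ w := fun h => h13 (hinj h).symm
  have hvw : v ≠ w := fun h => h23 (hinj h).symm
  have hJeq : J = {ξ₁, ξ₂, ξ₃} := by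
    symm
    apply eq_of_subset_of_card_le
    · intro x hx
      simp only [mem_insert, mem_singleton] at hx
      rcases hx with rfl | rfl | rfl
      exacts [hξ₁.1, hξ₂.1, hξ₃]
    · have h3 : ({ξ₁, ξ₂, ξ₃} : Finset (Fin 3 ⊕ Fin q)).card = 3 := by
        rw [card_insert_of_notMem, card_pair h23.symm]
        simp only [mem_insert, mem_singleton, not_or]
        exact ⟨hξ, Ne.symm h13⟩
      rw [hJ, h3]
  have hUC' : U ∩ Cset π = {u, v, w} := by
    rw [hUC, csetJ, hJeq]
    simp [image_insert, image_singleton, hu, hv, hw]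
  -- the `k`-matching `F* ⊇ H_{J'} ∪ {(u,v)}`
  have huH : u ∉ csetJ π J' ∪ dsetJ π J' := by
    intro h
    rcases mem_union.1 h with h | h
    · obtain ⟨ζ, hζ, hζu⟩ := mem_image.1 h
      exact hξ₁.2 (hinj hζu ▸ hζ)
    · obtain ⟨ζ, hζ, hζu⟩ := mem_image.1 h
      exact Cslot_ne_Dslot ξ₁ ζ (π.symm.injective hζu.symm)
  have hvH : v ∉ csetJ π J' ∪ dsetJ π J' := by
    intro h
    rcases mem_union.1 h with h | h
    · obtain ⟨ζ, hζ, hζv⟩ := mem_image.1 h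
      exact hξ₂.2 (hinj hζv ▸ hζ)
    · obtain ⟨ζ, hζ, hζv⟩ := mem_image.1 h
      exact Cslot_ne_Dslot ξ₂ ζ (π.symm.injective hζv.symm)
  have hVH : csetJ π J' ∪ dsetJ π J' ⊆ Cset π ∪ Dset π :=
    union_subset_union (csetJ_subset_Cset π J') (dsetJ_subset_Dset π J')
  have huvCD : ({u, v} : Finset (Slot m q)) ⊆ Cset π ∪ Dset π := by
    intro x hx
    simp only [mem_insert, mem_singleton] at hx
    rcases hx with rfl | rfl <;> exact mem_union_left _ (symm_Cslot_mem_Cset π _)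
  set S₁ : Finset (Slot m q) := (csetJ π J' ∪ dsetJ π J') ∪ {u, v} with hS₁
  have hd1 : Disjoint (csetJ π J' ∪ dsetJ π J') ({u, v} : Finset (Slot m q)) := by
    rw [disjoint_left]
    intro x hx hx'
    simp only [mem_insert, mem_singleton] at hx'
    rcases hx' with rfl | rfl
    · exact huH hx
    · exact hvH hx
  have hPM1 : IsPMOn S₁ (HmJ π J' ∪ {s(u, v)}) :=
    (isPMOn_HmJ π J').union (IsPMOn.pair huv) hd1
  set R : Finset (Slot m q) := (Cset π ∪ Dset π) \ S₁ with hR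
  have hS₁sub : S₁ ⊆ Cset π ∪ Dset π := union_subset hVH huvCD
  have hRcard : R.card = 2 * q - 2 := by
    rw [hR, card_sdiff_of_subset hS₁sub, card_union_of_disjoint (disjoint_Cset_Dset π), card_Cset, card_Dset,
      hS₁, card_union_of_disjoint hd1, card_union_of_disjoint, card_csetJ, card_dsetJ, hJ', card_pair huv]
    · omega
    · rw [disjoint_left]
      intro x hx hx'
      obtain ⟨ζ, -, rfl⟩ := mem_image.1 hx
      obtain ⟨ζ', -, h⟩ := mem_image.1 hx'
      exact Cslot_ne_Dslot ζ ζ' (π.symm.injective h.symm)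
  have hReven : Even R.card := by
    rw [hRcard]
    obtain ⟨r, hr⟩ := hqe
    exact ⟨r + r - 1, by omega⟩
  obtain ⟨F₀, hF₀⟩ := exists_isPMOn_of_even _ R rfl hReven
  set Fstar := (HmJ π J' ∪ {s(u, v)}) ∪ F₀ with hFstar
  have hFpm : IsPMOn (Cset π ∪ Dset π) Fstar := by
    have : Cset π ∪ Dset π = S₁ ∪ R := (union_sdiff_of_subset hS₁sub).symm
    rw [this]
    exact hPM1.union hF₀ disjoint_sdiff
  have hHF : Hm (cdPerm (permOfJ J' hJ') * π) ⊆ Fstar := by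
    rw [Hm_cdPerm_mul, selJ_permOfJ]
    exact subset_union_left.trans subset_union_left
  have hCD : Cset (cdPerm (permOfJ J' hJ') * π) ∪ Dset (cdPerm (permOfJ J' hJ') * π) = Cset π ∪ Dset π := by
    rw [Cset_cdPerm_mul, Dset_cdPerm_mul]
  -- `M`-goodness of `(T, H_{J'})` at `F*`
  have hgF := hMg Fstar (by rw [hCD]; exact hFpm) hHF
  have hMsup : ∀ F, Msup (cdPerm (permOfJ J' hJ') * π) F = Msup π F := fun F => by
    rw [Msup, Msup, Mall_cdPerm_mul]
  simp only [hMsup] at hgF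
  obtain ⟨hNH, hineq, -⟩ := hgF
  have hDF : (0 : ℝ) < (Msup π Fstar).card := by exact_mod_cast (Msup_nonempty hqe π hFpm).card_pos
  have hNF : (0 : ℝ) < ((Msup π Fstar ∩ ℳ).card : ℝ) := by
    by_contra h
    push Not at h
    have h0 : ((Msup π Fstar ∩ ℳ).card : ℝ) = 0 := le_antisymm h (by positivity)
    rw [h0, zero_mul, mul_zero] at hineq
    nlinarith
  obtain ⟨M, hM⟩ : (Msup π Fstar ∩ ℳ).Nonempty := by rw [← card_pos]; exact_mod_cast hNF
  rw [mem_inter] at hM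
  -- the contradiction `|δ(U) ∩ M| = 1`
  exact hR1 U hU𝒰 M hM.2 (card_cut_eq_one hUall hUC' huv huw hvw hFpm
    (mem_union_left _ (mem_union_right _ (mem_singleton_self _))) hM.1)

/-- **Lemma 9, the count**: at most `3k` of the `3`-subsets `J` (i.e. of the `3`-sub-matchings
of `F`) give a good pair: every good `J` contains a `2`-subset of a fixed good `J*`.
[cite: Rothvoss2017, Lemma 9 (PDF p. 10: "`Pr[|H ∩ H*| ≥ 2] ≤ 3k / C(k,3)`")] -/
theorem card_good_le (hq : 0 < q) (hqe : Even q)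
    (hR1 : ∀ U ∈ 𝒰, ∀ M ∈ ℳ, (M.filter fun e => cutCount U e = 1).card ≠ 1) :
    (((univ : Finset (Fin 3 ⊕ Fin q)).powersetCard 3).filter fun J =>
        ∃ h : J.card = 3, Good μ ε 𝒰 ℳ (cdPerm (permOfJ J h) * π)).card ≤ 3 * (q + 3) := by
  set G := ((univ : Finset (Fin 3 ⊕ Fin q)).powersetCard 3).filter fun J =>
      ∃ h : J.card = 3, Good μ ε 𝒰 ℳ (cdPerm (permOfJ J h) * π) with hG
  rcases G.eq_empty_or_nonempty with h0 | ⟨Jstar, hJstar⟩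
  · rw [h0, card_empty]; exact Nat.zero_le _
  rw [hG, mem_filter] at hJstar
  obtain ⟨-, hJs3, hgs⟩ := hJstar
  -- every good `J` contains `J* ∖ {a}` for some `a ∈ J*`
  have hcover : G ⊆ Jstar.biUnion fun a => (univ : Finset (Fin 3 ⊕ Fin q)).image fun b => insert b (Jstar.erase a) := by
    intro J hJ
    rw [hG, mem_filter] at hJ
    obtain ⟨-, hJ3, hgJ⟩ := hJ
    rw [mem_biUnion]
    rcases two_le_card_inter_of_good hq hqe hR1 hJs3 hJ3 hgs hgJ with rfl | h2
    · obtain ⟨a, ha⟩ : Jstar.Nonempty := by rw [← card_pos, hJs3]; norm_num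
      exact ⟨a, ha, mem_image.2 ⟨a, mem_univ _, insert_erase ha⟩⟩
    · -- `|J* ∩ J| ≥ 2`: some `a ∈ J*` has `J* \\ {a} ⊆ J`, and `J = insert b (J* \\ {a})`
      have hsd : (Jstar \ J).card ≤ 1 := by
        have := card_sdiff_add_card_inter Jstar J
        omega
      obtain ⟨a, ha, hsub⟩ : ∃ a ∈ Jstar, Jstar.erase a ⊆ J := by
        rcases (Jstar \ J).eq_empty_or_nonempty with he | ⟨a, ha⟩
        · obtain ⟨a, ha⟩ : Jstar.Nonempty := by rw [← card_pos, hJs3]; norm_num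
          refine ⟨a, ha, fun x hx => ?_⟩
          have hx' := (mem_erase.1 hx).2
          by_contra hxJ
          have : x ∈ Jstar \ J := mem_sdiff.2 ⟨hx', hxJ⟩
          rw [he] at this
          simp at this
        · refine ⟨a, (mem_sdiff.1 ha).1, fun x hx => ?_⟩
          rw [mem_erase] at hx
          by_contra hxJ
          have hx' : x ∈ Jstar \ J := mem_sdiff.2 ⟨hx.2, hxJ⟩
          have : 1 < (Jstar \ J).card := one_lt_card.2 ⟨x, hx', a, ha, hx.1⟩
          omega
      refine ⟨a, ha, ?_⟩
      rw [mem_image]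
      -- `J = insert b (J*.erase a)` for the unique `b ∈ J \\ (J*.erase a)`
      have hcard : (J \ Jstar.erase a).card = 1 := by
        rw [card_sdiff_of_subset hsub, hJ3, card_erase_of_mem ha, hJs3]
      obtain ⟨b, hb⟩ := card_eq_one.1 hcard
      refine ⟨b, mem_univ _, ?_⟩
      rw [insert_eq, ← hb, sdiff_union_of_subset hsub]
  calc G.card ≤ (Jstar.biUnion fun a => (univ : Finset (Fin 3 ⊕ Fin q)).image
          fun b => insert b (Jstar.erase a)).card := card_le_card hcover
    _ ≤ ∑ a ∈ Jstar, ((univ : Finset (Fin 3 ⊕ Fin q)).image fun b => insert b (Jstar.erase a)).card :=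
        card_biUnion_le
    _ ≤ ∑ _a ∈ Jstar, (q + 3) := sum_le_sum fun a _ => card_image_le.trans (by simp [add_comm])
    _ = 3 * (q + 3) := by rw [sum_const, hJs3, smul_eq_mul]

end core

/-! ### The contribution of good pairs -/

section good

variable (μ : ℕ) (ε : ℝ) (𝒰 : Finset (Finset (Slot m q))) (ℳ : Finset (Finset (Sym2 (Slot m q))))

/-- `p^ex_U(F) · p^ex_M(F)` is invariant under re-indexing. [folklore] -/
theorem pUC_mul_pMF_cdPerm_mul (τ : Equiv.Perm (Fin 3 ⊕ Fin q)) (π : Equiv.Perm (Slot m q)) :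
    pUC μ 𝒰 (cdPerm τ * π) * pMF ℳ (cdPerm τ * π) = pUC μ 𝒰 π * pMF ℳ π := by
  rw [pUC, pUC, pMF, pMF, UexC_cdPerm_mul, MexF_cdPerm_mul]

/-- The re-indexing used for `J` (identity off the `3`-subsets). [folklore] -/
def psiJ (J : Finset (Fin 3 ⊕ Fin q)) : Equiv.Perm (Slot m q) :=
  if h : J.card = 3 then cdPerm (permOfJ J h) else 1

/-- `psiJ` on a `3`-subset. [folklore] -/
theorem psiJ_eq {J : Finset (Fin 3 ⊕ Fin q)} (h : J.card = 3) : (psiJ J : Equiv.Perm (Slot m q)) = cdPerm (permOfJ J h) := by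
  rw [psiJ, dif_pos h]

/-- **§3.4: the contribution of good pairs.** For a rectangle with `μ₁(ℛ) = 0`,
`Σ_π GOOD(π) · p^ex_U p^ex_M ≤ (1+ε)³ · (3k / C(k,3)) · Σ_π p^ex_U(F) p^ex_M(F)`.
[cite: Rothvoss2017, §3.4 (PDF p. 10)] -/
theorem sum_good_le (hε : 0 ≤ ε) (hq : 0 < q) (hqe : Even q) (hm : m = 2 * μ + 1)
    (hR1 : ∀ U ∈ 𝒰, ∀ M ∈ ℳ, (M.filter fun e => cutCount U e = 1).card ≠ 1) :
    ∑ π : Equiv.Perm (Slot m q), (if Good μ ε 𝒰 ℳ π then pU3 μ 𝒰 π * pM3 ℳ π else 0) ≤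
      (1 + ε) ^ 3 * ((3 * (q + 3) : ℝ) / Nat.choose (q + 3) 3) *
        ∑ π : Equiv.Perm (Slot m q), pUC μ 𝒰 π * pMF ℳ π := by
  set g : Equiv.Perm (Slot m q) → ℝ := fun π => pUC μ 𝒰 π * pMF ℳ π with hg
  have hg0 : ∀ π, 0 ≤ g π := fun π =>
    mul_nonneg (div_nonneg (Nat.cast_nonneg _) (Nat.cast_nonneg _)) (div_nonneg (Nat.cast_nonneg _) (Nat.cast_nonneg _))
  -- pointwise comparison
  have h1 : ∑ π : Equiv.Perm (Slot m q), (if Good μ ε 𝒰 ℳ π then pU3 μ 𝒰 π * pM3 ℳ π else 0) ≤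
      (1 + ε) ^ 3 * ∑ π : Equiv.Perm (Slot m q), (if Good μ ε 𝒰 ℳ π then g π else 0) := by
    rw [mul_sum]
    refine sum_le_sum fun π _ => ?_
    split_ifs with hgood
    · exact pU3_mul_pM3_le_of_Good hε hq hqe hm hgood
    · simp
  -- averaging over the `3`-subsets `J`
  set 𝒥 := (univ : Finset (Fin 3 ⊕ Fin q)).powersetCard 3 with h𝒥
  have h𝒥card : (𝒥.card : ℝ) = Nat.choose (q + 3) 3 := by
    rw [h𝒥, card_powersetCard, card_univ, Fintype.card_sum, Fintype.card_fin, Fintype.card_fin, add_comm]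
  have h𝒥pos : (0 : ℝ) < 𝒥.card := by
    rw [h𝒥card]; exact_mod_cast Nat.choose_pos (by omega)
  have hginv : ∀ (τ : Equiv.Perm (Fin 3 ⊕ Fin q)) (π : Equiv.Perm (Slot m q)), g (cdPerm τ * π) = g π := by
    intro τ π; simp only [hg]; exact pUC_mul_pMF_cdPerm_mul μ 𝒰 ℳ τ π
  have hreidx : ∀ J ∈ 𝒥, ∑ π : Equiv.Perm (Slot m q), (if Good μ ε 𝒰 ℳ π then g π else 0) =
      ∑ π : Equiv.Perm (Slot m q), (if Good μ ε 𝒰 ℳ (psiJ J * π) then g π else 0) := by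
    intro J hJ
    have hJ3 : J.card = 3 := (mem_powersetCard.1 hJ).2
    rw [← Equiv.sum_comp (Equiv.mulLeft (psiJ J))]
    refine sum_congr rfl fun π _ => ?_
    simp only [Equiv.coe_mulLeft]
    rw [psiJ_eq hJ3, hginv]
  have h2 : (𝒥.card : ℝ) * ∑ π : Equiv.Perm (Slot m q), (if Good μ ε 𝒰 ℳ π then g π else 0) =
      ∑ π : Equiv.Perm (Slot m q), g π * ((𝒥.filter fun J => Good μ ε 𝒰 ℳ (psiJ J * π)).card : ℝ) := by
    calc (𝒥.card : ℝ) * ∑ π : Equiv.Perm (Slot m q), (if Good μ ε 𝒰 ℳ π then g π else 0)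
        = ∑ J ∈ 𝒥, ∑ π : Equiv.Perm (Slot m q), (if Good μ ε 𝒰 ℳ (psiJ J * π) then g π else 0) := by
          rw [← sum_congr rfl hreidx, sum_const, nsmul_eq_mul]
      _ = ∑ π : Equiv.Perm (Slot m q), ∑ J ∈ 𝒥, (if Good μ ε 𝒰 ℳ (psiJ J * π) then g π else 0) := sum_comm
      _ = ∑ π : Equiv.Perm (Slot m q), g π * ((𝒥.filter fun J => Good μ ε 𝒰 ℳ (psiJ J * π)).card : ℝ) := by
          refine sum_congr rfl fun π _ => ?_
          rw [card_filter, Nat.cast_sum, mul_sum]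
          refine sum_congr rfl fun J _ => ?_
          split_ifs <;> simp
  -- Lemma 9 bounds the inner count by `3k`
  have h3 : ∀ π : Equiv.Perm (Slot m q),
      ((𝒥.filter fun J => Good μ ε 𝒰 ℳ (psiJ J * π)).card : ℝ) ≤ 3 * (q + 3) := by
    intro π
    have hle := card_good_le (μ := μ) (ε := ε) (𝒰 := 𝒰) (ℳ := ℳ) (π := π) hq hqe hR1
    have hsub : (𝒥.filter fun J => Good μ ε 𝒰 ℳ (psiJ J * π)) ⊆
        ((univ : Finset (Fin 3 ⊕ Fin q)).powersetCard 3).filter fun J =>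
          ∃ h : J.card = 3, Good μ ε 𝒰 ℳ (cdPerm (permOfJ J h) * π) := by
      intro J hJ
      rw [mem_filter] at hJ ⊢
      have hJ3 : J.card = 3 := (mem_powersetCard.1 hJ.1).2
      refine ⟨hJ.1, hJ3, ?_⟩
      have := hJ.2
      rw [psiJ_eq hJ3] at this
      exact this
    exact_mod_cast (card_le_card hsub).trans hle
  have h4 : (𝒥.card : ℝ) * ∑ π : Equiv.Perm (Slot m q), (if Good μ ε 𝒰 ℳ π then g π else 0) ≤
      (3 * (q + 3) : ℝ) * ∑ π : Equiv.Perm (Slot m q), g π := by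
    rw [h2, mul_sum]
    refine sum_le_sum fun π _ => ?_
    rw [mul_comm]
    exact mul_le_mul_of_nonneg_right (h3 π) (hg0 π)
  have h5 : ∑ π : Equiv.Perm (Slot m q), (if Good μ ε 𝒰 ℳ π then g π else 0) ≤
      ((3 * (q + 3) : ℝ) / Nat.choose (q + 3) 3) * ∑ π : Equiv.Perm (Slot m q), g π := by
    rw [← h𝒥card, div_mul_eq_mul_div, le_div_iff₀ h𝒥pos, mul_comm]
    exact h4
  calc ∑ π : Equiv.Perm (Slot m q), (if Good μ ε 𝒰 ℳ π then pU3 μ 𝒰 π * pM3 ℳ π else 0)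
      ≤ (1 + ε) ^ 3 * ∑ π : Equiv.Perm (Slot m q), (if Good μ ε 𝒰 ℳ π then g π else 0) := h1
    _ ≤ (1 + ε) ^ 3 * (((3 * (q + 3) : ℝ) / Nat.choose (q + 3) 3) * ∑ π : Equiv.Perm (Slot m q), g π) :=
        mul_le_mul_of_nonneg_left h5 (by positivity)
    _ = (1 + ε) ^ 3 * ((3 * (q + 3) : ℝ) / Nat.choose (q + 3) 3) *
        ∑ π : Equiv.Perm (Slot m q), pUC μ 𝒰 π * pMF ℳ π := by rw [hg]; ring

end good

end Literature.Barriers.PneNP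

end


/-! ## Part: `TSPExtensionComplexityRothvossExchange` -/

/-!
# Rothvoß §3.6: exchanging the expectations (bad pairs reduce to a per-`(U,M)` statement)

Support file for the discharge of `Literature.Barriers.PneNP.Rothvoss2017_tsp` (Rothvoß 2017,
§3.6, PDF p. 11): "In (8) we pick first the pair `(T,H)` and then `(U,M)`. Now we want to switch
the expectations … it suffices to prove that for each pair `(U,M) ∈ Q₃`, only an `ε`-fraction of
compatible partitions can be bad." In the slot model: since `|𝒰ex(π)|` and `|ℳex(π)|` do not
depend on `π` (`card_Uex3`, `card_Mex3_eq`), `E_π[BAD · p^ex_U · p^ex_M]` is a normalised count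
of compatible triples `(π, U, M)` with `BAD(π)`, and the per-pair hypothesis
`#{π compatible with (U,M) and bad} ≤ ε_b · #{π compatible with (U,M)}` sums to
`E_π[BAD · p^ex_U p^ex_M] ≤ ε_b · E_π[p^ex_U p^ex_M]` (`sum_bad_le`). The per-pair bound itself is
Lemmas 13–15 (sibling files). [cite: Rothvoss2017, §3.6 and Lemma 13 (PDF p. 11)]
-/

noncomputable section

open scoped Classical

namespace Literature.Barriers.PneNP

open Finset Slot

variable {m q : ℕ} (μ : ℕ) (ε θ : ℝ) (𝒰 : Finset (Finset (Slot m q))) (ℳ : Finset (Finset (Sym2 (Slot m q))))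

/-- **Exchange of expectations** (§3.6): a per-`(U,M)` bound on the fraction of bad compatible
partitions gives the same bound on the bad part of `μ₃(ℛ)`.
[cite: Rothvoss2017, §3.6, eq. (7)–(8) and Lemma 13 (PDF p. 11)] -/
theorem sum_bad_le (hq : 0 < q) {εb : ℝ}
    (hper : ∀ U ∈ 𝒰, ∀ M ∈ ℳ,
      ((univ.filter fun π : Equiv.Perm (Slot m q) =>
          (U ∈ Uex3 μ π ∧ M ∈ Mex3 π) ∧ Bad μ ε θ 𝒰 ℳ π).card : ℝ) ≤
        εb * ((univ.filter fun π : Equiv.Perm (Slot m q) => U ∈ Uex3 μ π ∧ M ∈ Mex3 π).card : ℝ)) :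
    ∑ π : Equiv.Perm (Slot m q), (if Bad μ ε θ 𝒰 ℳ π then pU3 μ 𝒰 π * pM3 ℳ π else 0) ≤
      εb * ∑ π : Equiv.Perm (Slot m q), pU3 μ 𝒰 π * pM3 ℳ π := by
  set NU : ℝ := (Nat.choose m (μ + 1) : ℝ) with hNU
  set NM : ℝ := ((Mex3 (1 : Equiv.Perm (Slot m q))).card : ℝ) with hNM
  have hU : ∀ π : Equiv.Perm (Slot m q), ((Uex3 μ π).card : ℝ) = NU := fun π => by
    rw [hNU]; exact_mod_cast card_Uex3 hq π
  have hM : ∀ π : Equiv.Perm (Slot m q), ((Mex3 π).card : ℝ) = NM := fun π => by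
    rw [hNM]; exact_mod_cast card_Mex3_eq π 1
  have hc : 0 ≤ NU * NM := by positivity
  -- both sides as sums of `f(π) |𝒰ex(π) ∩ 𝒰| |ℳex(π) ∩ ℳ|`
  have hL : ∀ π : Equiv.Perm (Slot m q), (if Bad μ ε θ 𝒰 ℳ π then pU3 μ 𝒰 π * pM3 ℳ π else 0) =
      ((if Bad μ ε θ 𝒰 ℳ π then (1 : ℝ) else 0) / (NU * NM)) * ((Uex3 μ π ∩ 𝒰).card : ℝ) * ((Mex3 π ∩ ℳ).card : ℝ) := by
    intro π
    split_ifs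
    · rw [pU3, pM3, hU, hM]; ring
    · simp
  have hR : ∀ π : Equiv.Perm (Slot m q), pU3 μ 𝒰 π * pM3 ℳ π =
      (1 / (NU * NM)) * ((Uex3 μ π ∩ 𝒰).card : ℝ) * ((Mex3 π ∩ ℳ).card : ℝ) := by
    intro π
    rw [pU3, pM3, hU, hM]; ring
  rw [sum_congr rfl fun π _ => hL π, sum_congr rfl fun π _ => hR π]
  rw [sum_mul_card_inter_eq (fun π => (if Bad μ ε θ 𝒰 ℳ π then (1 : ℝ) else 0) / (NU * NM)) (Uex3 μ) Mex3 𝒰 ℳ,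
    sum_mul_card_inter_eq (fun _ => 1 / (NU * NM)) (Uex3 μ) Mex3 𝒰 ℳ, mul_sum]
  refine sum_le_sum fun U hU𝒰 => ?_
  rw [mul_sum]
  refine sum_le_sum fun M hMℳ => ?_
  have h := hper U hU𝒰 M hMℳ
  rw [← sum_div, ← sum_div, sum_boole, sum_const, nsmul_eq_mul, mul_one, filter_filter]
  rw [mul_div_assoc']
  refine div_le_div_of_nonneg_right ?_ hc
  simpa [and_comm, and_assoc, and_left_comm] using h

end Literature.Barriers.PneNP

end
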